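import Literature.AlgebraicGeometry.Shioda1982.KoblitzOgusRelationsEighteenPrime
import Literature.AlgebraicGeometry.Shioda1982.HodgeQuadruplesSixPrime
import HarnessLib

/-!
# The pair-free Hodge `4`-multisets of level `18p` (`p ≥ 17` prime) in Chinese-remainder coordinates

Topic `Literature/AlgebraicGeometry/Shioda1982`; the level `m = 18p` of Shioda 1982, Lemma 1 / Prop. 4 (Q′) and Aoki–Shioda 1983,
Theorem (𝔅²ₘ) (ii): the first level of the tree's series (`2p, 3p, 4p, 8p, 2ʲp, 9p, 3ʲp, 6p, 12p, 24p`) at which `9 ∣ m` and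
`2 ∣ m`, with EXCEPTIONAL quadruples lifted from level `18` (Shioda's table p. 727 and Meyer–Neutsch's Tabelle 1, row `N = 18`:
the three orbits of `(1, 6, 14, 15)`, `(1, 7, 12, 16)`, `(1, 9, 12, 14)`). THEOREM (no named fact, no `sorry`):
**`classify_hodgeMultiset_eighteenPrime`** — a pair-free Hodge `4`-multiset `s` over `ℤ/18p`, `p ≥ 17` prime (`IsHodgeMultiset s`,
Shioda's semigroup condition), is `{x, x + 9p, −2x, 9p}`, `{x, x + 9p, 2x + 9p, −4x}` or `{x, x + 6p, x + 12p, −3x}` for some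
residue `x` (Shioda's `αᵢ, βᵢ` with `m′ = 9p` and `γⱼ` with `m″ = 6p`), or `{x, 6x, 14x, 15x}`, `{x, 7x, 12x, 16x}`,
`{x, 9x, 12x, 14x}` with `x = t·p`, `t ∈ {1, 5, 7, 11, 13, 17}` (the `18` multiples by `p` of the unit orbits of the three
exceptional quadruples of level `18`) [cite: Shioda1982PicardFermat, §4 Lemma 1 p. 728, Prop. 4 (Q′) p. 729, table p. 727];
[cite: AokiShioda1983, §2 Theorem (𝔅²ₘ) (ii) a)–c)]; [cite: MeyerNeutsch1981Fermatquadrupel, Tabelle 1 p. 54 (N = 18)]. The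
hypothesis `p ≥ 17` is sharp in the sense that at `p = 11, 13` the lifts of the exceptional quadruples of the levels `66 = 6·11`,
`78 = 6·13` are further pair-free Hodge quadruples of level `18p` (cell `pub-hfermat`, brute force, see below). Also public: the
transfer **`isHodgeMultiset_cast_eighteenPrime`** (a Hodge multiset of level `18p` without multiples of `3` reduces to one of
level `6p`).

## The proof (ours — Koblitz–Ogus in Chinese-remainder coordinates, the transfer to level `6p` and one norm estimate; NOT the printed argument)

Coordinates `ℤ/18p ≅ ℤ/18 × ℤ/p`, `w ↔ (u, c)` (`crtPt` of `KoblitzOgusRelationsEighteenPrime`); `k` = the number of members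
`(u, c)` of `s` with `3 ∣ u`; `Σ u = 0` forces `k ≠ 3`.
(F) All members in the fibre `c = 0`: the norm equations at the units `(τ, 1)` make `s/p` a pair-free Hodge quadruple of level `18`,
and those are enumerated by the kernel (`testLev_all`, a Boolean test on `(ℤ/18)³`, read back by `level_eighteen_forms`:
standard, or in one of the three exceptional orbits).
(T) `k = 4`: `s/3` (thirds of the representatives, reduced mod `6p`) is a pair-free Hodge quadruple of level `6p`
(`isHodgeMultiset_third`), classified by the tree's `classify_hodgeMultiset_sixPrime`; multiplying back gives
`α_{3z}, β_{3z}, γ_{3z}`.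
(R) The two Koblitz–Ogus relation families of the tree's `KoblitzOgusRelationsEighteenPrime` (`relOne/relTwo_eighteenPrime`:
for `c ≠ 0`, twelve-term identities among the odd counts `ô(u, c)`, `ô(u, 2c)`, `3 ∤ u`) are evaluated on explicit multisets
member by member (`cR1_cons`, `cR2_cons`: a member `(e, d)` contributes `A(e)([d = c] − [d = −c]) + B(e)([d = 2c] − [d = −2c])`
with the tables `A1, B1, A2, B2` mod `18`, all even in `e`). A member `(u, c)` with `3 ∤ u`, `c ≠ 0` is ISOLATED unless another
member lies in a fibre `±c, ±2c, ±c/2` (`B1, B2` do not vanish simultaneously off `3ℤ`), and two such members alone balance the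
relations only as a TWISTED pair `(u, c), (u, −c)` (`pair_closed`). `k = 2`: the two members prime to `3` have opposite residues
mod `3`, so they are not a twisted pair; if both are in the fibre `0` the other two are `(3v, ±c)` and the NORM LEMMA applies
(`norm_lemma`: if `s = {x, y, a, b}` with `a, b` in the fibre `0`, `x` not, then over the units `t = (1, δ)` the sum `⟨tx⟩ + ⟨ty⟩` is
constant while `tx` runs through a whole residue class mod `18` — impossible, one value lies below `⟨x + y⟩ ∈ [p, 17p]` and one
above; this is where `p ≥ 17` enters besides the level-`6p` theorem). `k = 1`: the three members prime to `3` have equal residues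
mod `3`; one or two of them visible is isolated or twisted (norm lemma again, after scaling by the unit `(5, 1)` if needed); three
visible have fibres `(c, c, c)` — then the tables leave only `γ` (`shape_ccc`) —, `(c, c, d)` with `d ∈ {−c, 2c, −2c}` — only
`(c, c, −2c)` survives, as `α` (`shape_ccg`) —, or pairwise distinct — excluded (`shape_cm2`, `k1_distinct`). `k = 0`: for a unit `u` of `ℤ/18p`
also `u(1 + 6p)`, `u(1 + 12p)` are units and `{uw, u(1+6p)w, u(1+12p)w} = uw + {0, 6p, 12p}` for `3 ∤ w`; adding the three norm
equations shows that `s mod 6p` is a Hodge quadruple of level `6p` (`isHodgeMultiset_cast_eighteenPrime`). If it is pair-free it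
is `β^{6p}` (types `α^{6p}, γ^{6p}` contain a multiple of `3`), and of the nine lifts with `Σ = 0` the relations at the fibres `f, f/2`
leave `β_x` (`fin_beta`, `k0_pairfree`); if it has a pair, `s = {(u₁, c), (u₂, −c), (u₃, d), (u₄, −d)}` with `u₁ + u₂ ∈ {6, 12}`, excluded by the
tables for `d` generic (`A, B` separate `u` from `u − 6, u − 12`: `fin_shift`) and for `d ∈ {±c, ±2c, ±c/2}` (`fin_pm_c`,
`fin_pm_2c`, `k0_pairs`). Only the non-coincidence of `i·d`, `j·d` in `ℤ/p` for `d ≠ 0`, `|i|, |j| ≤ 8` is used (`kb_ne`), whence `p ≥ 17`.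
Numerical companions (cell `pub-hfermat`, outside Lean): `code/lit/picard/table_vs_18p.py` (brute force from the definition at
`m = 306, 342, 414`: the pair-free Hodge quadruples are exactly the `402 / 450 / 546` standard ones `α, β, γ` and the `18` lifts, none
other; at `m = 198, 234` there are `30`, `32` others, of gcd `3`) and `cases18p.py` (the finite `ℤ/18` checks of this file, independently).

HONEST FRAMING (cell `pub-hfermat`): explicit algebraic cycles for specific Hodge classes on Fermat/Delsarte varieties; residual open
instances listed; no claim on general Hodge. (Surface classes are algebraic by Lefschetz (1,1); this file reproduces a printed
structure theorem at the levels `18p`; the proof route is this formalisation's.)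

## References
* [Shioda1982PicardFermat] T. Shioda, *On the Picard number of a Fermat surface*, J. Fac. Sci. Univ. Tokyo IA **28** (1982) 725–734,
  §4 Lemma 1 p. 728, Prop. 4 (Q′) p. 729, table p. 727 (row `m = 18`).
* [AokiShioda1983] N. Aoki, T. Shioda, *Generators of the Néron–Severi group of a Fermat surface*, Progr. Math. **35** (1983) 1–12,
  §2 Theorem (𝔅²ₘ) (ii).
* [MeyerNeutsch1981Fermatquadrupel] W. Meyer, W. Neutsch, *Fermatquadrupel*, Math. Ann. **256** (1981) 51–62, Tabelle 1 p. 54 (N = 18).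
* [Deligne1982HodgeCycles] P. Deligne, *Hodge cycles on abelian varieties*, LNM 900 (1982), Rem. 7.16 (a) (Koblitz–Ogus) — through
  `KoblitzOgusRelationsEighteenPrime`.
* [Aoki1983] N. Aoki, Math. Ann. **266** (1983) 23–54, Prop. 2.2.
* [Shioda1979PJA] T. Shioda, Proc. Japan Acad. **55A** (1979), §1 (2) (the Hodge condition).
-/

namespace Literature.AlgebraicGeometry.Shioda1982

open Finset Multiset
open Literature.AlgebraicGeometry.HodgeTheory Literature.AlgebraicGeometry.HodgeTheory.FermatCharacter

section EighteenPrime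

variable {p : ℕ}

set_option linter.unusedSimpArgs false -- uniform simp sets across the case analyses (as in `HodgeQuadruplesTwelvePrime`)

/-! ### `ℤ/18p ≅ ℤ/18 × ℤ/p`: Chinese-remainder coordinates -/

/-- `(18, p) = 1` for a prime `p ≥ 5`. [folklore] -/
private theorem coprime_eighteen (hp : p.Prime) (h5 : 5 ≤ p) : Nat.Coprime 18 p := by
  have h2 : Nat.Coprime 2 p := (Nat.coprime_primes Nat.prime_two hp).2 (by omega)
  have h3 : Nat.Coprime 3 p := (Nat.coprime_primes Nat.prime_three hp).2 (by omega)
  have h9 : Nat.Coprime 9 p := Nat.Coprime.mul_left h3 h3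
  exact Nat.Coprime.mul_left h2 h9

/-- The Chinese-remainder isomorphism `ℤ/18p ≃+* ℤ/18 × ℤ/p`. [folklore] -/
private def crt (h : Nat.Coprime 18 p) : ZMod (18 * p) ≃+* ZMod 18 × ZMod p := ZMod.chineseRemainder h

/-- `crtPt` is the inverse of `crt`. [folklore] -/
private theorem crtPt_eq (h : Nat.Coprime 18 p) (e : ZMod 18) (b : ZMod p) : crtPt h e b = (crt h).symm (e, b) := rfl

/-- First coordinate = residue mod `18`. [folklore] -/
private theorem crt_fst (h : Nat.Coprime 18 p) [NeZero (18 * p)] (w : ZMod (18 * p)) :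
    (crt h w).1 = (w.val : ZMod 18) := by
  conv_lhs => rw [← ZMod.natCast_zmod_val w]
  rw [map_natCast, Prod.fst_natCast]

/-- Second coordinate = residue mod `p`. [folklore] -/
private theorem crt_snd (h : Nat.Coprime 18 p) [NeZero (18 * p)] (w : ZMod (18 * p)) :
    (crt h w).2 = (w.val : ZMod p) := by
  conv_lhs => rw [← ZMod.natCast_zmod_val w]
  rw [map_natCast, Prod.snd_natCast]

/-- `crt (pt e b) = (e, b)`. [folklore] -/
private theorem crt_pt (h : Nat.Coprime 18 p) (e : ZMod 18) (b : ZMod p) : crt h (crtPt h e b) = (e, b) :=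
  (crt h).apply_symm_apply (e, b)

/-- `pt (crt w) = w`. [folklore] -/
private theorem pt_crt (h : Nat.Coprime 18 p) (w : ZMod (18 * p)) : crtPt h (crt h w).1 (crt h w).2 = w :=
  (crt h).symm_apply_apply w

/-- `pt` is injective. [folklore] -/
private theorem pt_inj (h : Nat.Coprime 18 p) {e e' : ZMod 18} {b b' : ZMod p} :
    crtPt h e b = crtPt h e' b' ↔ e = e' ∧ b = b' := by
  rw [crtPt_eq, crtPt_eq, (crt h).symm.injective.eq_iff, Prod.mk.injEq]

/-- `pt` is additive. [folklore] -/
private theorem pt_add (h : Nat.Coprime 18 p) (e e' : ZMod 18) (b b' : ZMod p) :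
    crtPt h e b + crtPt h e' b' = crtPt h (e + e') (b + b') := by
  rw [crtPt_eq, crtPt_eq, crtPt_eq, ← (crt h).symm.map_add, Prod.mk_add_mk]

/-- `pt` is multiplicative. [folklore] -/
private theorem pt_mul (h : Nat.Coprime 18 p) (e e' : ZMod 18) (b b' : ZMod p) :
    crtPt h e b * crtPt h e' b' = crtPt h (e * e') (b * b') := by
  rw [crtPt_eq, crtPt_eq, crtPt_eq, ← (crt h).symm.map_mul, Prod.mk_mul_mk]

/-- `pt` and negation. [folklore] -/
private theorem neg_pt (h : Nat.Coprime 18 p) (e : ZMod 18) (b : ZMod p) : -crtPt h e b = crtPt h (-e) (-b) := by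
  rw [crtPt_eq, crtPt_eq, ← (crt h).symm.map_neg, Prod.neg_mk]

/-- `pt 1 1 = 1`. [folklore] -/
private theorem pt_one (h : Nat.Coprime 18 p) : crtPt h 1 1 = 1 := by
  rw [crtPt_eq]
  exact _root_.map_one (crt h).symm

/-- `pt 0 0 = 0`. [folklore] -/
private theorem pt_zero (h : Nat.Coprime 18 p) : crtPt h 0 0 = 0 := by
  rw [crtPt_eq]
  exact _root_.map_zero (crt h).symm

/-- The coordinates of a natural number. [folklore] -/
private theorem crt_natCast (h : Nat.Coprime 18 p) (n : ℕ) : crt h n = ((n : ZMod 18), (n : ZMod p)) := by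
  rw [map_natCast]; rfl

/-- The residue mod `3` of the first coordinate is that of the representative. [folklore] -/
private theorem fst_val_mod_three (h : Nat.Coprime 18 p) [NeZero (18 * p)] (w : ZMod (18 * p)) :
    (crt h w).1.val % 3 = w.val % 3 := by
  rw [crt_fst, ZMod.val_natCast, Nat.mod_mod_of_dvd _ (by norm_num : 3 ∣ 18)]

/-- Non-coincidence of small multiples in `ℤ/p`: `i·b ≠ j·b` for `b ≠ 0`, `i ≠ j`, `|i|, |j| ≤ 8`, `p ≥ 17`. [folklore] -/
private theorem kb_ne (hp : p.Prime) (h17 : 17 ≤ p) {b : ZMod p} (hb : b ≠ 0) {i j : ℤ} (hij : i ≠ j) (hi : |i| ≤ 8)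
    (hj : |j| ≤ 8) : (i : ZMod p) * b ≠ (j : ZMod p) * b := by
  haveI := Fact.mk hp
  intro h
  have h1 : ((i - j : ℤ) : ZMod p) * b = 0 := by push_cast; linear_combination h
  rcases mul_eq_zero.1 h1 with h2 | h2
  · rw [ZMod.intCast_zmod_eq_zero_iff_dvd] at h2
    have h3 : (p : ℤ) ∣ |i - j| := (dvd_abs _ _).2 h2
    have h4 : |i - j| ≤ 16 := by
      have := abs_sub i j; omega
    have h5 : 0 < |i - j| := abs_pos.2 (sub_ne_zero.2 hij)
    have := Int.le_of_dvd h5 h3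
    omega
  · exact hb h2

/-! ### The odd counts in coordinates and the coefficient tables mod `18` -/

/-- The odd part of the multiplicity function of `T : Multiset (ℤ/18 × ℤ/p)`: `o(q) = #_q T − #_{−q} T`. [folklore] -/
private def oc (T : Multiset (ZMod 18 × ZMod p)) (q : ZMod 18 × ZMod p) : ℤ := (count q T : ℤ) - count (-q) T

/-- `oddCount s (pt e c)` is the odd part of `s.map crt` at `(e, c)`. [folklore] -/
private theorem oddCount_eq_oc (h : Nat.Coprime 18 p) (s : Multiset (ZMod (18 * p))) (e : ZMod 18) (c : ZMod p) :
    oddCount s (crtPt h e c) = oc (s.map (crt h)) (e, c) := by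
  classical
  have hc : ∀ q : ZMod 18 × ZMod p, count q (s.map (crt h)) = count ((crt h).symm q) s := fun q ↦ by
    rw [← Multiset.count_map_eq_count' _ _ (crt h).symm.injective, Multiset.map_map]
    simp only [Function.comp_def, RingEquiv.symm_apply_apply, Multiset.map_id']
  have hneg : -(crt h).symm (e, c) = (crt h).symm (-e, -c) := by rw [← map_neg, Prod.neg_mk]
  simp only [oddCount, oc, hc, crtPt_eq, hneg, Prod.neg_mk]

/-- The indicator `[k = e]` as an integer. [folklore] -/
private def ind (k e : ZMod 18) : ℤ := if k = e then 1 else 0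

/-- Table `A₁` (fibre-`c` part of the first relation): `−[5] + [7] + [11] − [13]`. [folklore] -/
private def A1 (e : ZMod 18) : ℤ := -ind 5 e + ind 7 e + ind 11 e - ind 13 e

/-- Table `B₁` (fibre-`2c` part of the first relation): `[1] + [4] − [5] − [8] − [10] − [13] + [14] + [17]`. [folklore] -/
private def B1 (e : ZMod 18) : ℤ := ind 1 e + ind 4 e - ind 5 e - ind 8 e - ind 10 e - ind 13 e + ind 14 e + ind 17 e

/-- Table `A₂` (fibre-`c` part of the second relation): `[1] − [5] − [13] + [17]`. [folklore] -/
private def A2 (e : ZMod 18) : ℤ := ind 1 e - ind 5 e - ind 13 e + ind 17 e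

/-- Table `B₂` (fibre-`2c` part of the second relation): `[1] + [2] − [7] − [8] − [10] − [11] + [16] + [17]`. [folklore] -/
private def B2 (e : ZMod 18) : ℤ := ind 1 e + ind 2 e - ind 7 e - ind 8 e - ind 10 e - ind 11 e + ind 16 e + ind 17 e

/-- The negatives of the residues mod `18` that occur in the tables. [folklore] -/
private theorem neg18 : (-(1 : ZMod 18)) = 17 ∧ (-(2 : ZMod 18)) = 16 ∧ (-(4 : ZMod 18)) = 14 ∧ (-(5 : ZMod 18)) = 13 ∧
    (-(7 : ZMod 18)) = 11 ∧ (-(8 : ZMod 18)) = 10 ∧ (-(10 : ZMod 18)) = 8 ∧ (-(11 : ZMod 18)) = 7 ∧ (-(13 : ZMod 18)) = 5 ∧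
    (-(14 : ZMod 18)) = 4 ∧ (-(16 : ZMod 18)) = 2 ∧ (-(17 : ZMod 18)) = 1 := by decide

/-- `[P ∧ Q] = [P]·[Q]`. [folklore] -/
private theorem ite_and_one {P Q : Prop} [Decidable P] [Decidable Q] :
    (if P ∧ Q then (1 : ℤ) else 0) = (if P then 1 else 0) * (if Q then 1 else 0) := by
  split_ifs <;> simp_all

variable (T : Multiset (ZMod 18 × ZMod p))

/-- The first relation in coordinates: `Σ_e A₁(e) o(e, c) + B₁(e) o(e, 2c)`, written out. [folklore] -/
private def cR1 (c : ZMod p) : ℤ :=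
  -oc T (5, c) + oc T (7, c) + oc T (11, c) - oc T (13, c) +
    oc T (1, 2 * c) + oc T (4, 2 * c) - oc T (5, 2 * c) - oc T (8, 2 * c) - oc T (10, 2 * c) - oc T (13, 2 * c) +
    oc T (14, 2 * c) + oc T (17, 2 * c)

/-- The second relation in coordinates. [folklore] -/
private def cR2 (c : ZMod p) : ℤ :=
  oc T (1, c) - oc T (5, c) - oc T (13, c) + oc T (17, c) +
    oc T (1, 2 * c) + oc T (2, 2 * c) - oc T (7, 2 * c) - oc T (8, 2 * c) - oc T (10, 2 * c) - oc T (11, 2 * c) +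
    oc T (16, 2 * c) + oc T (17, 2 * c)

/-- The two relation families on the coordinates of a Hodge multiset of level `18p`. [folklore] -/
private structure Rels (T : Multiset (ZMod 18 × ZMod p)) : Prop where
  rel1 : ∀ c : ZMod p, c ≠ 0 → cR1 T c = 0
  rel2 : ∀ c : ZMod p, c ≠ 0 → cR2 T c = 0

variable {T}

/-- **The relations `R¹_c`, `R²_c` for the coordinates of a Hodge multiset of level `18p`** (the tree's
`relOne/relTwo_eighteenPrime`). [cite: Deligne1982HodgeCycles, Rem. 7.16 (a)] [cite: Aoki1983, Prop. 2.2] -/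
private theorem rels_of_isHodgeMultiset (h : Nat.Coprime 18 p) [NeZero (18 * p)] (hp : p.Prime) (h5 : 5 ≤ p)
    {s : Multiset (ZMod (18 * p))} (hs : IsHodgeMultiset s) : Rels (s.map (crt h)) := by
  refine ⟨fun c hc ↦ ?_, fun c hc ↦ ?_⟩
  · have key := relOne_eighteenPrime hp h5 h hs hc
    simp only [oddCount_eq_oc] at key
    simpa [cR1] using key
  · have key := relTwo_eighteenPrime hp h5 h hs hc
    simp only [oddCount_eq_oc] at key
    simpa [cR2] using key

/-! ### Evaluating the relations on explicit multisets: member contributions -/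

/-- `o` of the empty multiset. [folklore] -/
private theorem oc_zero (q : ZMod 18 × ZMod p) : oc (0 : Multiset (ZMod 18 × ZMod p)) q = 0 := by simp [oc]

/-- `o` of `a ::ₘ T`. [folklore] -/
private theorem oc_cons (a : ZMod 18 × ZMod p) (T : Multiset (ZMod 18 × ZMod p)) (q : ZMod 18 × ZMod p) :
    oc (a ::ₘ T) q = oc T q + ((if q = a then 1 else 0) - (if -q = a then 1 else 0)) := by
  simp only [oc, Multiset.count_cons, Nat.cast_add, Nat.cast_ite, Nat.cast_one, Nat.cast_zero]
  ring

/-- The contribution of a member `(e, d)` at the parameter `c`: `A(e)([c = d] − [−c = d]) + B(e)([2c = d] − [−2c = d])`. [folklore] -/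
private def contrib (A B : ZMod 18 → ℤ) (c : ZMod p) (e : ZMod 18) (d : ZMod p) : ℤ :=
  A e * ((if c = d then 1 else 0) - (if -c = d then 1 else 0)) +
    B e * ((if 2 * c = d then 1 else 0) - (if -(2 * c) = d then 1 else 0))

/-- The contribution of a member `(e, d)` to `R¹(c)`. [folklore] -/
private theorem cR1_cons (e : ZMod 18) (d : ZMod p) (T : Multiset (ZMod 18 × ZMod p)) (c : ZMod p) :
    cR1 ((e, d) ::ₘ T) c = cR1 T c + contrib A1 B1 c e d := by
  obtain ⟨n1, n2, n4, n5, n7, n8, n10, n11, n13, n14, n16, n17⟩ := neg18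
  simp only [cR1, oc_cons, Prod.neg_mk, Prod.mk.injEq, ite_and_one, contrib, A1, B1, ind, n1, n2, n4, n5, n7, n8, n10, n11,
    n13, n14, n16, n17]
  ring

/-- The contribution of a member `(e, d)` to `R²(c)`. [folklore] -/
private theorem cR2_cons (e : ZMod 18) (d : ZMod p) (T : Multiset (ZMod 18 × ZMod p)) (c : ZMod p) :
    cR2 ((e, d) ::ₘ T) c = cR2 T c + contrib A2 B2 c e d := by
  obtain ⟨n1, n2, n4, n5, n7, n8, n10, n11, n13, n14, n16, n17⟩ := neg18
  simp only [cR2, oc_cons, Prod.neg_mk, Prod.mk.injEq, ite_and_one, contrib, A2, B2, ind, n1, n2, n4, n5, n7, n8, n10, n11,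
    n13, n14, n16, n17]
  ring

/-- The relations vanish on the empty multiset. [folklore] -/
private theorem cR_zero (c : ZMod p) :
    cR1 (0 : Multiset (ZMod 18 × ZMod p)) c = 0 ∧ cR2 (0 : Multiset (ZMod 18 × ZMod p)) c = 0 := by
  simp [cR1, cR2, oc_zero]

/-- `R¹`, `R²` of an explicit `4`-multiset as the sum of the four member contributions. [folklore] -/
private theorem cR_four (q₁ q₂ q₃ q₄ : ZMod 18 × ZMod p) (c : ZMod p) :
    cR1 ({q₁, q₂, q₃, q₄} : Multiset (ZMod 18 × ZMod p)) c =
        contrib A1 B1 c q₁.1 q₁.2 + contrib A1 B1 c q₂.1 q₂.2 + contrib A1 B1 c q₃.1 q₃.2 + contrib A1 B1 c q₄.1 q₄.2 ∧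
      cR2 ({q₁, q₂, q₃, q₄} : Multiset (ZMod 18 × ZMod p)) c =
        contrib A2 B2 c q₁.1 q₁.2 + contrib A2 B2 c q₂.1 q₂.2 + contrib A2 B2 c q₃.1 q₃.2 + contrib A2 B2 c q₄.1 q₄.2 := by
  obtain ⟨e₁, d₁⟩ := q₁; obtain ⟨e₂, d₂⟩ := q₂; obtain ⟨e₃, d₃⟩ := q₃; obtain ⟨e₄, d₄⟩ := q₄
  simp only [Multiset.insert_eq_cons, ← Multiset.cons_zero (e₄, d₄)]
  refine ⟨?_, ?_⟩
  · rw [cR1_cons, cR1_cons, cR1_cons, cR1_cons, (cR_zero c).1]; ring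
  · rw [cR2_cons, cR2_cons, cR2_cons, cR2_cons, (cR_zero c).2]; ring


/-! ### Evaluating a member contribution: the five fibre cases -/

/-- For `c ≠ 0` (`p ≥ 17`): the fibres `c, −c, 2c, −2c` are pairwise distinct. [folklore] -/
private theorem fib4 (hp : p.Prime) (h17 : 17 ≤ p) {c : ZMod p} (hc : c ≠ 0) :
    -c ≠ c ∧ 2 * c ≠ c ∧ -(2 * c) ≠ c ∧ 2 * c ≠ -c ∧ -(2 * c) ≠ -c ∧ -(2 * c) ≠ 2 * c := by
  have K : ∀ i j : ℤ, i ≠ j → |i| ≤ 8 → |j| ≤ 8 → (i : ZMod p) * c ≠ (j : ZMod p) * c :=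
    fun i j hij hi hj ↦ kb_ne hp h17 hc hij hi hj
  refine ⟨fun e ↦ K (-1) 1 (by norm_num) (by norm_num) (by norm_num) (by push_cast; linear_combination e),
    fun e ↦ K 2 1 (by norm_num) (by norm_num) (by norm_num) (by push_cast; linear_combination e),
    fun e ↦ K (-2) 1 (by norm_num) (by norm_num) (by norm_num) (by push_cast; linear_combination e),
    fun e ↦ K 2 (-1) (by norm_num) (by norm_num) (by norm_num) (by push_cast; linear_combination e),
    fun e ↦ K (-2) (-1) (by norm_num) (by norm_num) (by norm_num) (by push_cast; linear_combination e),
    fun e ↦ K (-2) 2 (by norm_num) (by norm_num) (by norm_num) (by push_cast; linear_combination e)⟩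

/-- A member in the fibre `c` contributes `A(e)`. [folklore] -/
private theorem contrib_fib (hp : p.Prime) (h17 : 17 ≤ p) {c : ZMod p} (hc : c ≠ 0) (A B : ZMod 18 → ℤ) (e : ZMod 18) :
    contrib A B c e c = A e ∧ contrib A B c e (-c) = -A e ∧ contrib A B c e (2 * c) = B e ∧
      contrib A B c e (-(2 * c)) = -B e := by
  obtain ⟨h1, h2, h3, h4, h5, h6⟩ := fib4 hp h17 hc
  simp only [contrib, if_true, if_neg h1, if_neg h2, if_neg h3, if_neg h1.symm, if_neg h4, if_neg h5,
    if_neg h2.symm, if_neg h4.symm, if_neg h6, if_neg h3.symm, if_neg h5.symm, if_neg h6.symm]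
  refine ⟨by ring, by ring, by ring, by ring⟩

/-- A member off the fibres `±c, ±2c` contributes nothing. [folklore] -/
private theorem contrib_off {c d : ZMod p} (A B : ZMod 18 → ℤ) (e : ZMod 18) (h1 : d ≠ c) (h2 : d ≠ -c) (h3 : d ≠ 2 * c)
    (h4 : d ≠ -(2 * c)) : contrib A B c e d = 0 := by
  simp only [contrib, if_neg (Ne.symm h1), if_neg (Ne.symm h2), if_neg (Ne.symm h3), if_neg (Ne.symm h4)]
  ring

/-- The tables vanish on the multiples of `3`. [folklore] -/
private theorem tables_three {e : ZMod 18} (he : e.val % 3 = 0) : A1 e = 0 ∧ B1 e = 0 ∧ A2 e = 0 ∧ B2 e = 0 := by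
  revert e; decide

/-- A member `(e, d)` with `3 ∣ e` contributes nothing, to either relation. [folklore] -/
private theorem contrib_three {e : ZMod 18} (he : e.val % 3 = 0) (c d : ZMod p) :
    contrib A1 B1 c e d = 0 ∧ contrib A2 B2 c e d = 0 := by
  obtain ⟨h1, h2, h3, h4⟩ := tables_three he
  simp only [contrib, h1, h2, h3, h4, zero_mul, add_zero, and_self]

/-- The tables `A₁, A₂` vanish on the even residues. [folklore] -/
private theorem tablesA_even {e : ZMod 18} (he : e.val % 2 = 0) : A1 e = 0 ∧ A2 e = 0 := by
  revert e; decide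

/-! ### Finite facts about the tables mod `18` (kernel enumerations) -/

/-- **Isolation.** `B₁, B₂` do not vanish simultaneously off `3ℤ/18`. [folklore] -/
private theorem tablesB_ne {e : ZMod 18} (he : e.val % 3 ≠ 0) : ¬ (B1 e = 0 ∧ B2 e = 0) := by
  revert e; decide

/-- `A₁, A₂` do not vanish simultaneously on the units. [folklore] -/
private theorem tablesA_ne {e : ZMod 18} (he : e.val % 3 ≠ 0) (ho : e.val % 2 = 1) : ¬ (A1 e = 0 ∧ A2 e = 0) := by
  revert e; decide

set_option synthInstance.maxHeartbeats 0 in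
set_option synthInstance.maxSize 4096 in
/-- **Twisted pairs.** Two members `(u₁, c)`, `(u₂, −c)` prime to `3` balance the relations at `c` and `c/2` only if `u₁ = u₂`
(a genuine pair `u₂ = −u₁` being excluded). [folklore] -/
private theorem fin_pair_neg : ∀ u₁ u₂ : ZMod 18, u₁.val % 3 ≠ 0 → u₂.val % 3 ≠ 0 → u₁ + u₂ ≠ 0 →
    A1 u₁ - A1 u₂ = 0 → A2 u₁ - A2 u₂ = 0 → B1 u₁ - B1 u₂ = 0 → B2 u₁ - B2 u₂ = 0 → u₁ = u₂ := by
  decide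

set_option synthInstance.maxHeartbeats 0 in
set_option synthInstance.maxSize 4096 in
/-- Two members `(u₁, c)`, `(u₂, c)` prime to `3` never balance the relations at `c` and `c/2`. [folklore] -/
private theorem fin_pair_pos : ∀ u₁ u₂ : ZMod 18, u₁.val % 3 ≠ 0 → u₂.val % 3 ≠ 0 →
    A1 u₁ + A1 u₂ = 0 → A2 u₁ + A2 u₂ = 0 → B1 u₁ + B1 u₂ = 0 → B2 u₁ + B2 u₂ = 0 → False := by
  decide

set_option synthInstance.maxHeartbeats 0 in
set_option synthInstance.maxSize 4096 in
/-- Two members `(u₁, c)`, `(u₂, 2c)` prime to `3` never balance the relations at `c/2`, `c`, `2c`. [folklore] -/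
private theorem fin_pair_two : ∀ u₁ u₂ : ZMod 18, u₁.val % 3 ≠ 0 → u₂.val % 3 ≠ 0 →
    B1 u₁ = 0 → B2 u₁ = 0 → False := by
  decide

set_option synthInstance.maxHeartbeats 0 in
set_option synthInstance.maxSize 4096 in
/-- **Shape `(c, c, c)`** (three members prime to `3` with equal residues mod `3` in one fibre): only `{u, u + 6, u + 12}` (`γ`).
[folklore] -/
private theorem fin_ccc : ∀ u₁ u₂ u₃ : ZMod 18, u₁.val % 3 ≠ 0 → u₁.val % 3 = u₂.val % 3 → u₁.val % 3 = u₃.val % 3 →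
    A1 u₁ + A1 u₂ + A1 u₃ = 0 → A2 u₁ + A2 u₂ + A2 u₃ = 0 → B1 u₁ + B1 u₂ + B1 u₃ = 0 → B2 u₁ + B2 u₂ + B2 u₃ = 0 →
    (u₂ = u₁ + 6 ∧ u₃ = u₁ + 12) ∨ (u₂ = u₁ + 12 ∧ u₃ = u₁ + 6) := by
  decide

set_option synthInstance.maxHeartbeats 0 in
set_option synthInstance.maxSize 4096 in
/-- **Shape `(c, c, −2c)`**: only `{u, u + 9}` at `c` and `−2u` at `−2c` (`α`). [folklore] -/
private theorem fin_ccm2 : ∀ u₁ u₂ u₃ : ZMod 18, u₁.val % 3 ≠ 0 → u₁.val % 3 = u₂.val % 3 → u₁.val % 3 = u₃.val % 3 →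
    A1 u₁ + A1 u₂ - B1 u₃ = 0 → A2 u₁ + A2 u₂ - B2 u₃ = 0 → B1 u₁ + B1 u₂ = 0 → B2 u₁ + B2 u₂ = 0 → A1 u₃ = 0 → A2 u₃ = 0 →
    u₂ = u₁ + 9 ∧ u₃ = -(2 * u₁) := by
  decide

set_option synthInstance.maxHeartbeats 0 in
set_option synthInstance.maxSize 4096 in
/-- **Shape `(c, c, −c)`**: excluded. [folklore] -/
private theorem fin_ccm1 : ∀ u₁ u₂ u₃ : ZMod 18, u₁.val % 3 ≠ 0 → u₁.val % 3 = u₂.val % 3 → u₁.val % 3 = u₃.val % 3 →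
    A1 u₁ + A1 u₂ - A1 u₃ = 0 → A2 u₁ + A2 u₂ - A2 u₃ = 0 → B1 u₁ + B1 u₂ - B1 u₃ = 0 → B2 u₁ + B2 u₂ - B2 u₃ = 0 → False := by
  decide

set_option synthInstance.maxHeartbeats 0 in
set_option synthInstance.maxSize 4096 in
/-- **Shape `(c, c, 2c)`**: excluded. [folklore] -/
private theorem fin_cc2 : ∀ u₁ u₂ u₃ : ZMod 18, u₁.val % 3 ≠ 0 → u₁.val % 3 = u₂.val % 3 → u₁.val % 3 = u₃.val % 3 →
    A1 u₁ + A1 u₂ + B1 u₃ = 0 → A2 u₁ + A2 u₂ + B2 u₃ = 0 → B1 u₁ + B1 u₂ = 0 → B2 u₁ + B2 u₂ = 0 → A1 u₃ = 0 → A2 u₃ = 0 →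
    False := by
  decide

set_option synthInstance.maxHeartbeats 0 in
set_option synthInstance.maxSize 4096 in
/-- **Shape `(c, −c, 2c)`**: excluded. [folklore] -/
private theorem fin_cm2 : ∀ u₁ u₂ u₃ : ZMod 18, u₁.val % 3 ≠ 0 → u₁.val % 3 = u₂.val % 3 → u₁.val % 3 = u₃.val % 3 →
    A1 u₁ - A1 u₂ + B1 u₃ = 0 → A2 u₁ - A2 u₂ + B2 u₃ = 0 → B1 u₁ - B1 u₂ = 0 → B2 u₁ - B2 u₂ = 0 → A1 u₃ = 0 → A2 u₃ = 0 →
    False := by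
  decide

set_option synthInstance.maxHeartbeats 0 in
set_option synthInstance.maxSize 4096 in
/-- **The lifts of `β^{6p}`** (`k = 0`): members `(u, f), (u + 9 + e₂, f), (2u + 9 + e₃, 2f), (−4u + e₄, −4f)` with
`eᵢ ∈ {0, 6, 12}`, `Σ eᵢ = 0`; the relations at `f` and `f/2` force `e₂ = e₃ = 0`. [folklore] -/
private theorem fin_beta : ∀ u e₂ e₃ : ZMod 18, u.val % 3 ≠ 0 → (e₂ = 0 ∨ e₂ = 6 ∨ e₂ = 12) → (e₃ = 0 ∨ e₃ = 6 ∨ e₃ = 12) →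
    A1 u + A1 (u + 9 + e₂) + B1 (2 * u + 9 + e₃) = 0 → A2 u + A2 (u + 9 + e₂) + B2 (2 * u + 9 + e₃) = 0 →
    B1 u + B1 (u + 9 + e₂) = 0 → B2 u + B2 (u + 9 + e₂) = 0 → e₂ = 0 ∧ e₃ = 0 := by
  decide

set_option synthInstance.maxHeartbeats 0 in
set_option synthInstance.maxSize 4096 in
/-- **Shift by `6`** (`k = 0`, a pair mod `6p` but not mod `18p`): the tables separate `u` from `u − 6`, `u − 12`. [folklore] -/
private theorem fin_shift : ∀ u₁ u₂ : ZMod 18, u₁.val % 3 ≠ 0 → (u₁ + u₂ = 6 ∨ u₁ + u₂ = 12) →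
    A1 u₁ - A1 u₂ = 0 → A2 u₁ - A2 u₂ = 0 → B1 u₁ - B1 u₂ = 0 → B2 u₁ - B2 u₂ = 0 → False := by
  decide

/-- The tables are even. [folklore] -/
private theorem tables_even : ∀ e : ZMod 18, A1 (-e) = A1 e ∧ A2 (-e) = A2 e ∧ B1 (-e) = B1 e ∧ B2 (-e) = B2 e := by
  decide

set_option synthInstance.maxHeartbeats 0 in
set_option synthInstance.maxSize 4096 in
/-- **Shape `{(u₁, c), (u₂, −c), (u₃, c), (u₄, −c)}`** with `u₁ + u₂, u₃ + u₄ ∈ {6, 12}` (`k = 0`): excluded. [folklore] -/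
private theorem fin_pm_c : ∀ u₁ u₂ u₃ : ZMod 18, u₁.val % 3 ≠ 0 → u₂.val % 3 ≠ 0 → u₃.val % 3 ≠ 0 →
    (-(u₁ + u₂ + u₃)).val % 3 ≠ 0 → (u₁ + u₂ = 6 ∨ u₁ + u₂ = 12) → u₁ - (u₁ + u₂ + u₃) ≠ 0 → u₃ + u₂ ≠ 0 →
    A1 u₁ - A1 u₂ + A1 u₃ - A1 (u₁ + u₂ + u₃) = 0 → A2 u₁ - A2 u₂ + A2 u₃ - A2 (u₁ + u₂ + u₃) = 0 →
    B1 u₁ - B1 u₂ + B1 u₃ - B1 (u₁ + u₂ + u₃) = 0 → B2 u₁ - B2 u₂ + B2 u₃ - B2 (u₁ + u₂ + u₃) = 0 → False := by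
  decide

set_option synthInstance.maxHeartbeats 0 in
set_option synthInstance.maxSize 4096 in
/-- **Shape `{(u₁, c), (u₂, −c), (u₃, 2c), (u₄, −2c)}`** with `u₁ + u₂ ∈ {6, 12}` (`k = 0`): excluded. [folklore] -/
private theorem fin_pm_2c : ∀ u₁ u₂ u₃ : ZMod 18, u₁.val % 3 ≠ 0 → u₂.val % 3 ≠ 0 → u₃.val % 3 ≠ 0 →
    (-(u₁ + u₂ + u₃)).val % 3 ≠ 0 → (u₁ + u₂ = 6 ∨ u₁ + u₂ = 12) → u₃ - (u₁ + u₂ + u₃) ≠ 0 →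
    A1 u₁ - A1 u₂ + B1 u₃ - B1 (u₁ + u₂ + u₃) = 0 → A2 u₁ - A2 u₂ + B2 u₃ - B2 (u₁ + u₂ + u₃) = 0 →
    B1 u₁ - B1 u₂ = 0 → B2 u₁ - B2 u₂ = 0 → A1 u₃ - A1 (u₁ + u₂ + u₃) = 0 → A2 u₃ - A2 (u₁ + u₂ + u₃) = 0 → False := by
  decide


/-! ### Hodge multisets: scaling by a unit, the norm of an explicit quadruple -/

/-- **Scaling by a unit preserves Hodge multisets** (the defining conditions are invariant under `(ℤ/m)ˣ`).
[cite: Shioda1979PJA, §1 eq. (2)] -/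
private theorem isHodgeMultiset_map_mul {n : ℕ} {s : Multiset (ZMod n)} (hs : IsHodgeMultiset s) (u : (ZMod n)ˣ) :
    IsHodgeMultiset (s.map fun w ↦ (u : ZMod n) * w) := by
  refine ⟨⟨fun a ha ↦ ?_, ?_⟩, fun t ↦ ?_⟩
  · obtain ⟨w, hw, rfl⟩ := Multiset.mem_map.mp ha
    exact (Units.mul_right_eq_zero u).not.mpr (hs.1.1 w hw)
  · rw [Multiset.sum_map_mul_left, Multiset.map_id', hs.1.2, mul_zero]
  · have h := hs.2 (t * u)
    rw [Multiset.map_map, Multiset.card_map]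
    have e : ((fun a ↦ (t : ZMod n) * a) ∘ fun w ↦ (u : ZMod n) * w) = fun w ↦ ((t * u : (ZMod n)ˣ) : ZMod n) * w := by
      funext w; simp [mul_assoc]
    rw [e]; exact h

/-- The norm sum of an explicit quadruple. [folklore] -/
private theorem mNormSum_four {n : ℕ} (x y a b : ZMod n) :
    mNormSum ({x, y, a, b} : Multiset (ZMod n)) = x.val + y.val + a.val + b.val := by
  simp only [mNormSum, Multiset.insert_eq_cons, Multiset.map_cons, Multiset.map_singleton, Multiset.sum_cons,
    Multiset.sum_singleton]
  ring

/-- The norm sum of a singleton. [folklore] -/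
private theorem mNormSum_singleton {n : ℕ} (x : ZMod n) : mNormSum ({x} : Multiset (ZMod n)) = x.val := by
  simp [mNormSum]

/-- `⟨w₁⟩ + ⟨w₂⟩` is `⟨w₁ + w₂⟩` or `⟨w₁ + w₂⟩ + n`; in the first case `⟨w₁⟩ ≤ ⟨w₁ + w₂⟩`, in the second `⟨w₁⟩ > ⟨w₁ + w₂⟩`.
[folklore] -/
private theorem val_add_cases {n : ℕ} [NeZero n] (w₁ w₂ : ZMod n) :
    (w₁.val + w₂.val = (w₁ + w₂).val ∧ w₁.val ≤ (w₁ + w₂).val) ∨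
      (w₁.val + w₂.val = (w₁ + w₂).val + n ∧ (w₁ + w₂).val < w₁.val) := by
  have h := ZMod.val_add w₁ w₂
  have h1 := ZMod.val_lt w₁
  have h2 := ZMod.val_lt w₂
  have hn : 0 < n := Nat.pos_of_ne_zero (NeZero.ne n)
  by_cases hlt : w₁.val + w₂.val < n
  · left
    rw [Nat.mod_eq_of_lt hlt] at h
    omega
  · right
    rw [Nat.mod_eq_sub_mod (by omega), Nat.mod_eq_of_lt (by omega)] at h
    omega

/-! ### The norm lemma: two members in the fibre `0`, one outside -/

/-- `pt 1 δ` is a unit for `δ ≠ 0`. [folklore] -/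
private theorem isUnit_pt_one (h : Nat.Coprime 18 p) (hp : p.Prime) {δ : ZMod p} (hδ : δ ≠ 0) : IsUnit (crtPt h 1 δ) := by
  haveI := Fact.mk hp
  exact IsUnit.of_mul_eq_one (crtPt h 1 δ⁻¹) (by rw [pt_mul, one_mul, mul_inv_cancel₀ hδ, pt_one])

/-- `pt 1 δ` fixes the fibre `0`. [folklore] -/
private theorem pt_one_mul_fibre (h : Nat.Coprime 18 p) [NeZero (18 * p)] (δ : ZMod p) {a : ZMod (18 * p)}
    (ha : (crt h a).2 = 0) : crtPt h 1 δ * a = a := by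
  conv_lhs => rw [← pt_crt h a, ha, pt_mul, one_mul, mul_zero]
  conv_rhs => rw [← pt_crt h a, ha]

/-- `pt 1 δ · x` is the residue with coordinates `(x₁, δ x₂)`; choosing `δ = n/x₂` makes it the natural number `n ≡ x₁ (18)`. [folklore] -/
private theorem pt_one_mul_eq_natCast (h : Nat.Coprime 18 p) [NeZero (18 * p)] (hp : p.Prime) {x : ZMod (18 * p)}
    (hx : (crt h x).2 ≠ 0) {n : ℕ} (hn : (n : ZMod 18) = (crt h x).1) :
    crtPt h 1 ((n : ZMod p) * ((crt h x).2)⁻¹) * x = n := by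
  haveI := Fact.mk hp
  apply (crt h).injective
  rw [_root_.map_mul, crt_pt, crt_natCast, hn]
  conv_lhs => rw [← pt_crt h x, crt_pt]
  rw [Prod.mk_mul_mk, one_mul, inv_mul_cancel_right₀ hx]

/-- A non-zero residue in the fibre `0` has representative in `[p, 17p]`. [folklore] -/
private theorem val_bounds_fibre (h : Nat.Coprime 18 p) [NeZero (18 * p)] {z : ZMod (18 * p)} (hz : z ≠ 0)
    (hz0 : (crt h z).2 = 0) : p ≤ z.val ∧ z.val ≤ 17 * p := by
  rw [crt_snd, ZMod.natCast_eq_zero_iff] at hz0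
  obtain ⟨q, hq⟩ := hz0
  have hlt := ZMod.val_lt z
  have hne : z.val ≠ 0 := fun e ↦ hz ((ZMod.val_eq_zero z).mp e)
  have hq1 : 1 ≤ q := by
    rcases Nat.eq_zero_or_pos q with rfl | hq0
    · rw [mul_zero] at hq; exact absurd hq hne
    · exact hq0
  have hq2 : q ≤ 17 := by
    by_contra hc
    have : p * 18 ≤ p * q := Nat.mul_le_mul_left p (by omega)
    omega
  constructor
  · calc p = p * 1 := (mul_one p).symm
      _ ≤ p * q := Nat.mul_le_mul_left p hq1
      _ = z.val := hq.symm
  · calc z.val = p * q := hq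
      _ ≤ p * 17 := Nat.mul_le_mul_left p hq2
      _ = 17 * p := mul_comm _ _

/-- **The norm lemma.** A Hodge multiset `{x, y, a, b}` of level `18p`, `p ≥ 17`, with `a, b` in the fibre `0` (multiples of `p`),
`x` outside it, `x + y ≠ 0`, and first coordinate of `x` with representative in `[2, 16]`, does not exist: over the units
`t = (1, δ)` the sum `⟨tx⟩ + ⟨ty⟩` is constant (`t` fixes `a, b`) and `≡ ⟨x + y⟩ ∈ [p, 17p]` modulo `18p`, while `⟨tx⟩` takes
the value `x₁ ≤ 16 < p` (so the sum is `⟨x + y⟩`) and the value `x₁ + 18(p − 1) > 17p` (so it is `⟨x + y⟩ + 18p`).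
[cite: Shioda1979PJA, §1 eq. (2)] -/
private theorem norm_lemma (h : Nat.Coprime 18 p) [NeZero (18 * p)] (hp : p.Prime) (h17 : 17 ≤ p)
    {s : Multiset (ZMod (18 * p))} (hs : IsHodgeMultiset s) {x y a b : ZMod (18 * p)} (hsx : s = {x, y, a, b})
    (ha : (crt h a).2 = 0) (hb : (crt h b).2 = 0) (hx : (crt h x).2 ≠ 0) (hlo : 2 ≤ (crt h x).1.val)
    (hhi : (crt h x).1.val ≤ 16) (hxy : x + y ≠ 0) : False := by
  classical
  haveI := Fact.mk hp
  set z := x + y with hz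
  -- `z` lies in the fibre `0`
  have hsum := hs.1.2
  rw [hsx] at hsum
  simp only [Multiset.insert_eq_cons, Multiset.sum_cons, Multiset.sum_singleton] at hsum
  have hz0 : (crt h z).2 = 0 := by
    have e : z = -(a + b) := by rw [hz]; linear_combination hsum
    rw [e, _root_.map_neg, _root_.map_add, Prod.snd_neg, Prod.snd_add, ha, hb, add_zero, neg_zero]
  obtain ⟨hzlo, hzhi⟩ := val_bounds_fibre h hxy hz0
  -- the norm at `t = (1, δ)`: `⟨tx⟩ + ⟨ty⟩ = ⟨x⟩ + ⟨y⟩`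
  have key : ∀ δ : ZMod p, δ ≠ 0 →
      (crtPt h 1 δ * x).val + (crtPt h 1 δ * y).val = x.val + y.val := by
    intro δ hδ
    obtain ⟨t, ht⟩ := isUnit_pt_one h hp hδ
    have n1 := hs.2 1
    have nt := hs.2 t
    rw [hsx] at n1 nt
    simp only [Units.val_one, one_mul, Multiset.map_id', Multiset.insert_eq_cons, Multiset.map_cons,
      Multiset.map_singleton, Multiset.card_cons, Multiset.card_singleton, ht] at n1 nt
    have e4 : mNormSum (crtPt h 1 δ * x ::ₘ crtPt h 1 δ * y ::ₘ crtPt h 1 δ * a ::ₘ {crtPt h 1 δ * b}) =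
        (crtPt h 1 δ * x).val + (crtPt h 1 δ * y).val + a.val + b.val := by
      rw [pt_one_mul_fibre h δ ha, pt_one_mul_fibre h δ hb]; exact mNormSum_four _ _ _ _
    have e1 : mNormSum (x ::ₘ y ::ₘ a ::ₘ {b}) = x.val + y.val + a.val + b.val := mNormSum_four _ _ _ _
    rw [e4] at nt
    rw [e1] at n1
    omega
  have tz : ∀ δ : ZMod p, crtPt h 1 δ * x + crtPt h 1 δ * y = z := fun δ ↦ by
    rw [← mul_add, ← hz, pt_one_mul_fibre h δ hz0]
  -- the low value `x₁`
  set n₁ := (crt h x).1.val with hn₁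
  have hn18 : (n₁ : ZMod 18) = (crt h x).1 := ZMod.natCast_zmod_val _
  have hp18 : 18 * p = 18 * p := rfl
  have hlt18p : n₁ < 18 * p := by omega
  have hδlo : ((n₁ : ZMod p) * ((crt h x).2)⁻¹) ≠ 0 := by
    refine mul_ne_zero ?_ (inv_ne_zero hx)
    rw [Ne, ZMod.natCast_eq_zero_iff]
    intro hd; have := Nat.le_of_dvd (by omega) hd; omega
  have hlo_eq := key _ hδlo
  have hlo_x : crtPt h 1 ((n₁ : ZMod p) * ((crt h x).2)⁻¹) * x = n₁ := pt_one_mul_eq_natCast h hp hx hn18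
  have hlo_val : (crtPt h 1 ((n₁ : ZMod p) * ((crt h x).2)⁻¹) * x).val = n₁ := by
    rw [hlo_x, ZMod.val_natCast, Nat.mod_eq_of_lt hlt18p]
  have hxyz : x.val + y.val = z.val := by
    rcases val_add_cases (crtPt h 1 ((n₁ : ZMod p) * ((crt h x).2)⁻¹) * x)
        (crtPt h 1 ((n₁ : ZMod p) * ((crt h x).2)⁻¹) * y) with ⟨e, _⟩ | ⟨_, hgt⟩
    · rw [tz] at e; omega
    · rw [tz] at hgt; omega
  -- the high value `x₁ + 18(p − 1)`
  set n₂ := n₁ + 18 * (p - 1) with hn₂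
  have hn₂18 : (n₂ : ZMod 18) = (crt h x).1 := by
    rw [hn₂, Nat.cast_add, Nat.cast_mul, show ((18 : ℕ) : ZMod 18) = 0 from rfl, zero_mul, add_zero, hn18]
  have hlt18p₂ : n₂ < 18 * p := by omega
  have hδhi : ((n₂ : ZMod p) * ((crt h x).2)⁻¹) ≠ 0 := by
    refine mul_ne_zero ?_ (inv_ne_zero hx)
    rw [Ne, ZMod.natCast_eq_zero_iff]
    intro hd
    have h18p : 18 * p = n₂ + (18 - n₁) := by omega
    have hd' : p ∣ 18 - n₁ := (Nat.dvd_add_right hd).mp (h18p ▸ dvd_mul_left p 18)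
    have := Nat.le_of_dvd (by omega) hd'
    omega
  have hhi_eq := key _ hδhi
  have hhi_x : crtPt h 1 ((n₂ : ZMod p) * ((crt h x).2)⁻¹) * x = n₂ := pt_one_mul_eq_natCast h hp hx hn₂18
  have hhi_val : (crtPt h 1 ((n₂ : ZMod p) * ((crt h x).2)⁻¹) * x).val = n₂ := by
    rw [hhi_x, ZMod.val_natCast, Nat.mod_eq_of_lt hlt18p₂]
  rcases val_add_cases (crtPt h 1 ((n₂ : ZMod p) * ((crt h x).2)⁻¹) * x)
      (crtPt h 1 ((n₂ : ZMod p) * ((crt h x).2)⁻¹) * y) with ⟨_, hle⟩ | ⟨e, _⟩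
  · rw [tz] at hle; omega
  · rw [tz] at e; omega


/-! ### The elements `9p`, `6p` and the reduction modulo `6p` -/

local notation "K18" => (((9 * p : ℕ)) : ZMod (18 * p))
local notation "D18" => (((6 * p : ℕ)) : ZMod (18 * p))
local notation "K6" => (((3 * p : ℕ)) : ZMod (6 * p))
local notation "D6" => (((2 * p : ℕ)) : ZMod (6 * p))

/-- `⟨6p⟩ = 6p`. [folklore] -/
private theorem val_D (hp : 0 < p) : (D18).val = 6 * p := by
  rw [ZMod.val_natCast, Nat.mod_eq_of_lt (by omega)]

/-- `3 · 6p = 0`. [folklore] -/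
private theorem three_mul_D : (3 : ZMod (18 * p)) * D18 = 0 := by
  have : (3 : ZMod (18 * p)) * D18 = (((18 * p : ℕ)) : ZMod (18 * p)) := by push_cast; ring
  rw [this, ZMod.natCast_self]

/-- `6p · 6p = 0`. [folklore] -/
private theorem D_mul_D : (D18 : ZMod (18 * p)) * D18 = 0 := by
  have : (D18 : ZMod (18 * p)) * D18 = (2 * p : ℕ) * (((18 * p : ℕ)) : ZMod (18 * p)) := by push_cast; ring
  rw [this, ZMod.natCast_self, mul_zero]

/-- `6p · x = (⟨x⟩ mod 3) · 6p`. [folklore] -/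
private theorem D_mul [NeZero (18 * p)] (x : ZMod (18 * p)) : D18 * x = ((x.val % 3 : ℕ) : ZMod (18 * p)) * D18 := by
  have e : x = ((x.val : ℕ) : ZMod (18 * p)) := (ZMod.natCast_zmod_val x).symm
  have hd := Nat.div_add_mod x.val 3
  have h3 := three_mul_D (p := p)
  push_cast at h3
  conv_lhs => rw [e, ← hd]
  push_cast
  linear_combination (↑(x.val / 3) : ZMod (18 * p)) * h3

/-- `(1 + 6p)(1 + 12p) = 1`: both are units. [folklore] -/
private theorem one_add_D_mul : (1 + D18 : ZMod (18 * p)) * (1 + 2 * D18) = 1 := by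
  linear_combination (2 : ZMod (18 * p)) * D_mul_D (p := p) + three_mul_D (p := p)

/-- `(1 + 12p)(1 + 6p) = 1`. [folklore] -/
private theorem one_add_D_mul' : (1 + 2 * D18 : ZMod (18 * p)) * (1 + D18) = 1 := by
  linear_combination one_add_D_mul (p := p)

/-- The representative of the reduction modulo `6p`. [folklore] -/
private theorem val_castHom [NeZero (18 * p)] (hnm : 6 * p ∣ 18 * p) (y : ZMod (18 * p)) :
    (ZMod.castHom hnm (ZMod (6 * p)) y).val = y.val % (6 * p) := by
  rw [ZMod.castHom_apply, ZMod.cast_eq_val, ZMod.val_natCast]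

/-- **`⟨y⟩ + ⟨y + 6p⟩ + ⟨y + 12p⟩ = 3⟨ȳ⟩ + 18p`** (`ȳ = y mod 6p`). [folklore] -/
private theorem val_three_shifts [NeZero (18 * p)] (hp : 0 < p) (hnm : 6 * p ∣ 18 * p) (y : ZMod (18 * p)) :
    y.val + (y + D18).val + (y + 2 * D18).val = 3 * (ZMod.castHom hnm (ZMod (6 * p)) y).val + 18 * p := by
  rw [val_castHom]
  have hy := ZMod.val_lt y
  have hD := val_D (p := p) hp
  have h2D : ((2 : ZMod (18 * p)) * D18).val = 12 * p := by
    rw [show (2 : ZMod (18 * p)) * D18 = (((12 * p : ℕ)) : ZMod (18 * p)) by push_cast; ring, ZMod.val_natCast,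
      Nat.mod_eq_of_lt (by omega)]
  have e1 : (y + D18).val = (y.val + 6 * p) % (18 * p) := by rw [ZMod.val_add, hD]
  have e2 : (y + 2 * D18).val = (y.val + 12 * p) % (18 * p) := by rw [ZMod.val_add, h2D]
  rw [e1, e2]
  set v := y.val with hv
  by_cases h1 : v < 6 * p
  · rw [Nat.mod_eq_of_lt (by omega), Nat.mod_eq_of_lt (by omega), Nat.mod_eq_of_lt h1]; omega
  by_cases h2 : v < 12 * p
  · rw [Nat.mod_eq_of_lt (by omega), Nat.mod_eq_sub_mod (by omega), Nat.mod_eq_of_lt (by omega),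
      Nat.mod_eq_sub_mod (by omega), Nat.mod_eq_of_lt (by omega)]
    omega
  · rw [Nat.mod_eq_sub_mod (by omega), Nat.mod_eq_of_lt (by omega), Nat.mod_eq_sub_mod (by omega),
      Nat.mod_eq_of_lt (by omega), Nat.mod_eq_sub_mod (by omega), Nat.mod_eq_sub_mod (by omega),
      Nat.mod_eq_of_lt (by omega)]
    omega

/-- `⟨3y⟩ = 3⟨ȳ⟩`. [folklore] -/
private theorem val_three_mul [NeZero (18 * p)] (hp : 0 < p) (hnm : 6 * p ∣ 18 * p) (y : ZMod (18 * p)) :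
    ((3 : ZMod (18 * p)) * y).val = 3 * (ZMod.castHom hnm (ZMod (6 * p)) y).val := by
  rw [val_castHom, ZMod.val_mul, show ((3 : ZMod (18 * p))).val = 3 by
    rw [show (3 : ZMod (18 * p)) = ((3 : ℕ) : ZMod (18 * p)) by norm_cast, ZMod.val_natCast, Nat.mod_eq_of_lt (by omega)]]
  have h0 := Nat.mul_mod_mul_left 3 y.val (6 * p)
  rw [show 3 * (6 * p) = 18 * p by ring] at h0
  exact h0

/-- The residue mod `3` of a product. [folklore] -/
private theorem val_mul_mod_three [NeZero (18 * p)] (a b : ZMod (18 * p)) : (a * b).val % 3 = (a.val * b.val) % 3 := by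
  rw [ZMod.val_mul, Nat.mod_mod_of_dvd _ ⟨6 * p, by ring⟩]

/-- A unit of `ℤ/18p` is prime to `3`. [folklore] -/
private theorem mod_three_of_isUnit {u : ZMod (18 * p)} (hu : IsUnit u) : u.val % 3 ≠ 0 := by
  obtain ⟨u, rfl⟩ := hu
  have hc := ZMod.val_coe_unit_coprime u
  intro h
  have h3 : 3 ∣ (u : ZMod (18 * p)).val := Nat.dvd_of_mod_eq_zero h
  have : 3 ∣ Nat.gcd (u : ZMod (18 * p)).val (18 * p) := Nat.dvd_gcd h3 ⟨6 * p, by ring⟩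
  rw [hc] at this
  omega

/-- The norm sum of a mapped multiset as a sum of representatives. [folklore] -/
private theorem mNormSum_map {X : Type*} (t : Multiset X) {k : ℕ} (g : X → ZMod k) :
    mNormSum (t.map g) = (t.map fun w ↦ (g w).val).sum := by
  simp only [mNormSum, Multiset.map_map, Function.comp_def]

/-- The image of a unit under `unitsMap` is its reduction. [folklore] -/
private theorem coe_unitsMap {n m : ℕ} (hnm : n ∣ m) (u : (ZMod m)ˣ) :
    ((ZMod.unitsMap hnm u : (ZMod n)ˣ) : ZMod n) = ZMod.castHom hnm (ZMod n) (u : ZMod m) := by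
  simp [ZMod.unitsMap_def]

/-- **Transfer `18p → 6p` for multisets without multiples of `3`.** If `s` is a Hodge multiset of level `18p` none of whose members
is divisible by `3`, then `s mod 6p` is a Hodge multiset of level `6p`: for a unit `u` of `ℤ/18p` also `u(1 + 6p)`, `u(1 + 12p)` are
units, `{uw, u(1+6p)w, u(1+12p)w} = uw + {0, 6p, 12p}` for `3 ∤ w`, and `⟨y⟩ + ⟨y + 6p⟩ + ⟨y + 12p⟩ = 3⟨ȳ⟩ + 18p` — add the three
norm equations (the elementary shadow of the distribution relation of the Bernoulli function, as in the tree's transfers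
`isHodgeMultiset_transfer_fourPrime/twelvePrime`). [cite: Aoki1983, Prop. 2.2] [cite: Shioda1979PJA, §1 eq. (2)] -/
theorem isHodgeMultiset_cast_eighteenPrime [NeZero (18 * p)] (hp : 0 < p) (hnm : 6 * p ∣ 18 * p) {s : Multiset (ZMod (18 * p))}
    (h3 : ∀ w ∈ s, w.val % 3 ≠ 0) (hs : IsHodgeMultiset s) : IsHodgeMultiset (s.map (ZMod.castHom hnm (ZMod (6 * p)))) := by
  classical
  set R := ZMod.castHom hnm (ZMod (6 * p)) with hR
  obtain ⟨⟨hne, hsum⟩, hnorm⟩ := hs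
  refine ⟨⟨?_, ?_⟩, fun v ↦ ?_⟩
  · intro a ha
    obtain ⟨w, hw, rfl⟩ := Multiset.mem_map.mp ha
    intro h0
    have hv := congrArg ZMod.val h0
    rw [val_castHom, ZMod.val_zero] at hv
    obtain ⟨k, hk⟩ := Nat.dvd_of_mod_eq_zero hv
    exact h3 w hw (by rw [hk]; simp [Nat.mul_mod, Nat.mul_assoc])
  · rw [← map_multiset_sum, hsum, _root_.map_zero]
  · obtain ⟨u, hu⟩ := ZMod.unitsMap_surjective hnm v
    have hvu : (v : ZMod (6 * p)) = R u := by rw [← hu, coe_unitsMap]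
    set W1 : (ZMod (18 * p))ˣ := ⟨1 + D18, 1 + 2 * D18, one_add_D_mul, one_add_D_mul'⟩ with hW1
    set W2 : (ZMod (18 * p))ˣ := ⟨1 + 2 * D18, 1 + D18, one_add_D_mul', one_add_D_mul⟩ with hW2
    have n0 := hnorm u
    have n1 := hnorm (u * W1)
    have n2 := hnorm (u * W2)
    rw [mNormSum_map] at n0 n1 n2
    -- the three values at a member `w`: `uw + {0, 6p, 12p}`
    have key : ∀ w ∈ s, ((u : ZMod (18 * p)) * w).val + (((u * W1 : (ZMod (18 * p))ˣ) : ZMod (18 * p)) * w).val +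
        (((u * W2 : (ZMod (18 * p))ˣ) : ZMod (18 * p)) * w).val = 3 * (R ((u : ZMod (18 * p)) * w)).val + 18 * p := by
      intro w hw
      rw [← val_three_shifts hp hnm]
      set y := (u : ZMod (18 * p)) * w with hy
      have hy3 : y.val % 3 ≠ 0 := by
        rw [hy, val_mul_mod_three]
        have a := mod_three_of_isUnit u.isUnit
        have b := h3 w hw
        have ha : (u : ZMod (18 * p)).val % 3 = 1 ∨ (u : ZMod (18 * p)).val % 3 = 2 := by omega
        have hb : w.val % 3 = 1 ∨ w.val % 3 = 2 := by omega
        rw [Nat.mul_mod]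
        rcases ha with ha | ha <;> rcases hb with hb | hb <;> rw [ha, hb] <;> decide
      have e1 : ((u * W1 : (ZMod (18 * p))ˣ) : ZMod (18 * p)) * w = y + D18 * y := by
        rw [Units.val_mul, hW1]; ring
      have e2 : ((u * W2 : (ZMod (18 * p))ˣ) : ZMod (18 * p)) * w = y + 2 * (D18 * y) := by
        rw [Units.val_mul, hW2]; ring
      rw [e1, e2, D_mul]
      have hr : y.val % 3 = 1 ∨ y.val % 3 = 2 := by omega
      rcases hr with hr | hr
      · rw [hr, Nat.cast_one, one_mul]
      · rw [hr, Nat.cast_ofNat, show y + 2 * (2 * D18) = y + D18 by linear_combination three_mul_D (p := p)]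
        ring
    have hsum3 : (s.map fun w ↦ ((u : ZMod (18 * p)) * w).val).sum +
        (s.map fun w ↦ (((u * W1 : (ZMod (18 * p))ˣ) : ZMod (18 * p)) * w).val).sum +
        (s.map fun w ↦ (((u * W2 : (ZMod (18 * p))ˣ) : ZMod (18 * p)) * w).val).sum =
        3 * (s.map fun w ↦ (R ((u : ZMod (18 * p)) * w)).val).sum + 18 * p * Multiset.card s := by
      rw [← Multiset.sum_map_add, ← Multiset.sum_map_add]
      have : (s.map fun w ↦ ((u : ZMod (18 * p)) * w).val + (((u * W1 : (ZMod (18 * p))ˣ) : ZMod (18 * p)) * w).val +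
          (((u * W2 : (ZMod (18 * p))ˣ) : ZMod (18 * p)) * w).val) = s.map fun w ↦ 3 * (R ((u : ZMod (18 * p)) * w)).val + 18 * p :=
        Multiset.map_congr rfl key
      rw [this, Multiset.sum_map_add, Multiset.sum_map_mul_left, Multiset.map_const', Multiset.sum_replicate, smul_eq_mul,
        mul_comm (Multiset.card s)]
    rw [mNormSum_map, Multiset.map_map, Multiset.card_map]
    have tso : ∀ w ∈ s, ((fun w ↦ ((v : ZMod (6 * p)) * w).val) ∘ R) w = (R ((u : ZMod (18 * p)) * w)).val := fun w _ ↦ by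
      simp only [Function.comp_apply, hvu, map_mul]
    rw [Multiset.map_congr rfl tso]
    generalize Multiset.card s = cs at n0 n1 n2 hsum3 ⊢
    rw [show 18 * p * cs = 18 * (p * cs) by ring] at n0 n1 n2 hsum3
    rw [show 6 * p * cs = 6 * (p * cs) by ring]
    generalize p * cs = pcs at n0 n1 n2 hsum3 ⊢
    omega

/-- Thirds: `x ↦ ⟨x⟩/3 mod 6p`. [folklore] -/
private def third (x : ZMod (18 * p)) : ZMod (6 * p) := ((x.val / 3 : ℕ) : ZMod (6 * p))

/-- Triples: `ȳ ↦ 3⟨ȳ⟩`, an additive map `ℤ/6p → ℤ/18p`. [folklore] -/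
private def triple (p : ℕ) [NeZero (6 * p)] : ZMod (6 * p) →+ ZMod (18 * p) where
  toFun y := ((3 * y.val : ℕ) : ZMod (18 * p))
  map_zero' := by simp
  map_add' a b := by
    have e : ((3 * (a + b).val : ℕ) : ZMod (18 * p)) = ((3 * ((a.val + b.val) % (6 * p)) : ℕ) : ZMod (18 * p)) := by
      rw [ZMod.val_add]
    rw [e, ← Nat.mul_mod_mul_left, show 3 * (6 * p) = 18 * p by ring, ZMod.natCast_mod]
    push_cast; ring

/-- `triple (third x) = x` when `3 ∣ ⟨x⟩`. [folklore] -/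
private theorem triple_third [NeZero (18 * p)] [NeZero (6 * p)] {x : ZMod (18 * p)} (hx : x.val % 3 = 0) :
    triple p (third x) = x := by
  have hlt := ZMod.val_lt x
  show ((3 * (((x.val / 3 : ℕ) : ZMod (6 * p))).val : ℕ) : ZMod (18 * p)) = x
  rw [ZMod.val_natCast, Nat.mod_eq_of_lt (by omega), Nat.mul_div_cancel' (Nat.dvd_of_mod_eq_zero hx), ZMod.natCast_zmod_val]

/-- `triple (3p) = 9p`, `triple (2p) = 6p`. [folklore] -/
private theorem triple_K [NeZero (6 * p)] (hp : 0 < p) : triple p K6 = K18 ∧ triple p D6 = D18 := by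
  constructor
  · show ((3 * ((((3 * p : ℕ)) : ZMod (6 * p))).val : ℕ) : ZMod (18 * p)) = K18
    rw [ZMod.val_natCast, Nat.mod_eq_of_lt (by omega)]; push_cast; ring
  · show ((3 * ((((2 * p : ℕ)) : ZMod (6 * p))).val : ℕ) : ZMod (18 * p)) = D18
    rw [ZMod.val_natCast, Nat.mod_eq_of_lt (by omega)]; push_cast; ring

/-- `triple` is injective. [folklore] -/
private theorem triple_eq_zero [NeZero (18 * p)] [NeZero (6 * p)] {y : ZMod (6 * p)} (hy : triple p y = 0) :
    y = 0 := by
  have hv := congrArg ZMod.val hy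
  change ((3 * y.val : ℕ) : ZMod (18 * p)).val = (0 : ZMod (18 * p)).val at hv
  rw [ZMod.val_natCast, ZMod.val_zero, Nat.mod_eq_of_lt (by have := ZMod.val_lt y; omega)] at hv
  exact (ZMod.val_eq_zero y).mp (by omega)

/-- **Transfer `18p → 6p` for multisets of multiples of `3`.** If every member of a Hodge multiset `s` of level `18p` is divisible
by `3`, the thirds form a Hodge multiset of level `6p` of the same cardinality, pair-free if `s` is, and `s` is recovered by
tripling (`⟨3y⟩ = 3⟨ȳ⟩`). [cite: Shioda1979PJA, §1 eq. (2)] -/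
private theorem isHodgeMultiset_third [NeZero (18 * p)] (hp : 0 < p) (hnm : 6 * p ∣ 18 * p) {s : Multiset (ZMod (18 * p))}
    [NeZero (6 * p)] (h3 : ∀ w ∈ s, w.val % 3 = 0) (hs : IsHodgeMultiset s) :
    IsHodgeMultiset (s.map third) ∧ (s.map third).map (triple p) = s := by
  classical
  set R := ZMod.castHom hnm (ZMod (6 * p)) with hR
  -- `x = 3 x̂`, `third x = R x̂`
  have hhat : ∀ x ∈ s, x = 3 * (((x.val / 3 : ℕ)) : ZMod (18 * p)) ∧ third x = R (((x.val / 3 : ℕ)) : ZMod (18 * p)) := by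
    intro x hx
    constructor
    · have e : x = ((x.val : ℕ) : ZMod (18 * p)) := (ZMod.natCast_zmod_val x).symm
      conv_lhs => rw [e, ← Nat.mul_div_cancel' (Nat.dvd_of_mod_eq_zero (h3 x hx))]
      push_cast; ring
    · rw [third, map_natCast]
  have hrec : (s.map third).map (triple p) = s := by
    rw [Multiset.map_map]
    conv_rhs => rw [← Multiset.map_id s]
    exact Multiset.map_congr rfl fun x hx ↦ triple_third (h3 x hx)
  refine ⟨⟨⟨?_, ?_⟩, fun v ↦ ?_⟩, hrec⟩
  · intro a ha h0
    obtain ⟨x, hx, rfl⟩ := Multiset.mem_map.mp ha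
    have := triple_third (h3 x hx)
    rw [h0, _root_.map_zero] at this
    exact hs.1.1 x hx this.symm
  · -- `3 · Σ x̂ = 0`, hence `R (Σ x̂) = 0`
    have e : s.sum = ((s.map third).map (triple p)).sum := by rw [hrec]
    rw [← map_multiset_sum, hs.1.2] at e
    exact triple_eq_zero e.symm
  · obtain ⟨u, hu⟩ := ZMod.unitsMap_surjective hnm v
    have hvu : (v : ZMod (6 * p)) = R u := by rw [← hu, coe_unitsMap]
    have n0 := hs.2 u
    rw [mNormSum_map] at n0
    rw [mNormSum_map, Multiset.map_map, Multiset.card_map]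
    have key : ∀ x ∈ s, ((u : ZMod (18 * p)) * x).val = 3 * ((v : ZMod (6 * p)) * third x).val := by
      intro x hx
      obtain ⟨e1, e2⟩ := hhat x hx
      rw [e2, hvu, ← map_mul, ← val_three_mul hp hnm]
      congr 1
      conv_lhs => rw [e1]
      ring
    have : (s.map fun x ↦ ((u : ZMod (18 * p)) * x).val) = s.map fun x ↦ 3 * ((v : ZMod (6 * p)) * third x).val :=
      Multiset.map_congr rfl key
    rw [this, Multiset.sum_map_mul_left] at n0
    have e3 : ∀ x ∈ s, ((fun w ↦ ((v : ZMod (6 * p)) * w).val) ∘ third) x = ((v : ZMod (6 * p)) * third x).val :=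
      fun x _ ↦ rfl
    rw [Multiset.map_congr rfl e3]
    generalize Multiset.card s = cs at n0 ⊢
    rw [show 18 * p * cs = 18 * (p * cs) by ring] at n0
    rw [show 6 * p * cs = 6 * (p * cs) by ring]
    generalize p * cs = pcs at n0 ⊢
    omega

/-- Pair-freeness descends to the thirds. [folklore] -/
private theorem third_pairfree [NeZero (18 * p)] [NeZero (6 * p)] {s : Multiset (ZMod (18 * p))}
    (h3 : ∀ w ∈ s, w.val % 3 = 0) (hpf : ∀ a ∈ s, ∀ b ∈ s.erase a, a + b ≠ 0) :
    ∀ a ∈ s.map third, ∀ b ∈ (s.map third).erase a, a + b ≠ 0 := by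
  classical
  intro a ha b hb hab
  obtain ⟨x, hx, rfl⟩ := Multiset.mem_map.mp ha
  rw [← Multiset.map_erase_of_mem _ _ hx] at hb
  obtain ⟨y, hy, rfl⟩ := Multiset.mem_map.mp hb
  have e : triple p (third x + third y) = x + y := by
    rw [_root_.map_add, triple_third (h3 x hx), triple_third (h3 y (Multiset.mem_of_mem_erase hy))]
  rw [hab, _root_.map_zero] at e
  exact hpf x hx y hy e.symm

/-! ### Case F: all members in the fibre `0` — the level `18` -/

/-- Multiples: `k ↦ p⟨k⟩`, an additive map `ℤ/18 → ℤ/18p`. [folklore] -/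
private def pmul (p : ℕ) : ZMod 18 →+ ZMod (18 * p) where
  toFun k := ((p * k.val : ℕ) : ZMod (18 * p))
  map_zero' := by simp
  map_add' a b := by
    have e : ((p * (a + b).val : ℕ) : ZMod (18 * p)) = ((p * ((a.val + b.val) % 18) : ℕ) : ZMod (18 * p)) := by
      rw [ZMod.val_add]
    rw [e, ← Nat.mul_mod_mul_left, show p * 18 = 18 * p by ring, ZMod.natCast_mod]
    push_cast; ring

/-- The quotient by `p` of a member of the fibre `0`: `x ↦ ⟨x⟩/p mod 18`. [folklore] -/
private def pdiv (p : ℕ) (x : ZMod (18 * p)) : ZMod 18 := (((x.val / p : ℕ)) : ZMod 18)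

/-- `pmul (pdiv x) = x` for `x` in the fibre `0`. [folklore] -/
private theorem pmul_pdiv (h : Nat.Coprime 18 p) [NeZero (18 * p)] {x : ZMod (18 * p)} (hx : (crt h x).2 = 0) :
    pmul p (pdiv p x) = x := by
  rw [crt_snd, ZMod.natCast_eq_zero_iff] at hx
  have hlt := ZMod.val_lt x
  have hq : x.val / p < 18 := Nat.div_lt_of_lt_mul (by omega)
  show ((p * ((((x.val / p : ℕ)) : ZMod 18)).val : ℕ) : ZMod (18 * p)) = x
  rw [ZMod.val_natCast, Nat.mod_eq_of_lt hq, Nat.mul_div_cancel' hx, ZMod.natCast_zmod_val]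

/-- `⟨t x⟩ = p ⟨t̄ · pdiv x⟩` for `x` in the fibre `0` and any `t`. [folklore] -/
private theorem val_mul_fibre (h : Nat.Coprime 18 p) [NeZero (18 * p)] {x : ZMod (18 * p)} (hx : (crt h x).2 = 0)
    (t : ZMod (18 * p)) : (t * x).val = p * (((t.val : ℕ) : ZMod 18) * pdiv p x).val := by
  have hx' := hx
  rw [crt_snd, ZMod.natCast_eq_zero_iff] at hx'
  have hlt := ZMod.val_lt x
  unfold pdiv
  set q := x.val / p with hq
  have hxq : x.val = p * q := (Nat.mul_div_cancel' hx').symm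
  have h0 := Nat.mul_mod_mul_left p (t.val * q) 18
  rw [show p * 18 = 18 * p by ring] at h0
  have hnat : (t.val * (p * q)) % (18 * p) = p * ((t.val * q) % 18) := by
    rw [show t.val * (p * q) = p * (t.val * q) by ring]; exact h0
  rw [ZMod.val_mul, hxq, hnat, ← Nat.cast_mul, ZMod.val_natCast]


/-- `pmul` is injective. [folklore] -/
private theorem pmul_eq_zero (hp : 0 < p) {k : ZMod 18} (hk : pmul p k = 0) : k = 0 := by
  have hv : ((p * k.val : ℕ) : ZMod (18 * p)) = 0 := hk
  rw [ZMod.natCast_eq_zero_iff] at hv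
  have hlt := ZMod.val_lt k
  have h18 : 18 ∣ k.val := by
    have h1 : p * 18 ∣ p * k.val := by rwa [mul_comm p 18]
    exact Nat.dvd_of_mul_dvd_mul_left hp h1
  exact (ZMod.val_eq_zero k).mp (Nat.eq_zero_of_dvd_of_lt h18 hlt)

/-- `pmul (n k) = n · pmul k`. [folklore] -/
private theorem pmul_natMul (n : ℕ) (k : ZMod 18) : pmul p ((n : ZMod 18) * k) = (n : ZMod (18 * p)) * pmul p k := by
  rw [← nsmul_eq_mul, _root_.map_nsmul, nsmul_eq_mul]

/-- `pmul (n k) = n · pmul k` for the numerals met below. [folklore] -/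
private theorem pmul_nums (k : ZMod 18) :
    pmul p (2 * k) = 2 * pmul p k ∧
    pmul p (3 * k) = 3 * pmul p k ∧
    pmul p (4 * k) = 4 * pmul p k ∧
    pmul p (6 * k) = 6 * pmul p k ∧
    pmul p (7 * k) = 7 * pmul p k ∧
    pmul p (9 * k) = 9 * pmul p k ∧
    pmul p (12 * k) = 12 * pmul p k ∧
    pmul p (14 * k) = 14 * pmul p k ∧
    pmul p (15 * k) = 15 * pmul p k ∧
    pmul p (16 * k) = 16 * pmul p k := by
  refine ⟨?_, ?_, ?_, ?_, ?_, ?_, ?_, ?_, ?_, ?_⟩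
  · simpa using pmul_natMul (p := p) 2 k
  · simpa using pmul_natMul (p := p) 3 k
  · simpa using pmul_natMul (p := p) 4 k
  · simpa using pmul_natMul (p := p) 6 k
  · simpa using pmul_natMul (p := p) 7 k
  · simpa using pmul_natMul (p := p) 9 k
  · simpa using pmul_natMul (p := p) 12 k
  · simpa using pmul_natMul (p := p) 14 k
  · simpa using pmul_natMul (p := p) 15 k
  · simpa using pmul_natMul (p := p) 16 k

/-- `pmul 9 = 9p`, `pmul 6 = 6p`, `pmul 12 = 12p`. [folklore] -/
private theorem pmul_nine : pmul p 9 = K18 ∧ pmul p 6 = D18 ∧ pmul p 12 = 2 * D18 := by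
  refine ⟨?_, ?_, ?_⟩
  · show ((p * (9 : ZMod 18).val : ℕ) : ZMod (18 * p)) = K18
    rw [show (9 : ZMod 18).val = 9 from rfl]; push_cast; ring
  · show ((p * (6 : ZMod 18).val : ℕ) : ZMod (18 * p)) = D18
    rw [show (6 : ZMod 18).val = 6 from rfl]; push_cast; ring
  · show ((p * (12 : ZMod 18).val : ℕ) : ZMod (18 * p)) = 2 * D18
    rw [show (12 : ZMod 18).val = 12 from rfl]; push_cast; ring

/-- The six pair conditions of a pair-free explicit quadruple. [folklore] -/
private theorem six_pairs {n : ℕ} {s : Multiset (ZMod n)} {a b c d : ZMod n} (hs : s = {a, b, c, d})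
    (hpf : ∀ x ∈ s, ∀ y ∈ s.erase x, x + y ≠ 0) :
    a + b ≠ 0 ∧ a + c ≠ 0 ∧ a + d ≠ 0 ∧ b + c ≠ 0 ∧ b + d ≠ 0 ∧ c + d ≠ 0 := by
  classical
  have ea : s = a ::ₘ {b, c, d} := by rw [hs]; rfl
  have eb : s = b ::ₘ {a, c, d} := by rw [hs]; exact Multiset.cons_swap a b _
  have ec : s = c ::ₘ {a, b, d} := by
    rw [hs]; simp only [Multiset.insert_eq_cons]; rw [Multiset.cons_swap b c, Multiset.cons_swap a c]
  have mem : ∀ (x : ZMod n) (t : Multiset (ZMod n)), s = x ::ₘ t → ∀ y ∈ t, x + y ≠ 0 := by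
    rintro x t rfl y hy
    exact hpf x (Multiset.mem_cons_self _ _) y (by rw [Multiset.erase_cons_head]; exact hy)
  exact ⟨mem a _ ea b (by simp), mem a _ ea c (by simp), mem a _ ea d (by simp), mem b _ eb c (by simp), mem b _ eb d (by simp),
    mem c _ ec d (by simp)⟩

/-- The conclusion of the classification: `α`, `β`, `γ`, or a lifted exceptional quadruple of level `18`. [folklore] -/
private def IsStdOrLift (s : Multiset (ZMod (18 * p))) : Prop :=
  ∃ x : ZMod (18 * p), s = {x, x + K18, -(2 * x), K18} ∨ s = {x, x + K18, 2 * x + K18, -(4 * x)} ∨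
    s = {x, x + D18, x + 2 * D18, -(3 * x)} ∨
    ((∃ t : ℕ, (t = 1 ∨ t = 5 ∨ t = 7 ∨ t = 11 ∨ t = 13 ∨ t = 17) ∧ x = ((t * p : ℕ) : ZMod (18 * p))) ∧
      (s = {x, 6 * x, 14 * x, 15 * x} ∨ s = {x, 7 * x, 12 * x, 16 * x} ∨ s = {x, 9 * x, 12 * x, 14 * x}))

/-! ### Case F: the kernel enumeration at level `18` (a cheap Boolean test, no `Multiset` in the kernel) -/

/-- The standard forms at level `18` with base `k`, as lists. [folklore] -/
private def formsL (k : ZMod 18) : List (List (ZMod 18)) :=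
  [[k, k + 9, -(2 * k), 9], [k, k + 9, 2 * k + 9, -(4 * k)], [k, k + 6, k + 12, -(3 * k)]]

/-- The exceptional quadruples of level `18` with base `k`, as lists. [cite: MeyerNeutsch1981Fermatquadrupel, Tabelle 1 p. 54 (N = 18)] -/
private def excL (k : ZMod 18) : List (List (ZMod 18)) :=
  [[k, 6 * k, 14 * k, 15 * k], [k, 7 * k, 12 * k, 16 * k], [k, 9 * k, 12 * k, 14 * k]]

/-- Equality of the multisets of two lists, by counting. [folklore] -/
private def permB (L M : List (ZMod 18)) : Bool := (L ++ M).all fun x ↦ L.count x == M.count x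

/-- The units of `ℤ/18`. [folklore] -/
private def unitB (k : ZMod 18) : Bool := k == 1 || k == 5 || k == 7 || k == 11 || k == 13 || k == 17

/-- The hypotheses at one triple: non-zero members, no pair, the norm equations `Σ⟨u k⟩ = 36` at `u = 1, 5, 7, 11, 13`. [folklore] -/
private def levHyp (k₁ k₂ k₃ : ZMod 18) : Prop :=
  (k₁ ≠ 0 ∧ k₂ ≠ 0 ∧ k₃ ≠ 0 ∧ -(k₁ + k₂ + k₃) ≠ 0) ∧
  (k₁ + k₂ ≠ 0 ∧ k₁ + k₃ ≠ 0 ∧ k₁ + -(k₁ + k₂ + k₃) ≠ 0 ∧ k₂ + k₃ ≠ 0 ∧ k₂ + -(k₁ + k₂ + k₃) ≠ 0 ∧ k₃ + -(k₁ + k₂ + k₃) ≠ 0) ∧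
  ∀ u ∈ [(1 : ZMod 18), 5, 7, 11, 13],
    (u * k₁).val + (u * k₂).val + (u * k₃).val + (u * -(k₁ + k₂ + k₃)).val = 36

/-- `levHyp` is decidable. [folklore] -/
private instance (k₁ k₂ k₃ : ZMod 18) : Decidable (levHyp k₁ k₂ k₃) := by unfold levHyp; infer_instance

/-- The test at one triple: hypotheses ⇒ the list `[k₁, k₂, k₃, k₄]` is a permutation of a form. [folklore] -/
private def testLev (k₁ k₂ k₃ : ZMod 18) : Bool :=
  !decide (levHyp k₁ k₂ k₃) ||
    [k₁, k₂, k₃, -(k₁ + k₂ + k₃)].any fun k ↦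
      (formsL k).any (permB [k₁, k₂, k₃, -(k₁ + k₂ + k₃)]) ||
        (unitB k && (excL k).any (permB [k₁, k₂, k₃, -(k₁ + k₂ + k₃)]))

set_option maxHeartbeats 1000000 in
/-- **The pair-free Hodge quadruples of level `18`** (kernel enumeration of the `18³` triples): every triple passes `testLev`.
[cite: MeyerNeutsch1981Fermatquadrupel, Tabelle 1 p. 54 (N = 18)] [cite: Shioda1982PicardFermat, table p. 727 (m = 18)] -/
private theorem testLev_all : ∀ k₁ k₂ k₃ : ZMod 18, testLev k₁ k₂ k₃ = true := by
  decide +kernel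

/-- `permB` decides equality of multisets. [folklore] -/
private theorem perm_of_permB {L M : List (ZMod 18)} (h : permB L M = true) : (L : Multiset (ZMod 18)) = M := by
  rw [Multiset.coe_eq_coe, List.perm_iff_count]
  intro x
  unfold permB at h
  rw [List.all_eq_true] at h
  by_cases hx : x ∈ L ++ M
  · simpa using h x hx
  · rw [List.mem_append, not_or] at hx
    rw [List.count_eq_zero_of_not_mem hx.1, List.count_eq_zero_of_not_mem hx.2]

/-- **The pair-free Hodge quadruples of level `18`, multiset form:** `{k, k + 9, −2k, 9}`, `{k, k + 9, 2k + 9, −4k}`,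
`{k, k + 6, k + 12, −3k}`, or a unit multiple `u·{1, 6, 14, 15}`, `u·{1, 7, 12, 16}`, `u·{1, 9, 12, 14}` of one of the three
representatives printed in Tabelle 1 at `N = 18`. [cite: MeyerNeutsch1981Fermatquadrupel, Tabelle 1 p. 54 (N = 18)]
[cite: Shioda1982PicardFermat, table p. 727 (m = 18)] -/
private theorem level_eighteen_forms (k₁ k₂ k₃ : ZMod 18) (H : levHyp k₁ k₂ k₃) :
    ∃ k : ZMod 18, ({k₁, k₂, k₃, -(k₁ + k₂ + k₃)} : Multiset (ZMod 18)) = {k, k + 9, -(2 * k), 9} ∨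
      ({k₁, k₂, k₃, -(k₁ + k₂ + k₃)} : Multiset (ZMod 18)) = {k, k + 9, 2 * k + 9, -(4 * k)} ∨
      ({k₁, k₂, k₃, -(k₁ + k₂ + k₃)} : Multiset (ZMod 18)) = {k, k + 6, k + 12, -(3 * k)} ∨
      ((k = 1 ∨ k = 5 ∨ k = 7 ∨ k = 11 ∨ k = 13 ∨ k = 17) ∧
        (({k₁, k₂, k₃, -(k₁ + k₂ + k₃)} : Multiset (ZMod 18)) = {k, 6 * k, 14 * k, 15 * k} ∨
          ({k₁, k₂, k₃, -(k₁ + k₂ + k₃)} : Multiset (ZMod 18)) = {k, 7 * k, 12 * k, 16 * k} ∨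
          ({k₁, k₂, k₃, -(k₁ + k₂ + k₃)} : Multiset (ZMod 18)) = {k, 9 * k, 12 * k, 14 * k})) := by
  have t := testLev_all k₁ k₂ k₃
  rw [testLev, decide_eq_true H, Bool.not_true, Bool.false_or, List.any_eq_true] at t
  obtain ⟨k, -, hk⟩ := t
  have eL : ({k₁, k₂, k₃, -(k₁ + k₂ + k₃)} : Multiset (ZMod 18)) = ([k₁, k₂, k₃, -(k₁ + k₂ + k₃)] : List (ZMod 18)) := rfl
  refine ⟨k, ?_⟩
  rw [eL]
  rw [Bool.or_eq_true, List.any_eq_true, Bool.and_eq_true, List.any_eq_true] at hk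
  rcases hk with ⟨M, hM, hperm⟩ | ⟨hu, M, hM, hperm⟩
  · simp only [formsL, List.mem_cons, List.not_mem_nil, or_false] at hM
    rcases hM with rfl | rfl | rfl
    · exact Or.inl (perm_of_permB hperm)
    · exact Or.inr (Or.inl (perm_of_permB hperm))
    · exact Or.inr (Or.inr (Or.inl (perm_of_permB hperm)))
  · have hk' : k = 1 ∨ k = 5 ∨ k = 7 ∨ k = 11 ∨ k = 13 ∨ k = 17 := by
      simp only [unitB, Bool.or_eq_true, beq_iff_eq] at hu; tauto
    refine Or.inr (Or.inr (Or.inr ⟨hk', ?_⟩))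
    simp only [excL, List.mem_cons, List.not_mem_nil, or_false] at hM
    rcases hM with rfl | rfl | rfl
    · exact Or.inl (perm_of_permB hperm)
    · exact Or.inr (Or.inl (perm_of_permB hperm))
    · exact Or.inr (Or.inr (perm_of_permB hperm))

/-- A unit of `ℤ/18p` above a given unit residue mod `18`. [folklore] -/
private theorem exists_unit_above [NeZero (18 * p)] (hnm : 18 ∣ 18 * p) (τ : (ZMod 18)ˣ) :
    ∃ t : (ZMod (18 * p))ˣ, (((t : ZMod (18 * p)).val : ℕ) : ZMod 18) = τ := by
  obtain ⟨t, ht⟩ := ZMod.unitsMap_surjective hnm τ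
  refine ⟨t, ?_⟩
  rw [← ht, coe_unitsMap, ZMod.castHom_apply, ZMod.cast_eq_val]

/-- **Case F: all members in the fibre `0`.** Then `s/p` is a pair-free Hodge quadruple of level `18` (the norm equations at
units above `1, 5, 7, 11, 13`), enumerated by the kernel: `s` is `α_x, β_x, γ_x` with `x ∈ pℤ/18p` or one of the `18` lifts of the
exceptional quadruples of level `18`. [cite: Shioda1982PicardFermat, table p. 727 (m = 18)]
[cite: MeyerNeutsch1981Fermatquadrupel, Tabelle 1 p. 54 (N = 18)] -/
private theorem fibre_zero (h : Nat.Coprime 18 p) [NeZero (18 * p)] (hp : p.Prime) {s : Multiset (ZMod (18 * p))}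
    (hs : IsHodgeMultiset s) (hcard : Multiset.card s = 4) (hpf : ∀ a ∈ s, ∀ b ∈ s.erase a, a + b ≠ 0)
    (h0 : ∀ w ∈ s, (crt h w).2 = 0) : IsStdOrLift s := by
  classical
  have hp0 := hp.pos
  have hnm : 18 ∣ 18 * p := ⟨p, rfl⟩
  obtain ⟨x₁, x₂, x₃, x₄, hsx⟩ := Multiset.card_eq_four.mp hcard
  have hx₁ : x₁ ∈ s := by rw [hsx]; simp
  have hx₂ : x₂ ∈ s := by rw [hsx]; simp
  have hx₃ : x₃ ∈ s := by rw [hsx]; simp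
  have hx₄ : x₄ ∈ s := by rw [hsx]; simp
  set k₁ := pdiv p x₁ with hk₁d
  set k₂ := pdiv p x₂ with hk₂d
  set k₃ := pdiv p x₃ with hk₃d
  set k₄ := pdiv p x₄ with hk₄d
  have e₁ : pmul p k₁ = x₁ := pmul_pdiv h (h0 x₁ hx₁)
  have e₂ : pmul p k₂ = x₂ := pmul_pdiv h (h0 x₂ hx₂)
  have e₃ : pmul p k₃ = x₃ := pmul_pdiv h (h0 x₃ hx₃)
  have e₄ : pmul p k₄ = x₄ := pmul_pdiv h (h0 x₄ hx₄)
  -- `Σ = 0`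
  have hk₄ : k₄ = -(k₁ + k₂ + k₃) := by
    have hsum := hs.1.2
    rw [hsx] at hsum
    simp only [Multiset.insert_eq_cons, Multiset.sum_cons, Multiset.sum_singleton] at hsum
    rw [← e₁, ← e₂, ← e₃, ← e₄, ← _root_.map_add, ← _root_.map_add, ← _root_.map_add] at hsum
    have := pmul_eq_zero hp0 hsum
    linear_combination this
  -- the hypotheses of the kernel lemma
  have H : levHyp k₁ k₂ k₃ := by
    rw [levHyp, ← hk₄]
    refine ⟨⟨?_, ?_, ?_, ?_⟩, ?_, ?_⟩
    · intro e; rw [e, _root_.map_zero] at e₁; exact hs.1.1 x₁ hx₁ e₁.symm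
    · intro e; rw [e, _root_.map_zero] at e₂; exact hs.1.1 x₂ hx₂ e₂.symm
    · intro e; rw [e, _root_.map_zero] at e₃; exact hs.1.1 x₃ hx₃ e₃.symm
    · intro e; rw [e, _root_.map_zero] at e₄; exact hs.1.1 x₄ hx₄ e₄.symm
    · obtain ⟨p12, p13, p14, p23, p24, p34⟩ := six_pairs hsx hpf
      have P : ∀ {a b : ZMod 18} {x y : ZMod (18 * p)}, pmul p a = x → pmul p b = y → x + y ≠ 0 → a + b ≠ 0 := by
        rintro a b x y rfl rfl hxy e
        rw [← _root_.map_add, e, _root_.map_zero] at hxy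
        exact hxy rfl
      exact ⟨P e₁ e₂ p12, P e₁ e₃ p13, P e₁ e₄ p14, P e₂ e₃ p23, P e₂ e₄ p24, P e₃ e₄ p34⟩
    · intro u hu
      have hU : IsUnit u := by
        simp only [List.mem_cons, List.not_mem_nil, or_false] at hu
        rcases hu with rfl | rfl | rfl | rfl | rfl <;> decide
      obtain ⟨t, ht⟩ := exists_unit_above hnm hU.unit
      rw [IsUnit.unit_spec] at ht
      have n := hs.2 t
      rw [hsx] at n
      simp only [Multiset.insert_eq_cons, Multiset.map_cons, Multiset.map_singleton, Multiset.card_cons,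
        Multiset.card_singleton, mNormSum_cons, mNormSum_singleton] at n
      rw [val_mul_fibre h (h0 x₁ hx₁), val_mul_fibre h (h0 x₂ hx₂), val_mul_fibre h (h0 x₃ hx₃),
        val_mul_fibre h (h0 x₄ hx₄), ht] at n
      have n' : p * (2 * ((u * k₁).val + (u * k₂).val + (u * k₃).val + (u * k₄).val)) = p * 72 := by linear_combination n
      have := Nat.eq_of_mul_eq_mul_left hp0 n'
      omega
  obtain ⟨k, hk⟩ := level_eighteen_forms k₁ k₂ k₃ H
  -- translate back through `pmul`
  have hs' : s = ({k₁, k₂, k₃, -(k₁ + k₂ + k₃)} : Multiset (ZMod 18)).map (pmul p) := by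
    rw [← hk₄, hsx]
    simp only [Multiset.insert_eq_cons, Multiset.map_cons, Multiset.map_singleton, e₁, e₂, e₃, e₄]
  obtain ⟨h9, h6, h12⟩ := pmul_nine (p := p)
  obtain ⟨m2, m3, m4, m6, m7, m9, m12, m14, m15, m16⟩ := pmul_nums (p := p) k
  refine ⟨pmul p k, ?_⟩
  rcases hk with e | e | e | ⟨hku, e⟩
  · left
    rw [hs', e]
    simp only [Multiset.insert_eq_cons, Multiset.map_cons, Multiset.map_singleton, _root_.map_add, _root_.map_neg, m2, m4, h9]
  · right; left
    rw [hs', e]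
    simp only [Multiset.insert_eq_cons, Multiset.map_cons, Multiset.map_singleton, _root_.map_add, _root_.map_neg, m2, m4, h9]
  · right; right; left
    rw [hs', e]
    simp only [Multiset.insert_eq_cons, Multiset.map_cons, Multiset.map_singleton, _root_.map_add, _root_.map_neg, m3, h6,
      h12]
  · right; right; right
    refine ⟨⟨k.val, ?_, ?_⟩, ?_⟩
    · rcases hku with rfl | rfl | rfl | rfl | rfl | rfl <;> decide
    · show ((p * k.val : ℕ) : ZMod (18 * p)) = ((k.val * p : ℕ) : ZMod (18 * p)); rw [Nat.mul_comm p k.val]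
    · rcases e with e | e | e
      · left; rw [hs', e]
        simp only [Multiset.insert_eq_cons, Multiset.map_cons, Multiset.map_singleton, m6, m7, m9, m12, m14, m15, m16]
      · right; left; rw [hs', e]
        simp only [Multiset.insert_eq_cons, Multiset.map_cons, Multiset.map_singleton, m6, m7, m9, m12, m14, m15, m16]
      · right; right; rw [hs', e]
        simp only [Multiset.insert_eq_cons, Multiset.map_cons, Multiset.map_singleton, m6, m7, m9, m12, m14, m15, m16]


/-! ### Coordinates of `9p`, `6p`; the kernel of the reduction mod `6p` -/

/-- `crt (9p) = (9, 0)` (`p` odd). [folklore] -/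
private theorem crt_K (h : Nat.Coprime 18 p) (hp : p.Prime) (h5 : 5 ≤ p) : crt h K18 = (9, 0) := by
  rw [crt_natCast, Prod.mk.injEq]
  obtain ⟨k, hk⟩ := hp.odd_of_ne_two (by omega)
  constructor
  · rw [hk, show 9 * (2 * k + 1) = 18 * k + 9 by ring]; push_cast
    rw [show (18 : ZMod 18) = 0 from rfl]; ring
  · rw [Nat.cast_mul, ZMod.natCast_self, mul_zero]

/-- `crt (6p) = (6, 0)` or `(12, 0)` (`p ≡ ±1 (mod 3)`). [folklore] -/
private theorem crt_D (h : Nat.Coprime 18 p) (hp : p.Prime) (h5 : 5 ≤ p) :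
    (crt h D18 = (6, 0) ∧ crt h (2 * D18) = (12, 0)) ∨ (crt h D18 = (12, 0) ∧ crt h (2 * D18) = (6, 0)) := by
  have h3 : p % 3 ≠ 0 := by
    intro h0
    have : 3 ∣ p := Nat.dvd_of_mod_eq_zero h0
    rcases (Nat.dvd_prime hp).mp this with e | e <;> omega
  have e2 : (2 : ZMod (18 * p)) * D18 = (((12 * p : ℕ)) : ZMod (18 * p)) := by push_cast; ring
  rw [e2, crt_natCast, crt_natCast]
  simp only [Prod.mk.injEq]
  have hz : ((6 * p : ℕ) : ZMod p) = 0 ∧ ((12 * p : ℕ) : ZMod p) = 0 := by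
    constructor <;> rw [Nat.cast_mul, ZMod.natCast_self, mul_zero]
  obtain ⟨k, hk⟩ : ∃ k, p = 3 * k + p % 3 := ⟨p / 3, (Nat.div_add_mod p 3).symm⟩
  have hr : p % 3 = 1 ∨ p % 3 = 2 := by omega
  rcases hr with hr | hr <;> rw [hr] at hk
  · left
    refine ⟨⟨?_, hz.1⟩, ?_, hz.2⟩
    · rw [hk, show 6 * (3 * k + 1) = 18 * k + 6 by ring]; push_cast; rw [show (18 : ZMod 18) = 0 from rfl]; ring
    · rw [hk, show 12 * (3 * k + 1) = 18 * (2 * k) + 12 by ring]; push_cast; rw [show (18 : ZMod 18) = 0 from rfl]; ring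
  · right
    refine ⟨⟨?_, hz.1⟩, ?_, hz.2⟩
    · rw [hk, show 6 * (3 * k + 2) = 18 * k + 12 by ring]; push_cast; rw [show (18 : ZMod 18) = 0 from rfl]; ring
    · rw [hk, show 12 * (3 * k + 2) = 18 * (2 * k + 1) + 6 by ring]; push_cast; rw [show (18 : ZMod 18) = 0 from rfl]; ring

/-- `K18 = pt 9 0`. [folklore] -/
private theorem K_eq_pt (h : Nat.Coprime 18 p) (hp : p.Prime) (h5 : 5 ≤ p) : (K18 : ZMod (18 * p)) = crtPt h 9 0 := by
  rw [← pt_crt h K18, crt_K h hp h5]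

/-- The kernel of the reduction `ℤ/18p → ℤ/6p` is `{0, 6p, 12p}`. [folklore] -/
private theorem castHom_eq_zero_iff [NeZero (18 * p)] (hp : 0 < p) (hnm : 6 * p ∣ 18 * p) {w : ZMod (18 * p)} :
    ZMod.castHom hnm (ZMod (6 * p)) w = 0 ↔ w = 0 ∨ w = D18 ∨ w = 2 * D18 := by
  haveI : NeZero (6 * p) := ⟨by omega⟩
  have hD := val_D (p := p) hp
  have h2D : ((2 : ZMod (18 * p)) * D18).val = 12 * p := by
    rw [show (2 : ZMod (18 * p)) * D18 = (((12 * p : ℕ)) : ZMod (18 * p)) by push_cast; ring, ZMod.val_natCast,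
      Nat.mod_eq_of_lt (by omega)]
  constructor
  · intro h0
    have hv := congrArg ZMod.val h0
    rw [val_castHom, ZMod.val_zero] at hv
    have hlt := ZMod.val_lt w
    obtain ⟨k, hk⟩ := Nat.dvd_of_mod_eq_zero hv
    have hk3 : k < 3 := by
      by_contra hk3
      have : 6 * p * 3 ≤ 6 * p * k := Nat.mul_le_mul_left _ (by omega)
      omega
    interval_cases k
    · left; apply ZMod.val_injective (18 * p); rw [ZMod.val_zero]; omega
    · right; left; apply ZMod.val_injective (18 * p); rw [hD]; omega
    · right; right; apply ZMod.val_injective (18 * p); rw [h2D]; omega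
  · rintro (rfl | rfl | rfl)
    · exact _root_.map_zero _
    · rw [map_natCast, show ((6 * p : ℕ) : ZMod (6 * p)) = 0 from ZMod.natCast_self _]
    · rw [_root_.map_mul, map_natCast, show ((6 * p : ℕ) : ZMod (6 * p)) = 0 from ZMod.natCast_self _, mul_zero]

/-- Two residues with the same reduction mod `6p` differ by `pt(e, 0)` with `e ∈ {0, 6, 12}`. [folklore] -/
private theorem lift_eq (h : Nat.Coprime 18 p) [NeZero (18 * p)] (hp : p.Prime) (h5 : 5 ≤ p) (hnm : 6 * p ∣ 18 * p)
    {a b : ZMod (18 * p)} (hab : ZMod.castHom hnm (ZMod (6 * p)) a = ZMod.castHom hnm (ZMod (6 * p)) b) :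
    ∃ e : ZMod 18, (e = 0 ∨ e = 6 ∨ e = 12) ∧ a = b + crtPt h e 0 := by
  have : ZMod.castHom hnm (ZMod (6 * p)) (a - b) = 0 := by rw [_root_.map_sub, hab, sub_self]
  rcases (castHom_eq_zero_iff hp.pos hnm).mp this with e | e | e
  · exact ⟨0, Or.inl rfl, by rw [pt_zero]; linear_combination e⟩
  · rcases crt_D h hp h5 with ⟨hD, -⟩ | ⟨hD, -⟩
    · have hq : crtPt h 6 0 = D18 := by rw [← pt_crt h D18, hD]
      exact ⟨6, Or.inr (Or.inl rfl), by rw [hq]; linear_combination e⟩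
    · have hq : crtPt h 12 0 = D18 := by rw [← pt_crt h D18, hD]
      exact ⟨12, Or.inr (Or.inr rfl), by rw [hq]; linear_combination e⟩
  · rcases crt_D h hp h5 with ⟨-, hD⟩ | ⟨-, hD⟩
    · have hq : crtPt h 12 0 = 2 * D18 := by rw [← pt_crt h (2 * D18), hD]
      exact ⟨12, Or.inr (Or.inr rfl), by rw [hq]; linear_combination e⟩
    · have hq : crtPt h 6 0 = 2 * D18 := by rw [← pt_crt h (2 * D18), hD]
      exact ⟨6, Or.inr (Or.inl rfl), by rw [hq]; linear_combination e⟩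

/-- The reduction of `9p` mod `6p` is `3p`. [folklore] -/
private theorem castHom_K (hnm : 6 * p ∣ 18 * p) : ZMod.castHom hnm (ZMod (6 * p)) K18 = K6 := by
  rw [map_natCast, show 9 * p = 3 * p + 6 * p by ring, Nat.cast_add, ZMod.natCast_self, add_zero]

/-! ### Residues mod `3` of the first coordinates -/

set_option synthInstance.maxHeartbeats 0 in
set_option synthInstance.maxSize 4096 in
/-- `Σ u = 0` with three multiples of `3` forces the fourth to be one (`k ≠ 3`). [folklore] -/
private theorem fin_k3 : ∀ u₁ u₂ u₃ : ZMod 18, u₁.val % 3 = 0 → u₂.val % 3 = 0 → u₃.val % 3 = 0 →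
    (-(u₁ + u₂ + u₃)).val % 3 = 0 := by
  decide

set_option synthInstance.maxHeartbeats 0 in
set_option synthInstance.maxSize 4096 in
/-- `Σ u = 0` with exactly one multiple of `3`: the other three residues mod `3` agree (`k = 1`). [folklore] -/
private theorem fin_k1 : ∀ u₁ u₂ u₃ : ZMod 18, u₁.val % 3 ≠ 0 → u₂.val % 3 ≠ 0 → u₃.val % 3 ≠ 0 →
    (-(u₁ + u₂ + u₃)).val % 3 = 0 → u₁.val % 3 = u₂.val % 3 ∧ u₁.val % 3 = u₃.val % 3 := by
  decide

set_option synthInstance.maxHeartbeats 0 in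
set_option synthInstance.maxSize 4096 in
/-- `Σ u = 0` with exactly two multiples of `3`: the other two are not equal mod `18` and `2u ≠ 0` (`k = 2`). [folklore] -/
private theorem fin_k2 : ∀ u₁ u₂ u₃ : ZMod 18, u₁.val % 3 ≠ 0 → u₂.val % 3 ≠ 0 → u₃.val % 3 = 0 →
    (-(u₁ + u₂ + u₃)).val % 3 = 0 → u₁ ≠ u₂ := by
  decide

/-- A non-zero multiple of `3` mod `18` has representative in `[2, 16]`; `2u ≠ 0` for `3 ∤ u`; `5u ∈ [2, 16]` for `u = ±1`.
[folklore] -/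
private theorem fin_range : ∀ u : ZMod 18, (u.val % 3 = 0 → u ≠ 0 → 2 ≤ u.val ∧ u.val ≤ 16) ∧ (u.val % 3 ≠ 0 → u + u ≠ 0) ∧
    (u.val % 3 ≠ 0 → ¬ (2 ≤ u.val ∧ u.val ≤ 16) → 2 ≤ (5 * u).val ∧ (5 * u).val ≤ 16) := by
  decide

/-! ### Evaluating the relations on a quadruple in coordinates -/

/-- The relations at a parameter `c ≠ 0`, as the sum of the four member contributions. [folklore] -/
private theorem rel_at {q₁ q₂ q₃ q₄ : ZMod 18 × ZMod p} (hR : Rels ({q₁, q₂, q₃, q₄} : Multiset (ZMod 18 × ZMod p)))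
    {c : ZMod p} (hc : c ≠ 0) :
    contrib A1 B1 c q₁.1 q₁.2 + contrib A1 B1 c q₂.1 q₂.2 + contrib A1 B1 c q₃.1 q₃.2 + contrib A1 B1 c q₄.1 q₄.2 = 0 ∧
      contrib A2 B2 c q₁.1 q₁.2 + contrib A2 B2 c q₂.1 q₂.2 + contrib A2 B2 c q₃.1 q₃.2 + contrib A2 B2 c q₄.1 q₄.2 = 0 := by
  obtain ⟨e1, e2⟩ := cR_four q₁ q₂ q₃ q₄ c
  exact ⟨e1 ▸ hR.rel1 c hc, e2 ▸ hR.rel2 c hc⟩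

/-- A member in the fibre `0` contributes nothing at any parameter `c ≠ 0`. [folklore] -/
private theorem contrib_fibre_zero (hp : p.Prime) (h17 : 17 ≤ p) {c : ZMod p} (hc : c ≠ 0) (A B : ZMod 18 → ℤ) (e : ZMod 18) :
    contrib A B c e 0 = 0 := by
  haveI := Fact.mk hp
  have h2 : (2 : ZMod p) ≠ 0 := by
    intro h2
    have := (ZMod.natCast_eq_zero_iff 2 p).mp (by exact_mod_cast h2)
    have := Nat.le_of_dvd (by norm_num) this; omega
  refine contrib_off A B e ?_ ?_ ?_ ?_
  · exact fun h0 ↦ hc h0.symm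
  · exact fun h0 ↦ hc (neg_eq_zero.mp h0.symm)
  · exact fun h0 ↦ hc ((mul_eq_zero.mp h0.symm).resolve_left h2)
  · exact fun h0 ↦ hc ((mul_eq_zero.mp (neg_eq_zero.mp h0.symm)).resolve_left h2)

/-- The coordinates of the members of `s = {x₁, x₂, x₃, x₄}`. [folklore] -/
private theorem map_crt_four (h : Nat.Coprime 18 p) (x₁ x₂ x₃ x₄ : ZMod (18 * p)) :
    Multiset.map (crt h) {x₁, x₂, x₃, x₄} =
      {((crt h x₁).1, (crt h x₁).2), ((crt h x₂).1, (crt h x₂).2), ((crt h x₃).1, (crt h x₃).2), ((crt h x₄).1, (crt h x₄).2)} := by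
  simp only [Multiset.insert_eq_cons, Multiset.map_cons, Multiset.map_singleton, Prod.mk.eta]

/-- **Isolation.** A member `(u, c)` with `3 ∤ u`, `c ≠ 0`, whose three companions contribute nothing at the parameter `c/2`, cannot
exist. [folklore] -/
private theorem isolated (hp : p.Prime) {u : ZMod 18} (hu : u.val % 3 ≠ 0) {c : ZMod p} (hc : c ≠ 0)
    {q₂ q₃ q₄ : ZMod 18 × ZMod p} (hR : Rels ({(u, c), q₂, q₃, q₄} : Multiset (ZMod 18 × ZMod p))) (h17 : 17 ≤ p)
    (h₂ : contrib A1 B1 (2⁻¹ * c) q₂.1 q₂.2 = 0 ∧ contrib A2 B2 (2⁻¹ * c) q₂.1 q₂.2 = 0)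
    (h₃ : contrib A1 B1 (2⁻¹ * c) q₃.1 q₃.2 = 0 ∧ contrib A2 B2 (2⁻¹ * c) q₃.1 q₃.2 = 0)
    (h₄ : contrib A1 B1 (2⁻¹ * c) q₄.1 q₄.2 = 0 ∧ contrib A2 B2 (2⁻¹ * c) q₄.1 q₄.2 = 0) : False := by
  haveI := Fact.mk hp
  have h2 : (2 : ZMod p) ≠ 0 := by
    intro h2
    have := (ZMod.natCast_eq_zero_iff 2 p).mp (by exact_mod_cast h2)
    have := Nat.le_of_dvd (by norm_num) this; omega
  have hc' : (2⁻¹ * c : ZMod p) ≠ 0 := mul_ne_zero (inv_ne_zero h2) hc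
  have hcc : c = 2 * (2⁻¹ * c) := by rw [← mul_assoc, mul_inv_cancel₀ h2, one_mul]
  obtain ⟨r1, r2⟩ := rel_at hR hc'
  obtain ⟨-, -, f1, -⟩ := contrib_fib hp h17 hc' A1 B1 u
  obtain ⟨-, -, f2, -⟩ := contrib_fib hp h17 hc' A2 B2 u
  rw [← hcc] at f1 f2
  simp only [] at r1 r2
  rw [f1, h₂.1, h₃.1, h₄.1] at r1
  rw [f2, h₂.2, h₃.2, h₄.2] at r2
  exact tablesB_ne hu ⟨by linarith, by linarith⟩


/-- `2 ≠ 0` in `ℤ/p`, `p ≥ 17`. [folklore] -/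
private theorem two_ne_zero' (h17 : 17 ≤ p) : (2 : ZMod p) ≠ 0 := by
  intro h2
  have := (ZMod.natCast_eq_zero_iff 2 p).mp (by exact_mod_cast h2)
  have := Nat.le_of_dvd (by norm_num) this
  omega

/-- A member in the fibre `i·d` contributes nothing at the parameter `j·d` when `i ∉ {±j, ±2j}` (`|i| ≤ 8`, `|j| ≤ 4`, `d ≠ 0`).
[folklore] -/
private theorem off (hp : p.Prime) (h17 : 17 ≤ p) {d : ZMod p} (hd : d ≠ 0) (i j : ℤ) (hi : |i| ≤ 8) (hj : |j| ≤ 4)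
    (h4 : i ≠ j ∧ i ≠ -j ∧ i ≠ 2 * j ∧ i ≠ -(2 * j)) (A B : ZMod 18 → ℤ) (e : ZMod 18) {f c : ZMod p} (hf : f = i * d)
    (hc : c = j * d) : contrib A B c e f = 0 := by
  have K : ∀ i' j' : ℤ, i' ≠ j' → |i'| ≤ 8 → |j'| ≤ 8 → (i' : ZMod p) * d ≠ (j' : ZMod p) * d :=
    fun i' j' hij hi' hj' ↦ kb_ne hp h17 hd hij hi' hj'
  have hj8 : |j| ≤ 8 := by omega
  have hnj : |-j| ≤ 8 := by rw [abs_neg]; omega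
  have h2j : |2 * j| ≤ 8 := by rw [abs_mul]; norm_num; omega
  have hn2j : |-(2 * j)| ≤ 8 := by rw [abs_neg, abs_mul]; norm_num; omega
  subst hf hc
  refine contrib_off A B e ?_ ?_ ?_ ?_
  · exact K i j h4.1 hi hj8
  · intro e'; exact K i (-j) h4.2.1 hi hnj (by push_cast; linear_combination e')
  · intro e'; exact K i (2 * j) h4.2.2.1 hi h2j (by push_cast; linear_combination e')
  · intro e'; exact K i (-(2 * j)) h4.2.2.2 hi hn2j (by push_cast; linear_combination e')

/-- **Twisted pairs.** Two members `(u₁, c₁)`, `(u₂, c₂)` prime to `3` and off the fibre `0`, not a pair, whose two companions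
contribute nothing at any parameter, balance the relations only if `u₂ = u₁`, `c₂ = −c₁`. [folklore] -/
private theorem pair_closed (hp : p.Prime) (h17 : 17 ≤ p) {u₁ u₂ : ZMod 18} (hu₁ : u₁.val % 3 ≠ 0) (hu₂ : u₂.val % 3 ≠ 0)
    {c₁ c₂ : ZMod p} (hc₁ : c₁ ≠ 0) (hc₂ : c₂ ≠ 0) {q₃ q₄ : ZMod 18 × ZMod p}
    (hq₃ : ∀ c : ZMod p, c ≠ 0 → contrib A1 B1 c q₃.1 q₃.2 = 0 ∧ contrib A2 B2 c q₃.1 q₃.2 = 0)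
    (hq₄ : ∀ c : ZMod p, c ≠ 0 → contrib A1 B1 c q₄.1 q₄.2 = 0 ∧ contrib A2 B2 c q₄.1 q₄.2 = 0)
    (hR : Rels ({(u₁, c₁), (u₂, c₂), q₃, q₄} : Multiset (ZMod 18 × ZMod p))) (hne : ¬ (u₁ + u₂ = 0 ∧ c₁ + c₂ = 0)) :
    u₂ = u₁ ∧ c₂ = -c₁ := by
  haveI := Fact.mk hp
  have h2 := two_ne_zero' h17
  -- half of `c₁` and of `c₂`
  set d₁ : ZMod p := 2⁻¹ * c₁ with hd₁
  set d₂ : ZMod p := 2⁻¹ * c₂ with hd₂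
  have hd₁0 : d₁ ≠ 0 := mul_ne_zero (inv_ne_zero h2) hc₁
  have hd₂0 : d₂ ≠ 0 := mul_ne_zero (inv_ne_zero h2) hc₂
  have ec₁ : c₁ = 2 * d₁ := by rw [hd₁, ← mul_assoc, mul_inv_cancel₀ h2, one_mul]
  have ec₂ : c₂ = 2 * d₂ := by rw [hd₂, ← mul_assoc, mul_inv_cancel₀ h2, one_mul]
  -- the relations at `c₁` and at `d₁`
  obtain ⟨r1, r2⟩ := rel_at hR hc₁
  obtain ⟨s1, s2⟩ := rel_at hR hd₁0
  simp only [] at r1 r2 s1 s2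
  rw [(hq₃ _ hc₁).1, (hq₄ _ hc₁).1, (contrib_fib hp h17 hc₁ A1 B1 u₁).1] at r1
  rw [(hq₃ _ hc₁).2, (hq₄ _ hc₁).2, (contrib_fib hp h17 hc₁ A2 B2 u₁).1] at r2
  rw [(hq₃ _ hd₁0).1, (hq₄ _ hd₁0).1] at s1
  rw [(hq₃ _ hd₁0).2, (hq₄ _ hd₁0).2] at s2
  have f1 := (contrib_fib hp h17 hd₁0 A1 B1 u₁).2.2.1
  have f2 := (contrib_fib hp h17 hd₁0 A2 B2 u₁).2.2.1
  rw [← ec₁] at f1 f2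
  rw [f1] at s1
  rw [f2] at s2
  by_cases e1 : c₂ = c₁
  · subst e1
    rw [(contrib_fib hp h17 hc₁ A1 B1 u₂).1] at r1
    rw [(contrib_fib hp h17 hc₁ A2 B2 u₂).1] at r2
    have g1 := (contrib_fib hp h17 hd₁0 A1 B1 u₂).2.2.1
    have g2 := (contrib_fib hp h17 hd₁0 A2 B2 u₂).2.2.1
    rw [← ec₁] at g1 g2
    rw [g1] at s1
    rw [g2] at s2
    exact (fin_pair_pos u₁ u₂ hu₁ hu₂ (by linarith) (by linarith) (by linarith) (by linarith)).elim
  by_cases e2 : c₂ = -c₁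
  · subst e2
    rw [(contrib_fib hp h17 hc₁ A1 B1 u₂).2.1] at r1
    rw [(contrib_fib hp h17 hc₁ A2 B2 u₂).2.1] at r2
    have g1 := (contrib_fib hp h17 hd₁0 A1 B1 u₂).2.2.2
    have g2 := (contrib_fib hp h17 hd₁0 A2 B2 u₂).2.2.2
    rw [← ec₁] at g1 g2
    rw [g1] at s1
    rw [g2] at s2
    have hsum : u₁ + u₂ ≠ 0 := fun e ↦ hne ⟨e, by ring⟩
    have := fin_pair_neg u₁ u₂ hu₁ hu₂ hsum (by linarith) (by linarith) (by linarith) (by linarith)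
    exact ⟨this.symm, rfl⟩
  by_cases e5 : c₁ = 2 * c₂
  · -- member `2` is isolated at the parameter `d₂`
    exfalso
    obtain ⟨t1, t2⟩ := rel_at hR hd₂0
    simp only [] at t1 t2
    have g1 := (contrib_fib hp h17 hd₂0 A1 B1 u₂).2.2.1
    have g2 := (contrib_fib hp h17 hd₂0 A2 B2 u₂).2.2.1
    rw [← ec₂] at g1 g2
    have o1 : contrib A1 B1 d₂ u₁ c₁ = 0 :=
      off hp h17 hd₂0 4 1 (by norm_num) (by norm_num) (by norm_num) A1 B1 u₁ (by rw [e5, ec₂]; ring) (by ring)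
    have o2 : contrib A2 B2 d₂ u₁ c₁ = 0 :=
      off hp h17 hd₂0 4 1 (by norm_num) (by norm_num) (by norm_num) A2 B2 u₁ (by rw [e5, ec₂]; ring) (by ring)
    rw [o1, g1, (hq₃ _ hd₂0).1, (hq₄ _ hd₂0).1] at t1
    rw [o2, g2, (hq₃ _ hd₂0).2, (hq₄ _ hd₂0).2] at t2
    exact tablesB_ne hu₂ ⟨by linarith, by linarith⟩
  by_cases e6 : c₁ = -(2 * c₂)
  · exfalso
    obtain ⟨t1, t2⟩ := rel_at hR hd₂0
    simp only [] at t1 t2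
    have g1 := (contrib_fib hp h17 hd₂0 A1 B1 u₂).2.2.1
    have g2 := (contrib_fib hp h17 hd₂0 A2 B2 u₂).2.2.1
    rw [← ec₂] at g1 g2
    have o1 : contrib A1 B1 d₂ u₁ c₁ = 0 :=
      off hp h17 hd₂0 (-4) 1 (by norm_num) (by norm_num) (by norm_num) A1 B1 u₁ (by rw [e6, ec₂]; push_cast; ring) (by ring)
    have o2 : contrib A2 B2 d₂ u₁ c₁ = 0 :=
      off hp h17 hd₂0 (-4) 1 (by norm_num) (by norm_num) (by norm_num) A2 B2 u₁ (by rw [e6, ec₂]; push_cast; ring) (by ring)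
    rw [o1, g1, (hq₃ _ hd₂0).1, (hq₄ _ hd₂0).1] at t1
    rw [o2, g2, (hq₃ _ hd₂0).2, (hq₄ _ hd₂0).2] at t2
    exact tablesB_ne hu₂ ⟨by linarith, by linarith⟩
  -- generic: member `1` is isolated at the parameter `d₁`
  exfalso
  have o1 : contrib A1 B1 d₁ u₂ c₂ = 0 := by
    refine contrib_off A1 B1 u₂ ?_ ?_ ?_ ?_
    · intro e; exact e5 (by rw [ec₁, ← e])
    · intro e; exact e6 (by rw [ec₁, show d₁ = -c₂ by rw [e, neg_neg]]; ring)
    · intro e; exact e1 (by rw [e, ec₁])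
    · intro e; exact e2 (by rw [e, ec₁])
  have o2 : contrib A2 B2 d₁ u₂ c₂ = 0 := by
    refine contrib_off A2 B2 u₂ ?_ ?_ ?_ ?_
    · intro e; exact e5 (by rw [ec₁, ← e])
    · intro e; exact e6 (by rw [ec₁, show d₁ = -c₂ by rw [e, neg_neg]]; ring)
    · intro e; exact e1 (by rw [e, ec₁])
    · intro e; exact e2 (by rw [e, ec₁])
  rw [o1] at s1
  rw [o2] at s2
  exact tablesB_ne hu₁ ⟨by linarith, by linarith⟩

/-! ### Case T: all members divisible by `3` -/

/-- **`k = 4`: all members divisible by `3`.** The thirds form a pair-free Hodge quadruple of level `6p`, classified by the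
tree's `classify_hodgeMultiset_sixPrime`; tripling gives `α_{3z}, β_{3z}, γ_{3z}`.
[cite: Shioda1982PicardFermat, Prop. 4 (Q′) p. 729] [cite: AokiShioda1983, §2 Theorem (𝔅²ₘ) (ii) a)–c), p. 3] -/
private theorem case_T [NeZero (18 * p)] (hp : p.Prime) (h17 : 17 ≤ p) {s : Multiset (ZMod (18 * p))}
    (hs : IsHodgeMultiset s) (hcard : Multiset.card s = 4) (hpf : ∀ a ∈ s, ∀ b ∈ s.erase a, a + b ≠ 0)
    (h3 : ∀ w ∈ s, w.val % 3 = 0) : IsStdOrLift s := by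
  classical
  have hp0 := hp.pos
  haveI : NeZero (6 * p) := ⟨by omega⟩
  have hnm : 6 * p ∣ 18 * p := ⟨3, by ring⟩
  obtain ⟨hσ, hrec⟩ := isHodgeMultiset_third hp0 hnm h3 hs
  have hcσ : Multiset.card (s.map third) = 4 := by rw [Multiset.card_map, hcard]
  obtain ⟨z, hz⟩ := classify_hodgeMultiset_sixPrime hp h17 hσ hcσ (third_pairfree h3 hpf)
  obtain ⟨tK, tD⟩ := triple_K (p := p) hp0
  have tn : ∀ (n : ℕ) (y : ZMod (6 * p)), triple p ((n : ZMod (6 * p)) * y) = (n : ZMod (18 * p)) * triple p y := fun n y ↦ by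
    rw [← nsmul_eq_mul, _root_.map_nsmul, nsmul_eq_mul]
  have t2 : ∀ y : ZMod (6 * p), triple p (2 * y) = 2 * triple p y := fun y ↦ by simpa using tn 2 y
  have t3 : ∀ y : ZMod (6 * p), triple p (3 * y) = 3 * triple p y := fun y ↦ by simpa using tn 3 y
  have t4 : ∀ y : ZMod (6 * p), triple p (4 * y) = 4 * triple p y := fun y ↦ by simpa using tn 4 y
  refine ⟨triple p z, ?_⟩
  rcases hz with e | e | e
  · left
    rw [← hrec, e]
    simp only [Multiset.insert_eq_cons, Multiset.map_cons, Multiset.map_singleton, _root_.map_add, _root_.map_neg, t2, tK]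
  · right; left
    rw [← hrec, e]
    simp only [Multiset.insert_eq_cons, Multiset.map_cons, Multiset.map_singleton, _root_.map_add, _root_.map_neg, t2, t4, tK]
  · right; right; left
    rw [← hrec, e]
    simp only [Multiset.insert_eq_cons, Multiset.map_cons, Multiset.map_singleton, _root_.map_add, _root_.map_neg, t2, t3, tD]

/-! ### Case `k = 2`: two members prime to `3`, two divisible by `3` -/

/-- The contributions of a member divisible by `3` vanish at every parameter. [folklore] -/
private theorem contrib_three' (h : Nat.Coprime 18 p) [NeZero (18 * p)] {x : ZMod (18 * p)} (hx : x.val % 3 = 0) :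
    ∀ c : ZMod p, c ≠ 0 → contrib A1 B1 c (crt h x).1 (crt h x).2 = 0 ∧ contrib A2 B2 c (crt h x).1 (crt h x).2 = 0 :=
  fun c _ ↦ contrib_three (by rw [fst_val_mod_three]; exact hx) c _

/-- The contributions of a member of the fibre `0` vanish at every parameter `c ≠ 0`. [folklore] -/
private theorem contrib_fibre_zero' (h : Nat.Coprime 18 p) [NeZero (18 * p)] (hp : p.Prime) (h17 : 17 ≤ p) {x : ZMod (18 * p)}
    (hx : (crt h x).2 = 0) :
    ∀ c : ZMod p, c ≠ 0 → contrib A1 B1 c (crt h x).1 (crt h x).2 = 0 ∧ contrib A2 B2 c (crt h x).1 (crt h x).2 = 0 :=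
  fun c hc ↦ by rw [hx]; exact ⟨contrib_fibre_zero hp h17 hc A1 B1 _, contrib_fibre_zero hp h17 hc A2 B2 _⟩

/-- **`k = 2` is impossible off the fibre `0`.** If the two members prime to `3` are both in the fibre `0`, the other two are
`(3v, ±c)` with `c ≠ 0` and the norm lemma applies; if exactly one is visible it is isolated; if both are, they form a twisted
pair `(u, c), (u, −c)`, contradicting `u₁ + u₂ ≡ 0 (mod 3)`. [folklore] -/
private theorem case_k2 (h : Nat.Coprime 18 p) [NeZero (18 * p)] (hp : p.Prime) (h17 : 17 ≤ p)
    {s : Multiset (ZMod (18 * p))} (hs : IsHodgeMultiset s) (hpf : ∀ a ∈ s, ∀ b ∈ s.erase a, a + b ≠ 0)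
    {x₁ x₂ x₃ x₄ : ZMod (18 * p)} (hsx : s = {x₁, x₂, x₃, x₄}) (h₁ : x₁.val % 3 ≠ 0) (h₂ : x₂.val % 3 ≠ 0)
    (h₃ : x₃.val % 3 = 0) (h₄ : x₄.val % 3 = 0) (hex : ∃ w ∈ s, (crt h w).2 ≠ 0) : False := by
  classical
  haveI := Fact.mk hp
  have h5 : 5 ≤ p := by omega
  obtain ⟨p12, p13, p14, p23, p24, p34⟩ := six_pairs hsx hpf
  have hR := rels_of_isHodgeMultiset h hp h5 hs
  rw [hsx, map_crt_four] at hR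
  have hu₁ : (crt h x₁).1.val % 3 ≠ 0 := by rw [fst_val_mod_three]; exact h₁
  have hu₂ : (crt h x₂).1.val % 3 ≠ 0 := by rw [fst_val_mod_three]; exact h₂
  have hu₃ : (crt h x₃).1.val % 3 = 0 := by rw [fst_val_mod_three]; exact h₃
  have hu₄ : (crt h x₄).1.val % 3 = 0 := by rw [fst_val_mod_three]; exact h₄
  -- `Σ = 0` in coordinates
  have hsum := hs.1.2
  rw [hsx] at hsum
  simp only [Multiset.insert_eq_cons, Multiset.sum_cons, Multiset.sum_singleton] at hsum
  have hsum1 : (crt h x₁).1 + (crt h x₂).1 + (crt h x₃).1 + (crt h x₄).1 = 0 := by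
    have := congrArg (fun w ↦ (crt h w).1) hsum
    simpa only [_root_.map_add, Prod.fst_add, _root_.map_zero, Prod.fst_zero, add_assoc] using this
  have hsum2 : (crt h x₁).2 + (crt h x₂).2 + (crt h x₃).2 + (crt h x₄).2 = 0 := by
    have := congrArg (fun w ↦ (crt h w).2) hsum
    simpa only [_root_.map_add, Prod.snd_add, _root_.map_zero, Prod.snd_zero, add_assoc] using this
  have e4 : (crt h x₄).1 = -((crt h x₁).1 + (crt h x₂).1 + (crt h x₃).1) := by linear_combination hsum1
  have hne12 : (crt h x₁).1 ≠ (crt h x₂).1 := fin_k2 _ _ _ hu₁ hu₂ hu₃ (e4 ▸ hu₄)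
  by_cases hc₁ : (crt h x₁).2 = 0
  · by_cases hc₂ : (crt h x₂).2 = 0
    · -- both prime-to-`3` members in the fibre `0`: norm lemma on `x₃, x₄`
      have hc₃ : (crt h x₃).2 ≠ 0 := by
        intro hc₃
        obtain ⟨w, hw, hw0⟩ := hex
        have hc₄ : (crt h x₄).2 = 0 := by rw [hc₁, hc₂, hc₃] at hsum2; simpa using hsum2
        rw [hsx] at hw
        simp only [Multiset.insert_eq_cons, Multiset.mem_cons, Multiset.mem_singleton] at hw
        rcases hw with rfl | rfl | rfl | rfl <;> contradiction
      have hsx' : s = {x₃, x₄, x₁, x₂} := by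
        rw [hsx]; simp only [Multiset.insert_eq_cons, ← Multiset.singleton_add]; abel
      have hsx'' : s = {x₄, x₃, x₁, x₂} := by
        rw [hsx]; simp only [Multiset.insert_eq_cons, ← Multiset.singleton_add]; abel
      by_cases hz₃ : (crt h x₃).1 = 0
      · -- use `x₄` (its first coordinate is a non-zero multiple of `3`)
        have hc₄ : (crt h x₄).2 ≠ 0 := by
          intro hc₄
          rw [hc₁, hc₂, hc₄] at hsum2
          exact hc₃ (by simpa using hsum2)
        have hz₄ : (crt h x₄).1 ≠ 0 := by
          intro hz₄
          apply p34
          rw [← pt_crt h x₃, ← pt_crt h x₄, hz₃, hz₄, pt_add, add_zero]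
          have : (crt h x₃).2 + (crt h x₄).2 = 0 := by rw [hc₁, hc₂] at hsum2; simpa using hsum2
          rw [this, pt_zero]
        obtain ⟨hr, -, -⟩ := fin_range (crt h x₄).1
        obtain ⟨hlo, hhi⟩ := hr hu₄ hz₄
        exact norm_lemma h hp h17 hs hsx'' hc₁ hc₂ hc₄ hlo hhi (by rw [add_comm]; exact p34)
      · obtain ⟨hr, -, -⟩ := fin_range (crt h x₃).1
        obtain ⟨hlo, hhi⟩ := hr hu₃ hz₃
        exact norm_lemma h hp h17 hs hsx' hc₁ hc₂ hc₃ hlo hhi p34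
    · -- `x₂` visible, `x₁` in the fibre `0`: isolated
      have hR' : Rels ({((crt h x₂).1, (crt h x₂).2), ((crt h x₁).1, (crt h x₁).2), ((crt h x₃).1, (crt h x₃).2),
          ((crt h x₄).1, (crt h x₄).2)} : Multiset (ZMod 18 × ZMod p)) := by
        rwa [Multiset.insert_eq_cons, Multiset.insert_eq_cons, Multiset.cons_swap, ← Multiset.insert_eq_cons,
          ← Multiset.insert_eq_cons]
      have hd : (2⁻¹ * (crt h x₂).2 : ZMod p) ≠ 0 := mul_ne_zero (inv_ne_zero (two_ne_zero' h17)) hc₂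
      exact isolated hp hu₂ hc₂ hR' h17 (contrib_fibre_zero' h hp h17 hc₁ _ hd) (contrib_three' h h₃ _ hd)
        (contrib_three' h h₄ _ hd)
  · by_cases hc₂ : (crt h x₂).2 = 0
    · have hd : (2⁻¹ * (crt h x₁).2 : ZMod p) ≠ 0 := mul_ne_zero (inv_ne_zero (two_ne_zero' h17)) hc₁
      exact isolated hp hu₁ hc₁ hR h17 (contrib_fibre_zero' h hp h17 hc₂ _ hd) (contrib_three' h h₃ _ hd)
        (contrib_three' h h₄ _ hd)
    · -- both visible: a twisted pair, `u₁ = u₂` — contradiction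
      have hne : ¬ ((crt h x₁).1 + (crt h x₂).1 = 0 ∧ (crt h x₁).2 + (crt h x₂).2 = 0) := by
        rintro ⟨e1, e2⟩
        apply p12
        rw [← pt_crt h x₁, ← pt_crt h x₂, pt_add, e1, e2, pt_zero]
      obtain ⟨hu, -⟩ := pair_closed hp h17 hu₁ hu₂ hc₁ hc₂ (contrib_three' h h₃) (contrib_three' h h₄) hR hne
      exact hne12 hu.symm


/-! ### Case `k = 1`: three members prime to `3` -/

/-- Reordering the coordinate multiset. [folklore] -/
private theorem perm4 {X : Type*} (q₁ q₂ q₃ q₄ : X) :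
    ({q₂, q₁, q₃, q₄} : Multiset X) = {q₁, q₂, q₃, q₄} ∧ ({q₃, q₁, q₂, q₄} : Multiset X) = {q₁, q₂, q₃, q₄} ∧
      ({q₁, q₃, q₂, q₄} : Multiset X) = {q₁, q₂, q₃, q₄} ∧ ({q₂, q₃, q₁, q₄} : Multiset X) = {q₁, q₂, q₃, q₄} ∧
      ({q₃, q₂, q₁, q₄} : Multiset X) = {q₁, q₂, q₃, q₄} := by
  simp only [Multiset.insert_eq_cons, ← Multiset.singleton_add]
  refine ⟨by abel, by abel, by abel, by abel, by abel⟩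

/-- **Shape `(c, c, c)`:** three members prime to `3` with equal residues mod `3` in one fibre `c ≠ 0`, the fourth contributing
nothing: the first coordinates are `{u, u + 6, u + 12}`. [folklore] -/
private theorem shape_ccc (hp : p.Prime) (h17 : 17 ≤ p) {u₁ u₂ u₃ : ZMod 18} (hu₁ : u₁.val % 3 ≠ 0)
    (h12 : u₁.val % 3 = u₂.val % 3) (h13 : u₁.val % 3 = u₃.val % 3) {c c₂ c₃ : ZMod p} (hc : c ≠ 0) (e2 : c₂ = c)
    (e3 : c₃ = c) {q₄ : ZMod 18 × ZMod p}
    (hq₄ : ∀ c : ZMod p, c ≠ 0 → contrib A1 B1 c q₄.1 q₄.2 = 0 ∧ contrib A2 B2 c q₄.1 q₄.2 = 0)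
    (hR : Rels ({(u₁, c), (u₂, c₂), (u₃, c₃), q₄} : Multiset (ZMod 18 × ZMod p))) :
    (u₂ = u₁ + 6 ∧ u₃ = u₁ + 12) ∨ (u₂ = u₁ + 12 ∧ u₃ = u₁ + 6) := by
  subst c₂ c₃
  haveI := Fact.mk hp
  have h2 := two_ne_zero' h17
  set d : ZMod p := 2⁻¹ * c with hd
  have hd0 : d ≠ 0 := mul_ne_zero (inv_ne_zero h2) hc
  have ec : c = 2 * d := by rw [hd, ← mul_assoc, mul_inv_cancel₀ h2, one_mul]
  obtain ⟨r1, r2⟩ := rel_at hR hc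
  obtain ⟨s1, s2⟩ := rel_at hR hd0
  simp only [] at r1 r2 s1 s2
  rw [(contrib_fib hp h17 hc A1 B1 u₁).1, (contrib_fib hp h17 hc A1 B1 u₂).1, (contrib_fib hp h17 hc A1 B1 u₃).1,
    (hq₄ _ hc).1] at r1
  rw [(contrib_fib hp h17 hc A2 B2 u₁).1, (contrib_fib hp h17 hc A2 B2 u₂).1, (contrib_fib hp h17 hc A2 B2 u₃).1,
    (hq₄ _ hc).2] at r2
  have f1 := fun u ↦ (contrib_fib hp h17 hd0 A1 B1 u).2.2.1
  have f2 := fun u ↦ (contrib_fib hp h17 hd0 A2 B2 u).2.2.1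
  simp only [← ec] at f1 f2
  rw [f1, f1, f1, (hq₄ _ hd0).1] at s1
  rw [f2, f2, f2, (hq₄ _ hd0).2] at s2
  exact fin_ccc u₁ u₂ u₃ hu₁ h12 h13 (by linarith) (by linarith) (by linarith) (by linarith)

/-- **Shape `(c, c, g)`, `g ≠ c`:** the third member forces `g ∈ {−c, 2c, −2c}`; `(c, c, −c)` and `(c, c, 2c)` are excluded and
`(c, c, −2c)` is `{u, u + 9}` over `c` and `−2u` over `−2c` (`α`). [folklore] -/
private theorem shape_ccg (hp : p.Prime) (h17 : 17 ≤ p) {u₁ u₂ u₃ : ZMod 18} (hu₁ : u₁.val % 3 ≠ 0) (hu₃ : u₃.val % 3 ≠ 0)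
    (h12 : u₁.val % 3 = u₂.val % 3) (h13 : u₁.val % 3 = u₃.val % 3) {c c₂ g : ZMod p} (hc : c ≠ 0) (e2 : c₂ = c) (hg : g ≠ 0)
    (hgc : g ≠ c) {q₄ : ZMod 18 × ZMod p}
    (hq₄ : ∀ c : ZMod p, c ≠ 0 → contrib A1 B1 c q₄.1 q₄.2 = 0 ∧ contrib A2 B2 c q₄.1 q₄.2 = 0)
    (hR : Rels ({(u₁, c), (u₂, c₂), (u₃, g), q₄} : Multiset (ZMod 18 × ZMod p))) :
    g = -(2 * c) ∧ u₂ = u₁ + 9 ∧ u₃ = -(2 * u₁) := by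
  subst c₂
  haveI := Fact.mk hp
  have h2 := two_ne_zero' h17
  set d : ZMod p := 2⁻¹ * c with hd
  have hd0 : d ≠ 0 := mul_ne_zero (inv_ne_zero h2) hc
  have ec : c = 2 * d := by rw [hd, ← mul_assoc, mul_inv_cancel₀ h2, one_mul]
  set d' : ZMod p := 2⁻¹ * g with hd'
  have hd'0 : d' ≠ 0 := mul_ne_zero (inv_ne_zero h2) hg
  have eg : g = 2 * d' := by rw [hd', ← mul_assoc, mul_inv_cancel₀ h2, one_mul]
  have h2c : (2 : ZMod p) * c ≠ 0 := mul_ne_zero h2 hc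
  -- the relations at `c`, `d = c/2`, `2c`
  obtain ⟨r1, r2⟩ := rel_at hR hc
  obtain ⟨s1, s2⟩ := rel_at hR hd0
  obtain ⟨t1, t2⟩ := rel_at hR h2c
  simp only [] at r1 r2 s1 s2 t1 t2
  rw [(contrib_fib hp h17 hc A1 B1 u₁).1, (contrib_fib hp h17 hc A1 B1 u₂).1, (hq₄ _ hc).1] at r1
  rw [(contrib_fib hp h17 hc A2 B2 u₁).1, (contrib_fib hp h17 hc A2 B2 u₂).1, (hq₄ _ hc).2] at r2
  have f1 := fun u ↦ (contrib_fib hp h17 hd0 A1 B1 u).2.2.1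
  have f2 := fun u ↦ (contrib_fib hp h17 hd0 A2 B2 u).2.2.1
  simp only [← ec] at f1 f2
  rw [f1, f1, (hq₄ _ hd0).1] at s1
  rw [f2, f2, (hq₄ _ hd0).2] at s2
  have o1 : contrib A1 B1 (2 * c) u₁ c = 0 :=
    off hp h17 hc 1 2 (by norm_num) (by norm_num) (by norm_num) A1 B1 u₁ (by ring) (by ring)
  have o2 : contrib A2 B2 (2 * c) u₁ c = 0 :=
    off hp h17 hc 1 2 (by norm_num) (by norm_num) (by norm_num) A2 B2 u₁ (by ring) (by ring)
  have o1' : contrib A1 B1 (2 * c) u₂ c = 0 :=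
    off hp h17 hc 1 2 (by norm_num) (by norm_num) (by norm_num) A1 B1 u₂ (by ring) (by ring)
  have o2' : contrib A2 B2 (2 * c) u₂ c = 0 :=
    off hp h17 hc 1 2 (by norm_num) (by norm_num) (by norm_num) A2 B2 u₂ (by ring) (by ring)
  rw [o1, o1', (hq₄ _ h2c).1] at t1
  rw [o2, o2', (hq₄ _ h2c).2] at t2
  by_cases e1 : g = -c
  · exfalso
    subst e1
    rw [(contrib_fib hp h17 hc A1 B1 u₃).2.1] at r1
    rw [(contrib_fib hp h17 hc A2 B2 u₃).2.1] at r2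
    have g1 := (contrib_fib hp h17 hd0 A1 B1 u₃).2.2.2
    have g2 := (contrib_fib hp h17 hd0 A2 B2 u₃).2.2.2
    rw [← ec] at g1 g2
    rw [g1] at s1
    rw [g2] at s2
    exact fin_ccm1 u₁ u₂ u₃ hu₁ h12 h13 (by linarith) (by linarith) (by linarith) (by linarith)
  by_cases e2 : g = 2 * c
  · exfalso
    subst e2
    rw [(contrib_fib hp h17 hc A1 B1 u₃).2.2.1] at r1
    rw [(contrib_fib hp h17 hc A2 B2 u₃).2.2.1] at r2
    have g1 : contrib A1 B1 d u₃ (2 * c) = 0 :=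
      off hp h17 hd0 4 1 (by norm_num) (by norm_num) (by norm_num) A1 B1 u₃ (by rw [ec]; ring) (by ring)
    have g2 : contrib A2 B2 d u₃ (2 * c) = 0 :=
      off hp h17 hd0 4 1 (by norm_num) (by norm_num) (by norm_num) A2 B2 u₃ (by rw [ec]; ring) (by ring)
    rw [g1] at s1
    rw [g2] at s2
    rw [(contrib_fib hp h17 h2c A1 B1 u₃).1] at t1
    rw [(contrib_fib hp h17 h2c A2 B2 u₃).1] at t2
    exact fin_cc2 u₁ u₂ u₃ hu₁ h12 h13 (by linarith) (by linarith) (by linarith) (by linarith) (by linarith) (by linarith)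
  by_cases e3 : g = -(2 * c)
  · subst e3
    rw [(contrib_fib hp h17 hc A1 B1 u₃).2.2.2] at r1
    rw [(contrib_fib hp h17 hc A2 B2 u₃).2.2.2] at r2
    have g1 : contrib A1 B1 d u₃ (-(2 * c)) = 0 :=
      off hp h17 hd0 (-4) 1 (by norm_num) (by norm_num) (by norm_num) A1 B1 u₃ (by rw [ec]; push_cast; ring) (by ring)
    have g2 : contrib A2 B2 d u₃ (-(2 * c)) = 0 :=
      off hp h17 hd0 (-4) 1 (by norm_num) (by norm_num) (by norm_num) A2 B2 u₃ (by rw [ec]; push_cast; ring) (by ring)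
    rw [g1] at s1
    rw [g2] at s2
    rw [(contrib_fib hp h17 h2c A1 B1 u₃).2.1] at t1
    rw [(contrib_fib hp h17 h2c A2 B2 u₃).2.1] at t2
    obtain ⟨e, e'⟩ := fin_ccm2 u₁ u₂ u₃ hu₁ h12 h13 (by linarith) (by linarith) (by linarith) (by linarith) (by linarith)
      (by linarith)
    exact ⟨rfl, e, e'⟩
  -- otherwise member `3` is isolated at `d' = g/2`
  exfalso
  obtain ⟨v1, v2⟩ := rel_at hR hd'0
  simp only [] at v1 v2
  have g1 := (contrib_fib hp h17 hd'0 A1 B1 u₃).2.2.1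
  have g2 := (contrib_fib hp h17 hd'0 A2 B2 u₃).2.2.1
  rw [← eg] at g1 g2
  have oc : ∀ (A B : ZMod 18 → ℤ) (u : ZMod 18), contrib A B d' u c = 0 := by
    intro A B u
    refine contrib_off A B u ?_ ?_ ?_ ?_
    · intro e; exact e2 (by rw [eg, ← e])
    · intro e; exact e3 (by rw [eg, show d' = -c by rw [e, neg_neg]]; ring)
    · intro e; exact hgc (by rw [eg, e])
    · intro e; exact e1 (by rw [eg, show 2 * d' = -c by rw [← neg_neg (2 * d'), ← e]])
  rw [oc, oc, g1, (hq₄ _ hd'0).1] at v1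
  rw [oc, oc, g2, (hq₄ _ hd'0).2] at v2
  exact tablesB_ne hu₃ ⟨by linarith, by linarith⟩

/-- **Shape `(c, −c, 2c)`:** excluded. [folklore] -/
private theorem shape_cm2 (hp : p.Prime) (h17 : 17 ≤ p) {u₁ u₂ u₃ : ZMod 18} (hu₁ : u₁.val % 3 ≠ 0)
    (h12 : u₁.val % 3 = u₂.val % 3) (h13 : u₁.val % 3 = u₃.val % 3) {c : ZMod p} (hc : c ≠ 0) {q₄ : ZMod 18 × ZMod p}
    (hq₄ : ∀ c : ZMod p, c ≠ 0 → contrib A1 B1 c q₄.1 q₄.2 = 0 ∧ contrib A2 B2 c q₄.1 q₄.2 = 0)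
    (hR : Rels ({(u₁, c), (u₂, -c), (u₃, 2 * c), q₄} : Multiset (ZMod 18 × ZMod p))) : False := by
  haveI := Fact.mk hp
  have h2 := two_ne_zero' h17
  set d : ZMod p := 2⁻¹ * c with hd
  have hd0 : d ≠ 0 := mul_ne_zero (inv_ne_zero h2) hc
  have ec : c = 2 * d := by rw [hd, ← mul_assoc, mul_inv_cancel₀ h2, one_mul]
  have h2c : (2 : ZMod p) * c ≠ 0 := mul_ne_zero h2 hc
  obtain ⟨r1, r2⟩ := rel_at hR hc
  obtain ⟨s1, s2⟩ := rel_at hR hd0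
  obtain ⟨t1, t2⟩ := rel_at hR h2c
  simp only [] at r1 r2 s1 s2 t1 t2
  rw [(contrib_fib hp h17 hc A1 B1 u₁).1, (contrib_fib hp h17 hc A1 B1 u₂).2.1, (contrib_fib hp h17 hc A1 B1 u₃).2.2.1,
    (hq₄ _ hc).1] at r1
  rw [(contrib_fib hp h17 hc A2 B2 u₁).1, (contrib_fib hp h17 hc A2 B2 u₂).2.1, (contrib_fib hp h17 hc A2 B2 u₃).2.2.1,
    (hq₄ _ hc).2] at r2
  have f1 := fun u ↦ (contrib_fib hp h17 hd0 A1 B1 u).2.2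
  have f2 := fun u ↦ (contrib_fib hp h17 hd0 A2 B2 u).2.2
  simp only [← ec] at f1 f2
  have g1 : contrib A1 B1 d u₃ (2 * c) = 0 :=
    off hp h17 hd0 4 1 (by norm_num) (by norm_num) (by norm_num) A1 B1 u₃ (by rw [ec]; ring) (by ring)
  have g2 : contrib A2 B2 d u₃ (2 * c) = 0 :=
    off hp h17 hd0 4 1 (by norm_num) (by norm_num) (by norm_num) A2 B2 u₃ (by rw [ec]; ring) (by ring)
  rw [(f1 u₁).1, (f1 u₂).2, g1, (hq₄ _ hd0).1] at s1
  rw [(f2 u₁).1, (f2 u₂).2, g2, (hq₄ _ hd0).2] at s2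
  have o : ∀ (A B : ZMod 18 → ℤ) (u : ZMod 18), contrib A B (2 * c) u c = 0 ∧ contrib A B (2 * c) u (-c) = 0 := fun A B u ↦
    ⟨off hp h17 hc 1 2 (by norm_num) (by norm_num) (by norm_num) A B u (by ring) (by ring),
      off hp h17 hc (-1) 2 (by norm_num) (by norm_num) (by norm_num) A B u (by push_cast; ring) (by ring)⟩
  rw [(o A1 B1 u₁).1, (o A1 B1 u₂).2, (contrib_fib hp h17 h2c A1 B1 u₃).1, (hq₄ _ h2c).1] at t1
  rw [(o A2 B2 u₁).1, (o A2 B2 u₂).2, (contrib_fib hp h17 h2c A2 B2 u₃).1, (hq₄ _ h2c).2] at t2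
  exact fin_cm2 u₁ u₂ u₃ hu₁ h12 h13 (by linarith) (by linarith) (by linarith) (by linarith) (by linarith) (by linarith)

/-- `pt 5 1` is a unit (`5 · 11 = 55 ≡ 1`). [folklore] -/
private theorem isUnit_pt_five (h : Nat.Coprime 18 p) : IsUnit (crtPt h 5 1) :=
  IsUnit.of_mul_eq_one (crtPt h 11 1) (by rw [pt_mul, mul_one, show (5 : ZMod 18) * 11 = 1 by decide, pt_one])

/-- **Shape S1** (a twisted pair plus two members of the fibre `0`): `{x, y, a, b}` with `y = (x₁, −x₂)`, `3 ∤ x₁`, `x₂ ≠ 0`,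
`a, b` in the fibre `0` is not a Hodge multiset — the norm lemma, after scaling by the unit `(5, 1)` when `x₁ = ±1`. [folklore] -/
private theorem shape_S1 (h : Nat.Coprime 18 p) [NeZero (18 * p)] (hp : p.Prime) (h17 : 17 ≤ p)
    {s : Multiset (ZMod (18 * p))} (hs : IsHodgeMultiset s) {x y a b : ZMod (18 * p)} (hsx : s = {x, y, a, b})
    (ha : (crt h a).2 = 0) (hb : (crt h b).2 = 0) (hx : (crt h x).2 ≠ 0) (hu : (crt h x).1.val % 3 ≠ 0) (hxy : x + y ≠ 0) :
    False := by
  classical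
  obtain ⟨-, -, h5⟩ := fin_range (crt h x).1
  by_cases hr : 2 ≤ (crt h x).1.val ∧ (crt h x).1.val ≤ 16
  · exact norm_lemma h hp h17 hs hsx ha hb hx hr.1 hr.2 hxy
  · obtain ⟨hlo, hhi⟩ := h5 hu hr
    obtain ⟨W, hW⟩ := isUnit_pt_five h
    have hs' := isHodgeMultiset_map_mul hs W
    rw [hsx] at hs'
    simp only [Multiset.insert_eq_cons, Multiset.map_cons, Multiset.map_singleton, hW] at hs'
    have cm : ∀ w : ZMod (18 * p), crt h (crtPt h 5 1 * w) = (5 * (crt h w).1, (crt h w).2) := fun w ↦ by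
      conv_lhs => rw [← pt_crt h w, pt_mul, crt_pt, one_mul]
    refine norm_lemma h hp h17 hs' rfl (x := crtPt h 5 1 * x) (y := crtPt h 5 1 * y) (a := crtPt h 5 1 * a)
      (b := crtPt h 5 1 * b) ?_ ?_ ?_ ?_ ?_ ?_
    · rw [cm, ha]
    · rw [cm, hb]
    · rw [cm]; exact hx
    · rw [cm]; exact hlo
    · rw [cm]; exact hhi
    · rw [← mul_add, ← hW]; exact (Units.mul_right_eq_zero W).not.mpr hxy

/-- Pointing: `x` points to `y` when `2y₂ = ±x₂`. No two members point at each other, and there is no `3`-cycle (`p ∤ 3·5·7·9`).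
[folklore] -/
private theorem no_cycles (hp : p.Prime) (h17 : 17 ≤ p) {a b c : ZMod p} (ha : a ≠ 0) :
    ((2 * b = a ∨ 2 * b = -a) → (2 * a = b ∨ 2 * a = -b) → False) ∧
      ((2 * b = a ∨ 2 * b = -a) → (2 * c = b ∨ 2 * c = -b) → (2 * a = c ∨ 2 * a = -c) → False) := by
  have K : ∀ i j : ℤ, i ≠ j → |i| ≤ 8 → |j| ≤ 8 → (i : ZMod p) * a ≠ (j : ZMod p) * a :=
    fun i j hij hi hj ↦ kb_ne hp h17 ha hij hi hj
  constructor
  · rintro (h1 | h1) (h2 | h2)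
    · exact K 4 1 (by norm_num) (by norm_num) (by norm_num) (by push_cast; linear_combination 2 * h2 + h1)
    · exact K 4 (-1) (by norm_num) (by norm_num) (by norm_num) (by push_cast; linear_combination 2 * h2 - h1)
    · exact K 4 (-1) (by norm_num) (by norm_num) (by norm_num) (by push_cast; linear_combination 2 * h2 + h1)
    · exact K 4 1 (by norm_num) (by norm_num) (by norm_num) (by push_cast; linear_combination 2 * h2 - h1)
  · rintro (h1 | h1) (h2 | h2) (h3 | h3)
    · exact K 8 1 (by norm_num) (by norm_num) (by norm_num) (by push_cast; linear_combination 4 * h3 + 2 * h2 + h1)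
    · exact K 8 (-1) (by norm_num) (by norm_num) (by norm_num) (by push_cast; linear_combination 4 * h3 - 2 * h2 - h1)
    · exact K 8 (-1) (by norm_num) (by norm_num) (by norm_num) (by push_cast; linear_combination 4 * h3 + 2 * h2 - h1)
    · exact K 8 1 (by norm_num) (by norm_num) (by norm_num) (by push_cast; linear_combination 4 * h3 - 2 * h2 + h1)
    · exact K 8 (-1) (by norm_num) (by norm_num) (by norm_num) (by push_cast; linear_combination 4 * h3 + 2 * h2 + h1)
    · exact K 8 1 (by norm_num) (by norm_num) (by norm_num) (by push_cast; linear_combination 4 * h3 - 2 * h2 - h1)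
    · exact K 8 1 (by norm_num) (by norm_num) (by norm_num) (by push_cast; linear_combination 4 * h3 + 2 * h2 - h1)
    · exact K 8 (-1) (by norm_num) (by norm_num) (by norm_num) (by push_cast; linear_combination 4 * h3 - 2 * h2 + h1)

/-- **Pointing from isolation:** a visible member `(u, x)` whose companions are `(u', y)`, `(u'', z)` (off the fibres `±x`) and a
silent one points to one of them: `2y = ±x` or `2z = ±x`. [folklore] -/
private theorem points (hp : p.Prime) (h17 : 17 ≤ p) {u u' u'' : ZMod 18} (hu : u.val % 3 ≠ 0) {x y z : ZMod p} (hx : x ≠ 0)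
    (hyx : y ≠ x) (hyx' : y ≠ -x) (hzx : z ≠ x) (hzx' : z ≠ -x) {q₄ : ZMod 18 × ZMod p}
    (hq₄ : ∀ c : ZMod p, c ≠ 0 → contrib A1 B1 c q₄.1 q₄.2 = 0 ∧ contrib A2 B2 c q₄.1 q₄.2 = 0)
    (hR : Rels ({(u, x), (u', y), (u'', z), q₄} : Multiset (ZMod 18 × ZMod p))) :
    (2 * y = x ∨ 2 * y = -x) ∨ (2 * z = x ∨ 2 * z = -x) := by
  haveI := Fact.mk hp
  have h2 := two_ne_zero' h17
  by_contra hn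
  simp only [not_or] at hn
  obtain ⟨⟨hy1, hy2⟩, hz1, hz2⟩ := hn
  set d : ZMod p := 2⁻¹ * x with hd
  have hd0 : d ≠ 0 := mul_ne_zero (inv_ne_zero h2) hx
  have ex : x = 2 * d := by rw [hd, ← mul_assoc, mul_inv_cancel₀ h2, one_mul]
  have o : ∀ (A B : ZMod 18 → ℤ) (v : ZMod 18) (w : ZMod p), w ≠ x → w ≠ -x → 2 * w ≠ x → 2 * w ≠ -x →
      contrib A B d v w = 0 := by
    intro A B v w h1 h1' h3 h4
    refine contrib_off A B v ?_ ?_ ?_ ?_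
    · intro e; exact h3 (by rw [e, ← ex])
    · intro e; exact h4 (by rw [e, ex]; ring)
    · intro e; exact h1 (by rw [e, ex])
    · intro e; exact h1' (by rw [e, ex])
  exact isolated hp hu hx hR h17 ⟨o A1 B1 u' y hyx hyx' hy1 hy2, o A2 B2 u' y hyx hyx' hy1 hy2⟩
    ⟨o A1 B1 u'' z hzx hzx' hz1 hz2, o A2 B2 u'' z hzx hzx' hz1 hz2⟩ (hq₄ _ hd0)

/-- **`k = 1`, three visible members with pairwise distinct fibres:** excluded (two opposite fibres lead to the shape
`(c, −c, ±2c)`; otherwise the pointing graph has a `2`- or `3`-cycle). [folklore] -/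
private theorem k1_distinct (hp : p.Prime) (h17 : 17 ≤ p) {u₁ u₂ u₃ : ZMod 18} (hu₁ : u₁.val % 3 ≠ 0)
    (hu₂ : u₂.val % 3 ≠ 0) (hu₃ : u₃.val % 3 ≠ 0) (h12 : u₁.val % 3 = u₂.val % 3) (h13 : u₁.val % 3 = u₃.val % 3)
    {c₁ c₂ c₃ : ZMod p} (hc₁ : c₁ ≠ 0) (hc₂ : c₂ ≠ 0) (hc₃ : c₃ ≠ 0) (h12' : c₁ ≠ c₂) (h13' : c₁ ≠ c₃) (h23' : c₂ ≠ c₃)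
    {q₄ : ZMod 18 × ZMod p} (hq₄ : ∀ c : ZMod p, c ≠ 0 → contrib A1 B1 c q₄.1 q₄.2 = 0 ∧ contrib A2 B2 c q₄.1 q₄.2 = 0)
    (hR : Rels ({(u₁, c₁), (u₂, c₂), (u₃, c₃), q₄} : Multiset (ZMod 18 × ZMod p))) : False := by
  haveI := Fact.mk hp
  have h21 : u₂.val % 3 = u₁.val % 3 := h12.symm
  have h23 : u₂.val % 3 = u₃.val % 3 := h12 ▸ h13
  have h31 : u₃.val % 3 = u₁.val % 3 := h13.symm
  have h32 : u₃.val % 3 = u₂.val % 3 := h13 ▸ h12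
  -- two opposite fibres: the third member points to one of them, and the shape `(f, −f, 2f)` appears
  have opp : ∀ {v₁ v₂ v₃ : ZMod 18} {f g : ZMod p}, v₁.val % 3 ≠ 0 → v₂.val % 3 ≠ 0 → v₃.val % 3 ≠ 0 →
      v₁.val % 3 = v₂.val % 3 → v₁.val % 3 = v₃.val % 3 → f ≠ 0 → g ≠ 0 → g ≠ f → g ≠ -f →
      Rels ({(v₁, f), (v₂, -f), (v₃, g), q₄} : Multiset (ZMod 18 × ZMod p)) → False := by
    intro v₁ v₂ v₃ f g hv₁ hv₂ hv₃ e12 e13 hf hg hgf hgf' hRv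
    obtain ⟨Q12, Q13, -, -, -⟩ := perm4 (v₁, f) (v₂, -f) (v₃, g) q₄
    have hneg : -f ≠ 0 := neg_ne_zero.mpr hf
    have hR3 : Rels ({(v₃, g), (v₁, f), (v₂, -f), q₄} : Multiset (ZMod 18 × ZMod p)) := by rw [Q13]; exact hRv
    have hP := points hp h17 hv₃ hg (Ne.symm hgf) (fun e ↦ hgf' (by rw [e, neg_neg])) (fun e ↦ hgf' e.symm)
      (fun e ↦ hgf (neg_injective e).symm) hq₄ hR3
    have hR2 : Rels ({(v₂, -f), (v₁, f), (v₃, g), q₄} : Multiset (ZMod 18 × ZMod p)) := by rw [Q12]; exact hRv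
    rcases hP with (e | e) | (e | e)
    · have hR' := hRv
      rw [← e] at hR'
      exact shape_cm2 hp h17 hv₁ e12 e13 hf hq₄ hR'
    · have e' : g = 2 * -f := by linear_combination e
      rw [e', show ((v₁, f) : ZMod 18 × ZMod p) = (v₁, -(-f)) by rw [neg_neg]] at hR2
      exact shape_cm2 hp h17 hv₂ e12.symm (e12 ▸ e13) hneg hq₄ hR2
    · rw [← e, show ((v₁, f) : ZMod 18 × ZMod p) = (v₁, -(-f)) by rw [neg_neg]] at hR2
      exact shape_cm2 hp h17 hv₂ e12.symm (e12 ▸ e13) hneg hq₄ hR2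
    · have e' : g = 2 * f := by linear_combination e
      have hR' := hRv
      rw [e'] at hR'
      exact shape_cm2 hp h17 hv₁ e12 e13 hf hq₄ hR'
  obtain ⟨P12, P13, P132, P23, -⟩ := perm4 (u₁, c₁) (u₂, c₂) (u₃, c₃) q₄
  by_cases o12 : c₂ = -c₁
  · subst o12
    exact opp hu₁ hu₂ hu₃ h12 h13 hc₁ hc₃ (Ne.symm h13') (Ne.symm h23') hR
  by_cases o13 : c₃ = -c₁
  · subst o13
    exact opp hu₁ hu₃ hu₂ h13 h12 hc₁ hc₂ (Ne.symm h12') h23' (by rw [P132]; exact hR)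
  by_cases o23 : c₃ = -c₂
  · subst o23
    exact opp hu₂ hu₃ hu₁ h23 h21 hc₂ hc₁ h12' h13' (by rw [P23]; exact hR)
  -- no two opposite fibres: everybody points, and the pointing graph has a short cycle
  have Pa := points hp h17 hu₁ hc₁ (Ne.symm h12') o12 (Ne.symm h13') o13 hq₄ hR
  have Pb := points hp h17 hu₂ hc₂ h12' (fun e ↦ o12 (by rw [e, neg_neg])) (Ne.symm h23') o23 hq₄ (by rw [P12]; exact hR)
  have Pc := points hp h17 hu₃ hc₃ h13' (fun e ↦ o13 (by rw [e, neg_neg])) h23' (fun e ↦ o23 (by rw [e, neg_neg])) hq₄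
    (by rw [P13]; exact hR)
  obtain ⟨n12, c123⟩ := no_cycles hp h17 (b := c₂) (c := c₃) hc₁
  obtain ⟨n13, c132⟩ := no_cycles hp h17 (b := c₃) (c := c₂) hc₁
  obtain ⟨n23, -⟩ := no_cycles hp h17 (b := c₃) (c := c₁) hc₂
  obtain ⟨n32, -⟩ := no_cycles hp h17 (b := c₂) (c := c₁) hc₃
  rcases Pa with Pab | Pac
  · rcases Pb with Pba | Pbc
    · exact n12 Pab Pba
    · rcases Pc with Pca | Pcb
      · exact c123 Pab Pbc Pca
      · exact n23 Pbc Pcb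
  · rcases Pc with Pca | Pcb
    · exact n13 Pac Pca
    · rcases Pb with Pba | Pbc
      · exact c132 Pac Pcb Pba
      · exact n32 Pcb Pbc

/-- Scalar multiples in coordinates. [folklore] -/
private theorem natCast_mul_pt (h : Nat.Coprime 18 p) (n : ℕ) (e : ZMod 18) (f : ZMod p) :
    (n : ZMod (18 * p)) * crtPt h e f = crtPt h (n * e) (n * f) := by
  rw [show (n : ZMod (18 * p)) = crtPt h n n by rw [← pt_crt h n, crt_natCast], pt_mul]

/-- The multiset equality `α` from coordinates. [folklore] -/
private theorem alpha_of_coords (h : Nat.Coprime 18 p) [NeZero (18 * p)] (hp : p.Prime) (h5 : 5 ≤ p) {x₁ x₂ x₃ x₄ : ZMod (18 * p)}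
    (e2 : x₂ = crtPt h ((crt h x₁).1 + 9) (crt h x₁).2) (e3 : x₃ = crtPt h (-(2 * (crt h x₁).1)) (-(2 * (crt h x₁).2)))
    (e4 : x₄ = crtPt h 9 0) : ({x₁, x₂, x₃, x₄} : Multiset (ZMod (18 * p))) = {x₁, x₁ + K18, -(2 * x₁), K18} := by
  have t2 : (2 : ZMod (18 * p)) * crtPt h (crt h x₁).1 (crt h x₁).2 = crtPt h (2 * (crt h x₁).1) (2 * (crt h x₁).2) := by
    simpa using natCast_mul_pt h 2 (crt h x₁).1 (crt h x₁).2
  have ex : x₁ = crtPt h (crt h x₁).1 (crt h x₁).2 := (pt_crt h x₁).symm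
  rw [e2, e3, e4, K_eq_pt h hp h5]
  conv_rhs => rw [ex]
  rw [pt_add, add_zero, t2, neg_pt, ← ex]

/-- The multiset equality `γ` from coordinates. [folklore] -/
private theorem gamma_of_coords (h : Nat.Coprime 18 p) [NeZero (18 * p)] (hp : p.Prime) (h5 : 5 ≤ p) {x₁ x₂ x₃ x₄ : ZMod (18 * p)}
    (e23 : (x₂ = crtPt h ((crt h x₁).1 + 6) (crt h x₁).2 ∧ x₃ = crtPt h ((crt h x₁).1 + 12) (crt h x₁).2) ∨
      (x₂ = crtPt h ((crt h x₁).1 + 12) (crt h x₁).2 ∧ x₃ = crtPt h ((crt h x₁).1 + 6) (crt h x₁).2))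
    (e4 : x₄ = crtPt h (-(3 * (crt h x₁).1)) (-(3 * (crt h x₁).2))) :
    ({x₁, x₂, x₃, x₄} : Multiset (ZMod (18 * p))) = {x₁, x₁ + D18, x₁ + 2 * D18, -(3 * x₁)} := by
  have t3 : (3 : ZMod (18 * p)) * crtPt h (crt h x₁).1 (crt h x₁).2 = crtPt h (3 * (crt h x₁).1) (3 * (crt h x₁).2) := by
    simpa using natCast_mul_pt h 3 (crt h x₁).1 (crt h x₁).2
  have hD6 : ∀ {e : ZMod 18}, crt h D18 = (e, 0) → x₁ + D18 = crtPt h ((crt h x₁).1 + e) (crt h x₁).2 := fun hD ↦ by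
    conv_lhs => rw [← pt_crt h x₁, ← pt_crt h D18, hD, pt_add, add_zero]
  have hD12 : ∀ {e : ZMod 18}, crt h (2 * D18) = (e, 0) → x₁ + 2 * D18 = crtPt h ((crt h x₁).1 + e) (crt h x₁).2 :=
    fun hD ↦ by conv_lhs => rw [← pt_crt h x₁, ← pt_crt h (2 * D18), hD, pt_add, add_zero]
  have hx4 : -(3 * x₁) = x₄ := by rw [e4]; conv_lhs => rw [← pt_crt h x₁]; rw [t3, neg_pt]
  rw [hx4]
  rcases crt_D h hp h5 with ⟨hD, hD2⟩ | ⟨hD, hD2⟩ <;> rcases e23 with ⟨e2, e3⟩ | ⟨e2, e3⟩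
  · rw [hD6 hD, hD12 hD2, ← e2, ← e3]
  · rw [hD6 hD, hD12 hD2, ← e2, ← e3]
    simp only [Multiset.insert_eq_cons, ← Multiset.singleton_add]; abel
  · rw [hD6 hD, hD12 hD2, ← e2, ← e3]
    simp only [Multiset.insert_eq_cons, ← Multiset.singleton_add]; abel
  · rw [hD6 hD, hD12 hD2, ← e2, ← e3]

/-- A member from its coordinates. [folklore] -/
private theorem eq_pt_of (h : Nat.Coprime 18 p) {x : ZMod (18 * p)} {e : ZMod 18} {f : ZMod p} (he : (crt h x).1 = e)
    (hf : (crt h x).2 = f) : x = crtPt h e f := by rw [← pt_crt h x, he, hf]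

/-- **`k = 1`: three members prime to `3`, one divisible by `3`, not all in the fibre `0` ⇒ `α` or `γ`.**
[cite: Shioda1982PicardFermat, Prop. 4 (Q′) p. 729] [cite: AokiShioda1983, §2 Theorem (𝔅²ₘ) (ii) a), c), p. 3] -/
private theorem case_k1 (h : Nat.Coprime 18 p) [NeZero (18 * p)] (hp : p.Prime) (h17 : 17 ≤ p)
    {s : Multiset (ZMod (18 * p))} (hs : IsHodgeMultiset s) (hpf : ∀ a ∈ s, ∀ b ∈ s.erase a, a + b ≠ 0)
    {x₁ x₂ x₃ x₄ : ZMod (18 * p)} (hsx : s = {x₁, x₂, x₃, x₄}) (h₁ : x₁.val % 3 ≠ 0) (h₂ : x₂.val % 3 ≠ 0)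
    (h₃ : x₃.val % 3 ≠ 0) (h₄ : x₄.val % 3 = 0) (hex : ∃ w ∈ s, (crt h w).2 ≠ 0) : IsStdOrLift s := by
  classical
  haveI := Fact.mk hp
  have h5 : 5 ≤ p := by omega
  have h2 := two_ne_zero' h17
  obtain ⟨p12, p13, p14, p23, p24, p34⟩ := six_pairs hsx hpf
  have hR := rels_of_isHodgeMultiset h hp h5 hs
  rw [hsx, map_crt_four] at hR
  have hu₁ : (crt h x₁).1.val % 3 ≠ 0 := by rw [fst_val_mod_three]; exact h₁
  have hu₂ : (crt h x₂).1.val % 3 ≠ 0 := by rw [fst_val_mod_three]; exact h₂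
  have hu₃ : (crt h x₃).1.val % 3 ≠ 0 := by rw [fst_val_mod_three]; exact h₃
  have hu₄ : (crt h x₄).1.val % 3 = 0 := by rw [fst_val_mod_three]; exact h₄
  have hq₄ := contrib_three' h h₄
  -- `Σ = 0` in coordinates
  have hsum := hs.1.2
  rw [hsx] at hsum
  simp only [Multiset.insert_eq_cons, Multiset.sum_cons, Multiset.sum_singleton] at hsum
  have hsum1 : (crt h x₁).1 + (crt h x₂).1 + (crt h x₃).1 + (crt h x₄).1 = 0 := by
    have := congrArg (fun w ↦ (crt h w).1) hsum
    simpa only [_root_.map_add, Prod.fst_add, _root_.map_zero, Prod.fst_zero, add_assoc] using this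
  have hsum2 : (crt h x₁).2 + (crt h x₂).2 + (crt h x₃).2 + (crt h x₄).2 = 0 := by
    have := congrArg (fun w ↦ (crt h w).2) hsum
    simpa only [_root_.map_add, Prod.snd_add, _root_.map_zero, Prod.snd_zero, add_assoc] using this
  have e4 : (crt h x₄).1 = -((crt h x₁).1 + (crt h x₂).1 + (crt h x₃).1) := by linear_combination hsum1
  have e4' : (crt h x₄).2 = -((crt h x₁).2 + (crt h x₂).2 + (crt h x₃).2) := by linear_combination hsum2
  obtain ⟨h12r, h13r⟩ := fin_k1 _ _ _ hu₁ hu₂ hu₃ (e4 ▸ hu₄)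
  obtain ⟨P12, P13, P132, P23, -⟩ :=
    perm4 ((crt h x₁).1, (crt h x₁).2) ((crt h x₂).1, (crt h x₂).2) ((crt h x₃).1, (crt h x₃).2) ((crt h x₄).1, (crt h x₄).2)
  have pne : ∀ {a b : ZMod (18 * p)}, a + b ≠ 0 → ¬ ((crt h a).1 + (crt h b).1 = 0 ∧ (crt h a).2 + (crt h b).2 = 0) := by
    rintro a b hab ⟨e1, e2⟩
    apply hab
    rw [← pt_crt h a, ← pt_crt h b, pt_add, e1, e2, pt_zero]
  by_cases hc₁ : (crt h x₁).2 = 0 <;> by_cases hc₂ : (crt h x₂).2 = 0 <;> by_cases hc₃ : (crt h x₃).2 = 0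
  · -- all in the fibre `0`
    exfalso
    obtain ⟨w, hw, hw0⟩ := hex
    have hc₄ : (crt h x₄).2 = 0 := by rw [e4', hc₁, hc₂, hc₃]; ring
    rw [hsx] at hw
    simp only [Multiset.insert_eq_cons, Multiset.mem_cons, Multiset.mem_singleton] at hw
    rcases hw with rfl | rfl | rfl | rfl <;> contradiction
  · -- only `x₃` visible: isolated
    exfalso
    have hd : (2⁻¹ * (crt h x₃).2 : ZMod p) ≠ 0 := mul_ne_zero (inv_ne_zero h2) hc₃
    exact isolated hp hu₃ hc₃ (by rw [P13]; exact hR) h17 (contrib_fibre_zero' h hp h17 hc₁ _ hd)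
      (contrib_fibre_zero' h hp h17 hc₂ _ hd) (hq₄ _ hd)
  · -- only `x₂` visible
    exfalso
    have hd : (2⁻¹ * (crt h x₂).2 : ZMod p) ≠ 0 := mul_ne_zero (inv_ne_zero h2) hc₂
    exact isolated hp hu₂ hc₂ (by rw [P12]; exact hR) h17 (contrib_fibre_zero' h hp h17 hc₁ _ hd)
      (contrib_fibre_zero' h hp h17 hc₃ _ hd) (hq₄ _ hd)
  · -- `x₂, x₃` visible, `x₁` in the fibre `0`: twisted pair, shape S1
    exfalso
    obtain ⟨eu, ec⟩ := pair_closed hp h17 hu₂ hu₃ hc₂ hc₃ (contrib_fibre_zero' h hp h17 hc₁) hq₄ (by rw [P23]; exact hR)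
      (pne p23)
    have hc₄ : (crt h x₄).2 = 0 := by rw [e4', hc₁, ec]; ring
    have hsx' : s = {x₂, x₃, x₁, x₄} := by rw [hsx]; simp only [Multiset.insert_eq_cons, ← Multiset.singleton_add]; abel
    exact shape_S1 h hp h17 hs hsx' hc₁ hc₄ hc₂ hu₂ p23
  · -- only `x₁` visible
    exfalso
    have hd : (2⁻¹ * (crt h x₁).2 : ZMod p) ≠ 0 := mul_ne_zero (inv_ne_zero h2) hc₁
    exact isolated hp hu₁ hc₁ hR h17 (contrib_fibre_zero' h hp h17 hc₂ _ hd) (contrib_fibre_zero' h hp h17 hc₃ _ hd)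
      (hq₄ _ hd)
  · -- `x₁, x₃` visible
    exfalso
    obtain ⟨eu, ec⟩ := pair_closed hp h17 hu₁ hu₃ hc₁ hc₃ (contrib_fibre_zero' h hp h17 hc₂) hq₄ (by rw [P132]; exact hR)
      (pne p13)
    have hc₄ : (crt h x₄).2 = 0 := by rw [e4', hc₂, ec]; ring
    have hsx' : s = {x₁, x₃, x₂, x₄} := by rw [hsx]; simp only [Multiset.insert_eq_cons, ← Multiset.singleton_add]; abel
    exact shape_S1 h hp h17 hs hsx' hc₂ hc₄ hc₁ hu₁ p13
  · -- `x₁, x₂` visible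
    exfalso
    obtain ⟨eu, ec⟩ := pair_closed hp h17 hu₁ hu₂ hc₁ hc₂ (contrib_fibre_zero' h hp h17 hc₃) hq₄ hR (pne p12)
    have hc₄ : (crt h x₄).2 = 0 := by rw [e4', hc₃, ec]; ring
    exact shape_S1 h hp h17 hs hsx hc₃ hc₄ hc₁ hu₁ p12
  · -- all three visible
    by_cases e12 : (crt h x₁).2 = (crt h x₂).2
    · by_cases e13 : (crt h x₁).2 = (crt h x₃).2
      · -- shape `(c, c, c)`: `γ`
        have hγ := shape_ccc hp h17 hu₁ h12r h13r hc₁ e12.symm e13.symm hq₄ hR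
        refine ⟨x₁, Or.inr (Or.inr (Or.inl ?_))⟩
        rw [hsx]
        have e4u : (crt h x₄).1 = -(3 * (crt h x₁).1) := by
          rw [e4]; rcases hγ with ⟨a, b⟩ | ⟨a, b⟩ <;> rw [a, b] <;> ring_nf <;> rw [show (18 : ZMod 18) = 0 from rfl] <;> ring
        refine gamma_of_coords h hp h5 ?_ (eq_pt_of h e4u (by rw [e4', ← e12, ← e13]; ring))
        rcases hγ with ⟨a, b⟩ | ⟨a, b⟩
        · exact Or.inl ⟨eq_pt_of h a e12.symm, eq_pt_of h b e13.symm⟩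
        · exact Or.inr ⟨eq_pt_of h a e12.symm, eq_pt_of h b e13.symm⟩
      · -- shape `(c, c, g)`: `α`
        obtain ⟨eg, a, b⟩ := shape_ccg hp h17 hu₁ hu₃ h12r h13r hc₁ e12.symm hc₃ (Ne.symm e13) hq₄ hR
        refine ⟨x₁, Or.inl ?_⟩
        rw [hsx]
        exact alpha_of_coords h hp h5 (eq_pt_of h a e12.symm) (eq_pt_of h b eg)
          (eq_pt_of h (by rw [e4, a, b]; ring_nf; decide) (by rw [e4', ← e12, eg]; ring))
    · by_cases e13 : (crt h x₁).2 = (crt h x₃).2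
      · -- shape `(c, g, c)`: `α` with `x₂, x₃` exchanged
        obtain ⟨eg, a, b⟩ := shape_ccg hp h17 hu₁ hu₂ h13r h12r hc₁ e13.symm hc₂ (Ne.symm e12) hq₄ (by rw [P132]; exact hR)
        refine ⟨x₁, Or.inl ?_⟩
        rw [hsx, show ({x₁, x₂, x₃, x₄} : Multiset (ZMod (18 * p))) = {x₁, x₃, x₂, x₄} by
          simp only [Multiset.insert_eq_cons, ← Multiset.singleton_add]; abel]
        exact alpha_of_coords h hp h5 (eq_pt_of h a e13.symm) (eq_pt_of h b eg)
          (eq_pt_of h (by rw [e4, a, b]; ring_nf; decide) (by rw [e4', ← e13, eg]; ring))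
      · by_cases e23 : (crt h x₂).2 = (crt h x₃).2
        · -- shape `(g, c, c)`: `α` based at `x₂`
          obtain ⟨eg, a, b⟩ := shape_ccg hp h17 hu₂ hu₁ (h12r.symm.trans h13r) h12r.symm hc₂ e23.symm hc₁ e12 hq₄
            (by rw [P23]; exact hR)
          refine ⟨x₂, Or.inl ?_⟩
          rw [hsx, show ({x₁, x₂, x₃, x₄} : Multiset (ZMod (18 * p))) = {x₂, x₃, x₁, x₄} by
            simp only [Multiset.insert_eq_cons, ← Multiset.singleton_add]; abel]
          exact alpha_of_coords h hp h5 (eq_pt_of h a e23.symm) (eq_pt_of h b eg)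
            (eq_pt_of h (by rw [e4, a, b]; ring_nf; decide) (by rw [e4', ← e23, eg]; ring))
        · -- pairwise distinct fibres
          exfalso
          exact k1_distinct hp h17 hu₁ hu₂ hu₃ h12r h13r hc₁ hc₂ hc₃ e12 e13 e23 hq₄ hR

/-! ### Case `k = 0`: no member divisible by `3` -/

/-- Pull a member back through `Multiset.map`. [folklore] -/
private theorem exists_cons_of_map_eq_cons {X Y : Type*} [DecidableEq X] [DecidableEq Y] (f : X → Y) {s : Multiset X}
    {b : Y} {t : Multiset Y} (h : s.map f = b ::ₘ t) : ∃ a s', s = a ::ₘ s' ∧ f a = b ∧ s'.map f = t := by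
  have hb : b ∈ s.map f := by rw [h]; exact Multiset.mem_cons_self _ _
  obtain ⟨a, ha, hfa⟩ := Multiset.mem_map.mp hb
  refine ⟨a, s.erase a, (Multiset.cons_erase ha).symm, hfa, ?_⟩
  rw [Multiset.map_erase_of_mem _ _ ha, h, hfa, Multiset.erase_cons_head]

/-- A residue whose reduction mod `6p` is `3w` is divisible by `3`. [folklore] -/
private theorem three_dvd_of_castHom [NeZero (18 * p)] (hp : 0 < p) (hnm : 6 * p ∣ 18 * p) {x : ZMod (18 * p)}
    {w : ZMod (6 * p)} (hx : ZMod.castHom hnm (ZMod (6 * p)) x = 3 * w) : x.val % 3 = 0 := by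
  haveI : NeZero (6 * p) := ⟨by omega⟩
  have hv := congrArg ZMod.val hx
  rw [val_castHom, ZMod.val_mul, show (3 : ZMod (6 * p)) = ((3 : ℕ) : ZMod (6 * p)) by norm_cast, ZMod.val_natCast,
    Nat.mod_eq_of_lt (show 3 < 6 * p by omega)] at hv
  have h3 : 3 ∣ 3 * w.val % (6 * p) := by
    refine Nat.dvd_of_mod_eq_zero ?_
    rw [Nat.mod_mod_of_dvd _ ⟨2 * p, by ring⟩, Nat.mul_mod_right]
  have hd := Nat.div_add_mod x.val (6 * p)
  rw [hv] at hd
  refine Nat.mod_eq_zero_of_dvd ?_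
  rw [← hd]
  exact dvd_add (dvd_mul_of_dvd_left ⟨2 * p, by ring⟩ _) h3

/-- The coordinates of four explicit points. [folklore] -/
private theorem map_crt_pts (h : Nat.Coprime 18 p) (u₁ u₂ u₃ u₄ : ZMod 18) (c₁ c₂ c₃ c₄ : ZMod p) :
    Multiset.map (crt h) {crtPt h u₁ c₁, crtPt h u₂ c₂, crtPt h u₃ c₃, crtPt h u₄ c₄} = {(u₁, c₁), (u₂, c₂), (u₃, c₃), (u₄, c₄)} := by
  simp only [Multiset.insert_eq_cons, Multiset.map_cons, Multiset.map_singleton, crt_pt]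

/-- **`k = 0`, `s mod 6p` pair-free:** `s mod 6p` is `β^{6p}` (`α^{6p}`, `γ^{6p}` contain a multiple of `3`), and of its lifts with
`Σ = 0` only `β_x` satisfies the relations at the fibres `c`, `c/2`. [cite: Shioda1982PicardFermat, Prop. 4 (Q′) p. 729]
[cite: AokiShioda1983, §2 Theorem (𝔅²ₘ) (ii) b), p. 3] -/
private theorem k0_pairfree (h : Nat.Coprime 18 p) [NeZero (18 * p)] (hp : p.Prime) (h17 : 17 ≤ p)
    {s : Multiset (ZMod (18 * p))} (hs : IsHodgeMultiset s) (hcard : Multiset.card s = 4)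
    (hn : ∀ w ∈ s, w.val % 3 ≠ 0) (hex : ∃ w ∈ s, (crt h w).2 ≠ 0) (hnm : 6 * p ∣ 18 * p) [NeZero (6 * p)]
    (hpair : ∀ a ∈ s.map (ZMod.castHom hnm (ZMod (6 * p))), ∀ b ∈ (s.map (ZMod.castHom hnm (ZMod (6 * p)))).erase a,
      a + b ≠ 0) : IsStdOrLift s := by
  classical
  haveI := Fact.mk hp
  have hp0 := hp.pos
  have h5 : 5 ≤ p := by omega
  have h2 := two_ne_zero' h17
  have hT := isHodgeMultiset_cast_eighteenPrime hp0 hnm hn hs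
  have hc4 : Multiset.card (s.map (ZMod.castHom hnm (ZMod (6 * p)))) = 4 := by rw [Multiset.card_map, hcard]
  obtain ⟨z, hz⟩ := classify_hodgeMultiset_sixPrime hp h17 hT hc4 hpair
  rcases hz with e | e | e
  · exfalso
    have hm : (K6 : ZMod (6 * p)) ∈ s.map (ZMod.castHom hnm (ZMod (6 * p))) := by rw [e]; simp
    obtain ⟨x, hx, hRx⟩ := Multiset.mem_map.mp hm
    exact hn x hx (three_dvd_of_castHom hp0 hnm (w := (p : ZMod (6 * p))) (by rw [hRx, Nat.cast_mul, Nat.cast_ofNat]))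
  · simp only [Multiset.insert_eq_cons] at e
    obtain ⟨x₁, s₁, hs₁, hx₁, e₁⟩ := exists_cons_of_map_eq_cons (ZMod.castHom hnm (ZMod (6 * p))) e
    obtain ⟨x₂, s₂, hs₂, hx₂, e₂⟩ := exists_cons_of_map_eq_cons (ZMod.castHom hnm (ZMod (6 * p))) e₁
    obtain ⟨x₃, s₃, hs₃, hx₃, e₃⟩ := exists_cons_of_map_eq_cons (ZMod.castHom hnm (ZMod (6 * p))) e₂
    rw [← Multiset.cons_zero] at e₃
    obtain ⟨x₄, s₄, hs₄, hx₄, e₄⟩ := exists_cons_of_map_eq_cons (ZMod.castHom hnm (ZMod (6 * p))) e₃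
    have hs₄0 : s₄ = 0 := Multiset.map_eq_zero.mp e₄
    have hsx : s = {x₁, x₂, x₃, x₄} := by rw [hs₁, hs₂, hs₃, hs₄, hs₄0]; rfl
    have hK : ZMod.castHom hnm (ZMod (6 * p)) K18 = K6 := castHom_K hnm
    obtain ⟨e₂', he₂, l₂⟩ := lift_eq h hp h5 hnm (a := x₂) (b := x₁ + K18) (by rw [_root_.map_add, hx₁, hK, hx₂])
    obtain ⟨e₃', he₃, l₃⟩ := lift_eq h hp h5 hnm (a := x₃) (b := 2 * x₁ + K18)
      (by rw [_root_.map_add, _root_.map_mul, map_ofNat, hx₁, hK, hx₃])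
    obtain ⟨e₄', -, l₄⟩ := lift_eq h hp h5 hnm (a := x₄) (b := -(4 * x₁))
      (by rw [_root_.map_neg, _root_.map_mul, map_ofNat, hx₁, hx₄])
    -- coordinates of `x₁`
    obtain ⟨u, c, ex₁⟩ : ∃ u c, x₁ = crtPt h u c := ⟨_, _, (pt_crt h x₁).symm⟩
    have t2 : (2 : ZMod (18 * p)) * crtPt h u c = crtPt h (2 * u) (2 * c) := by simpa using natCast_mul_pt h 2 u c
    have t4 : (4 : ZMod (18 * p)) * crtPt h u c = crtPt h (4 * u) (4 * c) := by simpa using natCast_mul_pt h 4 u c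
    have ex₂ : x₂ = crtPt h (u + 9 + e₂') c := by
      rw [l₂, ex₁, K_eq_pt h hp h5, pt_add, pt_add, add_zero, add_zero]
    have ex₃ : x₃ = crtPt h (2 * u + 9 + e₃') (2 * c) := by
      rw [l₃, ex₁, t2, K_eq_pt h hp h5, pt_add, pt_add, add_zero, add_zero]
    have ex₄ : x₄ = crtPt h (-(4 * u) + e₄') (-(4 * c)) := by
      rw [l₄, ex₁, t4, neg_pt, pt_add, add_zero]
    have hsx' : s = {crtPt h u c, crtPt h (u + 9 + e₂') c, crtPt h (2 * u + 9 + e₃') (2 * c),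
        crtPt h (-(4 * u) + e₄') (-(4 * c))} := by rw [hsx, ex₁, ex₂, ex₃, ex₄]
    have hu3 : u.val % 3 ≠ 0 := by
      have := hn x₁ (by rw [hsx]; simp)
      rwa [ex₁, ← fst_val_mod_three h, crt_pt] at this
    have hc0 : c ≠ 0 := by
      intro hc0
      obtain ⟨w, hw, hw0⟩ := hex
      rw [hsx'] at hw
      simp only [Multiset.insert_eq_cons, Multiset.mem_cons, Multiset.mem_singleton] at hw
      rcases hw with rfl | rfl | rfl | rfl <;> simp [crt_pt, hc0] at hw0
    -- `Σ = 0`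
    have h18 : (18 : ZMod 18) = 0 := by decide
    have hsum := hs.1.2
    rw [hsx'] at hsum
    simp only [Multiset.insert_eq_cons, Multiset.sum_cons, Multiset.sum_singleton, pt_add] at hsum
    rw [← pt_zero h, pt_inj] at hsum
    have hsumu : e₂' + e₃' + e₄' = 0 := by linear_combination hsum.1 - h18
    -- the relations at `c` and `c/2`
    have hRel := rels_of_isHodgeMultiset h hp h5 hs
    rw [hsx', map_crt_pts] at hRel
    set d : ZMod p := 2⁻¹ * c with hd
    have hd0 : d ≠ 0 := mul_ne_zero (inv_ne_zero h2) hc0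
    have ec : c = 2 * d := by rw [hd, ← mul_assoc, mul_inv_cancel₀ h2, one_mul]
    obtain ⟨r1, r2⟩ := rel_at hRel hc0
    obtain ⟨s1, s2⟩ := rel_at hRel hd0
    simp only [] at r1 r2 s1 s2
    have gA1 := fun v ↦ (contrib_fib hp h17 hc0 A1 B1 v).1
    have gA2 := fun v ↦ (contrib_fib hp h17 hc0 A2 B2 v).1
    have gB1 := fun v ↦ (contrib_fib hp h17 hc0 A1 B1 v).2.2.1
    have gB2 := fun v ↦ (contrib_fib hp h17 hc0 A2 B2 v).2.2.1
    have o4 : ∀ A B : ZMod 18 → ℤ, contrib A B c (-(4 * u) + e₄') (-(4 * c)) = 0 := fun A B ↦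
      off hp h17 hc0 (-4) 1 (by norm_num) (by norm_num) (by norm_num) A B _ (by push_cast; ring) (by ring)
    rw [gA1, gA1, gB1, o4] at r1
    rw [gA2, gA2, gB2, o4] at r2
    have f1 := fun v ↦ (contrib_fib hp h17 hd0 A1 B1 v).2.2.1
    have f2 := fun v ↦ (contrib_fib hp h17 hd0 A2 B2 v).2.2.1
    simp only [← ec] at f1 f2
    have o3 : ∀ A B : ZMod 18 → ℤ, contrib A B d (2 * u + 9 + e₃') (2 * c) = 0 := fun A B ↦
      off hp h17 hd0 4 1 (by norm_num) (by norm_num) (by norm_num) A B _ (by rw [ec]; ring) (by ring)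
    have o4' : ∀ A B : ZMod 18 → ℤ, contrib A B d (-(4 * u) + e₄') (-(4 * c)) = 0 := fun A B ↦
      off hp h17 hd0 (-8) 1 (by norm_num) (by norm_num) (by norm_num) A B _ (by rw [ec]; push_cast; ring) (by ring)
    rw [f1, f1, o3, o4'] at s1
    rw [f2, f2, o3, o4'] at s2
    obtain ⟨z2, z3⟩ := fin_beta u e₂' e₃' hu3 he₂ he₃ (by linarith) (by linarith) (by linarith) (by linarith)
    have z4 : e₄' = 0 := by rw [z2, z3, zero_add, zero_add] at hsumu; exact hsumu
    refine ⟨x₁, Or.inr (Or.inl ?_)⟩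
    rw [hsx, l₂, l₃, l₄, z2, z3, z4, pt_zero, add_zero, add_zero, add_zero]
  · exfalso
    have hm : -(3 * z) ∈ s.map (ZMod.castHom hnm (ZMod (6 * p))) := by rw [e]; simp
    obtain ⟨x, hx, hRx⟩ := Multiset.mem_map.mp hm
    exact hn x hx (three_dvd_of_castHom hp0 hnm (w := -z) (by rw [hRx]; ring))

/-- **`k = 0`, two pairs mod `6p`:** the coordinate multiset `{(u₁, f), (u₂, −f), (u₃, g), (u₄, −g)}`, `3 ∤ uᵢ`, `Σ uᵢ = 0`,
`u₁ + u₂ ∈ {6, 12}`, `f ≠ 0`, `f ∉ {±2g}`, pair-free, violates the relations (tables at `f`, `f/2`, `2f`). [folklore] -/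
private theorem k0_pairs_aux (hp : p.Prime) (h17 : 17 ≤ p) {u₁ u₂ u₃ u₄ : ZMod 18} (hu₁ : u₁.val % 3 ≠ 0)
    (hu₂ : u₂.val % 3 ≠ 0) (hu₃ : u₃.val % 3 ≠ 0) (hu₄ : u₄.val % 3 ≠ 0) (hsum : u₁ + u₂ + u₃ + u₄ = 0)
    (h12 : u₁ + u₂ = 6 ∨ u₁ + u₂ = 12) {f g : ZMod p} (hf : f ≠ 0) (hfg : f ≠ 2 * g ∧ f ≠ -(2 * g))
    (n14 : ¬ (u₁ + u₄ = 0 ∧ f + -g = 0)) (n23 : ¬ (u₂ + u₃ = 0 ∧ -f + g = 0)) (n13 : ¬ (u₁ + u₃ = 0 ∧ f + g = 0))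
    (n24 : ¬ (u₂ + u₄ = 0 ∧ -f + -g = 0))
    (hR : Rels ({(u₁, f), (u₂, -f), (u₃, g), (u₄, -g)} : Multiset (ZMod 18 × ZMod p))) : False := by
  haveI := Fact.mk hp
  have h2 := two_ne_zero' h17
  have e4 : u₄ = -(u₁ + u₂ + u₃) := by linear_combination hsum
  have e3 : u₃ = -(u₁ + u₂ + u₄) := by linear_combination hsum
  have hu₄' : (-(u₁ + u₂ + u₃)).val % 3 ≠ 0 := by rw [← e4]; exact hu₄
  have hu₃' : (-(u₁ + u₂ + u₄)).val % 3 ≠ 0 := by rw [← e3]; exact hu₃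
  have h34 : u₃ + u₄ ≠ 0 := by
    intro h0
    have e12 : u₁ + u₂ = 0 := by linear_combination hsum - h0
    rcases h12 with h | h <;> rw [e12] at h <;> exact absurd h (by decide)
  have Ae1 := fun e ↦ (tables_even e).1
  have Ae2 := fun e ↦ (tables_even e).2.1
  have Be1 := fun e ↦ (tables_even e).2.2.1
  have Be2 := fun e ↦ (tables_even e).2.2.2
  set d : ZMod p := 2⁻¹ * f with hd
  have hd0 : d ≠ 0 := mul_ne_zero (inv_ne_zero h2) hf
  have ef : f = 2 * d := by rw [hd, ← mul_assoc, mul_inv_cancel₀ h2, one_mul]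
  have h2f : (2 : ZMod p) * f ≠ 0 := mul_ne_zero h2 hf
  -- the relations at `f` and `f/2`: the members `(u₁, f)`, `(u₂, -f)` contribute `A(u₁), -A(u₂)` and `B(u₁), -B(u₂)`
  obtain ⟨r1, r2⟩ := rel_at hR hf
  obtain ⟨s1, s2⟩ := rel_at hR hd0
  simp only [] at r1 r2 s1 s2
  rw [(contrib_fib hp h17 hf A1 B1 u₁).1, (contrib_fib hp h17 hf A1 B1 u₂).2.1] at r1
  rw [(contrib_fib hp h17 hf A2 B2 u₁).1, (contrib_fib hp h17 hf A2 B2 u₂).2.1] at r2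
  have f1 := fun v ↦ (contrib_fib hp h17 hd0 A1 B1 v).2.2
  have f2 := fun v ↦ (contrib_fib hp h17 hd0 A2 B2 v).2.2
  simp only [← ef] at f1 f2
  rw [(f1 u₁).1, (f1 u₂).2] at s1
  rw [(f2 u₁).1, (f2 u₂).2] at s2
  -- the off-fibre facts for the parameters `2f` and `f/2`
  have o : ∀ (A B : ZMod 18 → ℤ) (v : ZMod 18), contrib A B (2 * f) v f = 0 ∧ contrib A B (2 * f) v (-f) = 0 ∧
      contrib A B d v (2 * f) = 0 ∧ contrib A B d v (-(2 * f)) = 0 := fun A B v ↦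
    ⟨off hp h17 hf 1 2 (by norm_num) (by norm_num) (by norm_num) A B v (by ring) (by ring),
      off hp h17 hf (-1) 2 (by norm_num) (by norm_num) (by norm_num) A B v (by push_cast; ring) (by ring),
      off hp h17 hd0 4 1 (by norm_num) (by norm_num) (by norm_num) A B v (by rw [ef]; ring) (by ring),
      off hp h17 hd0 (-4) 1 (by norm_num) (by norm_num) (by norm_num) A B v (by rw [ef]; push_cast; ring) (by ring)⟩
  by_cases e1 : g = f
  · rw [e1] at r1 r2 s1 s2
    rw [(contrib_fib hp h17 hf A1 B1 u₃).1, (contrib_fib hp h17 hf A1 B1 u₄).2.1, e4, Ae1] at r1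
    rw [(contrib_fib hp h17 hf A2 B2 u₃).1, (contrib_fib hp h17 hf A2 B2 u₄).2.1, e4, Ae2] at r2
    rw [(f1 u₃).1, (f1 u₄).2, e4, Be1] at s1
    rw [(f2 u₃).1, (f2 u₄).2, e4, Be2] at s2
    refine fin_pm_c u₁ u₂ u₃ hu₁ hu₂ hu₃ hu₄' h12 ?_ ?_ (by linarith) (by linarith) (by linarith) (by linarith)
    · intro e; exact n14 ⟨by rw [e4]; linear_combination e, by rw [e1]; ring⟩
    · intro e; exact n23 ⟨by linear_combination e, by rw [e1]; ring⟩
  by_cases e2 : g = -f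
  · rw [e2, neg_neg] at r1 r2 s1 s2
    rw [(contrib_fib hp h17 hf A1 B1 u₃).2.1, (contrib_fib hp h17 hf A1 B1 u₄).1, e3, Ae1] at r1
    rw [(contrib_fib hp h17 hf A2 B2 u₃).2.1, (contrib_fib hp h17 hf A2 B2 u₄).1, e3, Ae2] at r2
    rw [(f1 u₃).2, (f1 u₄).1, e3, Be1] at s1
    rw [(f2 u₃).2, (f2 u₄).1, e3, Be2] at s2
    refine fin_pm_c u₁ u₂ u₄ hu₁ hu₂ hu₄ hu₃' h12 ?_ ?_ (by linarith) (by linarith) (by linarith) (by linarith)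
    · intro e; exact n13 ⟨by rw [e3]; linear_combination e, by rw [e2]; ring⟩
    · intro e; exact n24 ⟨by linear_combination e, by rw [e2]; ring⟩
  by_cases e3c : g = 2 * f
  · rw [e3c] at hR r1 r2 s1 s2
    obtain ⟨t1, t2⟩ := rel_at hR h2f
    simp only [] at t1 t2
    rw [(contrib_fib hp h17 hf A1 B1 u₃).2.2.1, (contrib_fib hp h17 hf A1 B1 u₄).2.2.2, e4, Be1] at r1
    rw [(contrib_fib hp h17 hf A2 B2 u₃).2.2.1, (contrib_fib hp h17 hf A2 B2 u₄).2.2.2, e4, Be2] at r2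
    rw [(o A1 B1 u₃).2.2.1, (o A1 B1 u₄).2.2.2] at s1
    rw [(o A2 B2 u₃).2.2.1, (o A2 B2 u₄).2.2.2] at s2
    rw [(o A1 B1 u₁).1, (o A1 B1 u₂).2.1, (contrib_fib hp h17 h2f A1 B1 u₃).1, (contrib_fib hp h17 h2f A1 B1 u₄).2.1, e4,
      Ae1] at t1
    rw [(o A2 B2 u₁).1, (o A2 B2 u₂).2.1, (contrib_fib hp h17 h2f A2 B2 u₃).1, (contrib_fib hp h17 h2f A2 B2 u₄).2.1, e4,
      Ae2] at t2
    exact fin_pm_2c u₁ u₂ u₃ hu₁ hu₂ hu₃ hu₄' h12 (fun e ↦ h34 (by rw [e4]; linear_combination e)) (by linarith)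
      (by linarith) (by linarith) (by linarith) (by linarith) (by linarith)
  by_cases e4c : g = -(2 * f)
  · rw [e4c, neg_neg] at hR r1 r2 s1 s2
    obtain ⟨t1, t2⟩ := rel_at hR h2f
    simp only [] at t1 t2
    rw [(contrib_fib hp h17 hf A1 B1 u₃).2.2.2, (contrib_fib hp h17 hf A1 B1 u₄).2.2.1, e3, Be1] at r1
    rw [(contrib_fib hp h17 hf A2 B2 u₃).2.2.2, (contrib_fib hp h17 hf A2 B2 u₄).2.2.1, e3, Be2] at r2
    rw [(o A1 B1 u₃).2.2.2, (o A1 B1 u₄).2.2.1] at s1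
    rw [(o A2 B2 u₃).2.2.2, (o A2 B2 u₄).2.2.1] at s2
    rw [(o A1 B1 u₁).1, (o A1 B1 u₂).2.1, (contrib_fib hp h17 h2f A1 B1 u₃).2.1, (contrib_fib hp h17 h2f A1 B1 u₄).1, e3,
      Ae1] at t1
    rw [(o A2 B2 u₁).1, (o A2 B2 u₂).2.1, (contrib_fib hp h17 h2f A2 B2 u₃).2.1, (contrib_fib hp h17 h2f A2 B2 u₄).1, e3,
      Ae2] at t2
    exact fin_pm_2c u₁ u₂ u₄ hu₁ hu₂ hu₄ hu₃' h12 (fun e ↦ h34 (by rw [e3]; linear_combination e)) (by linarith)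
      (by linarith) (by linarith) (by linarith) (by linarith) (by linarith)
  -- generic second pair: `(u₃, g)`, `(u₄, -g)` contribute nothing at `f` and `f/2`
  have ng1 : -g ≠ f := fun e ↦ e2 (by linear_combination -e)
  have ng2 : -g ≠ -f := fun e ↦ e1 (neg_injective e)
  have ng3 : -g ≠ 2 * f := fun e ↦ e4c (by linear_combination -e)
  have ng4 : -g ≠ -(2 * f) := fun e ↦ e3c (neg_injective e)
  have gd1 : g ≠ d := fun e ↦ hfg.1 (by rw [ef, e])
  have gd2 : g ≠ -d := fun e ↦ hfg.2 (by rw [ef, e]; ring)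
  have gd3 : g ≠ 2 * d := by rw [← ef]; exact e1
  have gd4 : g ≠ -(2 * d) := by rw [← ef]; exact e2
  have md1 : -g ≠ d := fun e ↦ gd2 (by linear_combination -e)
  have md2 : -g ≠ -d := fun e ↦ gd1 (neg_injective e)
  have md3 : -g ≠ 2 * d := by rw [← ef]; exact ng1
  have md4 : -g ≠ -(2 * d) := by rw [← ef]; exact ng2
  rw [contrib_off A1 B1 u₃ e1 e2 e3c e4c, contrib_off A1 B1 u₄ ng1 ng2 ng3 ng4] at r1
  rw [contrib_off A2 B2 u₃ e1 e2 e3c e4c, contrib_off A2 B2 u₄ ng1 ng2 ng3 ng4] at r2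
  rw [contrib_off A1 B1 u₃ gd1 gd2 gd3 gd4, contrib_off A1 B1 u₄ md1 md2 md3 md4] at s1
  rw [contrib_off A2 B2 u₃ gd1 gd2 gd3 gd4, contrib_off A2 B2 u₄ md1 md2 md3 md4] at s2
  exact fin_shift u₁ u₂ hu₁ h12 (by linarith) (by linarith) (by linarith) (by linarith)

/-- **`k = 0`, two pairs mod `6p`: excluded** (the pairs exchanged when `f = ±2g`). [folklore] -/
private theorem k0_pairs (hp : p.Prime) (h17 : 17 ≤ p) {u₁ u₂ u₃ u₄ : ZMod 18} (hu₁ : u₁.val % 3 ≠ 0)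
    (hu₂ : u₂.val % 3 ≠ 0) (hu₃ : u₃.val % 3 ≠ 0) (hu₄ : u₄.val % 3 ≠ 0) (hsum : u₁ + u₂ + u₃ + u₄ = 0)
    (h12 : u₁ + u₂ = 6 ∨ u₁ + u₂ = 12) (h34 : u₃ + u₄ = 6 ∨ u₃ + u₄ = 12) {f g : ZMod p} (hf : f ≠ 0)
    (n14 : ¬ (u₁ + u₄ = 0 ∧ f + -g = 0)) (n23 : ¬ (u₂ + u₃ = 0 ∧ -f + g = 0)) (n13 : ¬ (u₁ + u₃ = 0 ∧ f + g = 0))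
    (n24 : ¬ (u₂ + u₄ = 0 ∧ -f + -g = 0))
    (hR : Rels ({(u₁, f), (u₂, -f), (u₃, g), (u₄, -g)} : Multiset (ZMod 18 × ZMod p))) : False := by
  by_cases hfg : f = 2 * g ∨ f = -(2 * g)
  · have hg : g ≠ 0 := by
      rintro rfl
      rcases hfg with e | e <;> exact hf (by simpa using e)
    have K : ∀ i j : ℤ, i ≠ j → |i| ≤ 8 → |j| ≤ 8 → (i : ZMod p) * f ≠ (j : ZMod p) * f :=
      fun i j hij hi hj ↦ kb_ne hp h17 hf hij hi hj
    have hgf : g ≠ 2 * f ∧ g ≠ -(2 * f) := by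
      constructor
      · intro e
        rcases hfg with e' | e'
        · exact K 1 4 (by norm_num) (by norm_num) (by norm_num) (by push_cast; linear_combination e' + 2 * e)
        · exact K 1 (-4) (by norm_num) (by norm_num) (by norm_num) (by push_cast; linear_combination e' - 2 * e)
      · intro e
        rcases hfg with e' | e'
        · exact K 1 (-4) (by norm_num) (by norm_num) (by norm_num) (by push_cast; linear_combination e' + 2 * e)
        · exact K 1 4 (by norm_num) (by norm_num) (by norm_num) (by push_cast; linear_combination e' - 2 * e)
    have P : ({(u₃, g), (u₄, -g), (u₁, f), (u₂, -f)} : Multiset (ZMod 18 × ZMod p)) =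
        {(u₁, f), (u₂, -f), (u₃, g), (u₄, -g)} := by
      simp only [Multiset.insert_eq_cons, ← Multiset.singleton_add]; abel
    refine k0_pairs_aux hp h17 hu₃ hu₄ hu₁ hu₂ (by linear_combination hsum) h34 hg hgf ?_ ?_ ?_ ?_ (by rw [P]; exact hR)
    · exact fun ⟨a, b⟩ ↦ n23 ⟨by linear_combination a, by linear_combination b⟩
    · exact fun ⟨a, b⟩ ↦ n14 ⟨by linear_combination a, by linear_combination b⟩
    · exact fun ⟨a, b⟩ ↦ n13 ⟨by linear_combination a, by linear_combination b⟩
    · exact fun ⟨a, b⟩ ↦ n24 ⟨by linear_combination a, by linear_combination b⟩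
  · push Not at hfg
    exact k0_pairs_aux hp h17 hu₁ hu₂ hu₃ hu₄ hsum h12 hf hfg n14 n23 n13 n24 hR

/-- A pair mod `6p` which is not a pair: first coordinates summing to `6` or `12`, opposite fibres. [folklore] -/
private theorem pair_mod (h : Nat.Coprime 18 p) [NeZero (18 * p)] (hp : p.Prime) (h5 : 5 ≤ p) (hnm : 6 * p ∣ 18 * p)
    {a b : ZMod (18 * p)} (hab : a + b ≠ 0) (h0 : ZMod.castHom hnm (ZMod (6 * p)) (a + b) = 0) :
    ((crt h a).1 + (crt h b).1 = 6 ∨ (crt h a).1 + (crt h b).1 = 12) ∧ (crt h b).2 = -(crt h a).2 := by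
  have key : ∀ {e : ZMod 18}, (e = 6 ∨ e = 12) → crt h (a + b) = (e, 0) →
      ((crt h a).1 + (crt h b).1 = 6 ∨ (crt h a).1 + (crt h b).1 = 12) ∧ (crt h b).2 = -(crt h a).2 := by
    intro e he hq
    simp only [_root_.map_add, Prod.ext_iff, Prod.fst_add, Prod.snd_add] at hq
    exact ⟨by rw [hq.1]; exact he, by linear_combination hq.2⟩
  rcases (castHom_eq_zero_iff hp.pos hnm).mp h0 with e0 | e0 | e0
  · exact absurd e0 hab
  · rcases crt_D h hp h5 with ⟨hD, -⟩ | ⟨hD, -⟩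
    · exact key (Or.inl rfl) (by rw [e0, hD])
    · exact key (Or.inr rfl) (by rw [e0, hD])
  · rcases crt_D h hp h5 with ⟨-, hD⟩ | ⟨-, hD⟩
    · exact key (Or.inr rfl) (by rw [e0, hD])
    · exact key (Or.inl rfl) (by rw [e0, hD])

/-- **`k = 0`: all four members prime to `3`, not all in the fibre `0` ⇒ `β`.** [cite: Shioda1982PicardFermat, Prop. 4 (Q′) p. 729]
[cite: AokiShioda1983, §2 Theorem (𝔅²ₘ) (ii) b), p. 3] -/
private theorem case_k0 (h : Nat.Coprime 18 p) [NeZero (18 * p)] (hp : p.Prime) (h17 : 17 ≤ p)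
    {s : Multiset (ZMod (18 * p))} (hs : IsHodgeMultiset s) (hcard : Multiset.card s = 4)
    (hpf : ∀ a ∈ s, ∀ b ∈ s.erase a, a + b ≠ 0) (hn : ∀ w ∈ s, w.val % 3 ≠ 0) (hex : ∃ w ∈ s, (crt h w).2 ≠ 0) :
    IsStdOrLift s := by
  classical
  haveI := Fact.mk hp
  have hp0 := hp.pos
  have h5 : 5 ≤ p := by omega
  haveI : NeZero (6 * p) := ⟨by omega⟩
  have hnm : 6 * p ∣ 18 * p := ⟨3, by ring⟩
  by_cases hpair : ∀ a ∈ s.map (ZMod.castHom hnm (ZMod (6 * p))),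
    ∀ b ∈ (s.map (ZMod.castHom hnm (ZMod (6 * p)))).erase a, a + b ≠ 0
  · exact k0_pairfree h hp h17 hs hcard hn hex hnm hpair
  exfalso
  push Not at hpair
  obtain ⟨a', ha', b', hb', hab⟩ := hpair
  obtain ⟨a, ha, rfl⟩ := Multiset.mem_map.mp ha'
  rw [← Multiset.map_erase_of_mem _ _ ha] at hb'
  obtain ⟨b, hb, rfl⟩ := Multiset.mem_map.mp hb'
  -- the other two members
  have hc2 : Multiset.card ((s.erase a).erase b) = 2 := by
    have := Multiset.card_erase_add_one hb; have := Multiset.card_erase_add_one ha; omega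
  obtain ⟨c, d, hcd⟩ := Multiset.card_eq_two.mp hc2
  have hsx : s = {a, b, c, d} := by rw [← Multiset.cons_erase ha, ← Multiset.cons_erase hb, hcd]; rfl
  obtain ⟨p12, p13, p14, p23, p24, p34⟩ := six_pairs hsx hpf
  have hab0 : ZMod.castHom hnm (ZMod (6 * p)) (a + b) = 0 := by rw [_root_.map_add, hab]
  have hsum := hs.1.2
  rw [hsx] at hsum
  simp only [Multiset.insert_eq_cons, Multiset.sum_cons, Multiset.sum_singleton] at hsum
  have hcd0 : ZMod.castHom hnm (ZMod (6 * p)) (c + d) = 0 := by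
    rw [show c + d = -(a + b) by linear_combination hsum, _root_.map_neg, hab0, neg_zero]
  obtain ⟨uab, fab⟩ := pair_mod h hp h5 hnm p12 hab0
  obtain ⟨ucd, fcd⟩ := pair_mod h hp h5 hnm p34 hcd0
  have hR := rels_of_isHodgeMultiset h hp h5 hs
  have hu : ∀ w ∈ s, (crt h w).1.val % 3 ≠ 0 := fun w hw ↦ by rw [fst_val_mod_three]; exact hn w hw
  have hsum1 : (crt h a).1 + (crt h b).1 + (crt h c).1 + (crt h d).1 = 0 := by
    have := congrArg (fun w ↦ (crt h w).1) hsum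
    simpa only [_root_.map_add, Prod.fst_add, _root_.map_zero, Prod.fst_zero, add_assoc] using this
  have pne : ∀ {x y : ZMod (18 * p)}, x + y ≠ 0 → ¬ ((crt h x).1 + (crt h y).1 = 0 ∧ (crt h x).2 + (crt h y).2 = 0) := by
    rintro x y hxy ⟨e1, e2⟩
    apply hxy
    rw [← pt_crt h x, ← pt_crt h y, pt_add, e1, e2, pt_zero]
  have ma : a ∈ s := by rw [hsx]; simp
  have mb : b ∈ s := by rw [hsx]; simp
  have mc : c ∈ s := by rw [hsx]; simp
  have md : d ∈ s := by rw [hsx]; simp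
  by_cases hf : (crt h a).2 = 0
  · -- the pair `a, b` lies in the fibre `0`: base the argument on the pair `c, d`
    have hg : (crt h c).2 ≠ 0 := by
      intro hg
      obtain ⟨w, hw, hw0⟩ := hex
      rw [hsx] at hw
      simp only [Multiset.insert_eq_cons, Multiset.mem_cons, Multiset.mem_singleton] at hw
      rcases hw with rfl | rfl | rfl | rfl
      · exact hw0 hf
      · exact hw0 (by rw [fab, hf, neg_zero])
      · exact hw0 hg
      · exact hw0 (by rw [fcd, hg, neg_zero])
    rw [hsx, show ({a, b, c, d} : Multiset (ZMod (18 * p))) = {c, d, a, b} by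
      simp only [Multiset.insert_eq_cons, ← Multiset.singleton_add]; abel, map_crt_four, fcd, fab] at hR
    refine k0_pairs hp h17 (hu c mc) (hu d md) (hu a ma) (hu b mb) (by linear_combination hsum1) ucd uab hg
      ?_ ?_ ?_ ?_ hR
    · rw [← fab]; exact pne (by rw [add_comm]; exact p23)
    · rw [← fcd]; exact pne (by rw [add_comm]; exact p14)
    · exact pne (by rw [add_comm]; exact p13)
    · rw [← fab, ← fcd]; exact pne (by rw [add_comm]; exact p24)
  · rw [hsx, map_crt_four, fcd, fab] at hR
    refine k0_pairs hp h17 (hu a ma) (hu b mb) (hu c mc) (hu d md) hsum1 uab ucd hf ?_ ?_ ?_ ?_ hR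
    · rw [← fcd]; exact pne p14
    · rw [← fab]; exact pne p23
    · exact pne p13
    · rw [← fab, ← fcd]; exact pne p24

/-! ### Assembly -/

/-- **The pair-free Hodge `4`-multisets of level `18p`, `p ≥ 17` prime** (Shioda's `(Q′)` at `m = 18p` together with the lifted
exceptional quadruples of level `18`): a Hodge multiset `s` over `ℤ/18p` with four members and no pair `{a, −a}` is
`α_x = {x, x + 9p, −2x, 9p}`, `β_x = {x, x + 9p, 2x + 9p, −4x}`, `γ_x = {x, x + 6p, x + 12p, −3x}`, or `x·{1, 6, 14, 15}`,
`x·{1, 7, 12, 16}`, `x·{1, 9, 12, 14}` with `x = tp`, `t ∈ {1, 5, 7, 11, 13, 17}` (the unit multiples, times `p`, of the three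
exceptional quadruples of level `18` of Shioda's table / Meyer–Neutsch's Tabelle 1). The hypothesis `p ≥ 17` excludes `p = 11, 13`,
where the exceptional quadruples of the levels `66`, `78` lift as well. Proof: this file (CRT coordinates, the Koblitz–Ogus relations
of `KoblitzOgusRelationsEighteenPrime`, the transfers to level `6p` and `classify_hodgeMultiset_sixPrime`, a norm estimate, and a
kernel enumeration at level `18`). [cite: Shioda1982PicardFermat, §4 Lemma 1 p. 728, Prop. 4 (Q′) p. 729, table p. 727 (m = 18)]
[cite: AokiShioda1983, §2 Theorem (𝔅²ₘ) (ii) a)–c), p. 3] [cite: MeyerNeutsch1981Fermatquadrupel, Tabelle 1 p. 54 (N = 18)] -/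
theorem classify_hodgeMultiset_eighteenPrime [NeZero (18 * p)] (hp : p.Prime) (h17 : 17 ≤ p) {s : Multiset (ZMod (18 * p))}
    (hs : IsHodgeMultiset s) (hcard : Multiset.card s = 4) (hind : ∀ a ∈ s, ∀ b ∈ s.erase a, a + b ≠ 0) :
    ∃ x : ZMod (18 * p), s = {x, x + K18, -(2 * x), K18} ∨ s = {x, x + K18, 2 * x + K18, -(4 * x)} ∨
      s = {x, x + D18, x + 2 * D18, -(3 * x)} ∨
      ((∃ t : ℕ, (t = 1 ∨ t = 5 ∨ t = 7 ∨ t = 11 ∨ t = 13 ∨ t = 17) ∧ x = ((t * p : ℕ) : ZMod (18 * p))) ∧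
        (s = {x, 6 * x, 14 * x, 15 * x} ∨ s = {x, 7 * x, 12 * x, 16 * x} ∨ s = {x, 9 * x, 12 * x, 14 * x})) := by
  classical
  have h5 : 5 ≤ p := by omega
  have h := coprime_eighteen hp h5
  suffices H : IsStdOrLift s from H
  by_cases hex : ∃ w ∈ s, (crt h w).2 ≠ 0
  swap
  · push Not at hex
    exact fibre_zero h hp hs hcard hind hex
  -- split off the members divisible by `3`
  obtain ⟨sd, sn, hs', hd, hn'⟩ : ∃ sd sn : Multiset (ZMod (18 * p)), s = sd + sn ∧ (∀ w ∈ sd, w.val % 3 = 0) ∧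
      ∀ w ∈ sn, w.val % 3 ≠ 0 :=
    ⟨s.filter (fun w ↦ w.val % 3 = 0), s.filter (fun w ↦ ¬ w.val % 3 = 0), (Multiset.filter_add_not _ s).symm,
      fun w hw ↦ (Multiset.mem_filter.mp hw).2, fun w hw ↦ (Multiset.mem_filter.mp hw).2⟩
  have hc : Multiset.card sd + Multiset.card sn = 4 := by rw [← Multiset.card_add, ← hs', hcard]
  obtain ⟨k, hk⟩ : ∃ k, Multiset.card sd = k := ⟨_, rfl⟩
  have hk4 : k ≤ 4 := by omega
  interval_cases k
  · -- `k = 0`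
    have hsd0 : sd = 0 := Multiset.card_eq_zero.mp hk
    rw [hsd0, zero_add] at hs'
    exact case_k0 h hp h17 hs hcard hind (fun w hw ↦ hn' w (hs' ▸ hw)) hex
  · -- `k = 1`
    obtain ⟨x₄, hx₄⟩ := Multiset.card_eq_one.mp hk
    obtain ⟨x₁, x₂, x₃, hx⟩ := Multiset.card_eq_three.mp (show Multiset.card sn = 3 by omega)
    have hsx : s = {x₁, x₂, x₃, x₄} := by
      rw [hs', hx₄, hx]; simp only [Multiset.insert_eq_cons, ← Multiset.singleton_add]; abel
    exact case_k1 h hp h17 hs hind hsx (hn' x₁ (by rw [hx]; simp)) (hn' x₂ (by rw [hx]; simp)) (hn' x₃ (by rw [hx]; simp))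
      (hd x₄ (by rw [hx₄]; simp)) hex
  · -- `k = 2`
    exfalso
    obtain ⟨x₃, x₄, hx34⟩ := Multiset.card_eq_two.mp hk
    obtain ⟨x₁, x₂, hx12⟩ := Multiset.card_eq_two.mp (show Multiset.card sn = 2 by omega)
    have hsx : s = {x₁, x₂, x₃, x₄} := by
      rw [hs', hx34, hx12]; simp only [Multiset.insert_eq_cons, ← Multiset.singleton_add]; abel
    exact case_k2 h hp h17 hs hind hsx (hn' x₁ (by rw [hx12]; simp)) (hn' x₂ (by rw [hx12]; simp))
      (hd x₃ (by rw [hx34]; simp)) (hd x₄ (by rw [hx34]; simp)) hex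
  · -- `k = 3` contradicts `Σ u = 0`
    exfalso
    obtain ⟨a, b, c, habc⟩ := Multiset.card_eq_three.mp hk
    obtain ⟨w, hw⟩ := Multiset.card_eq_one.mp (show Multiset.card sn = 1 by omega)
    have hsum := hs.1.2
    rw [hs', habc, hw] at hsum
    simp only [Multiset.sum_add, Multiset.insert_eq_cons, Multiset.sum_cons, Multiset.sum_singleton] at hsum
    have e : (crt h w).1 = -((crt h a).1 + (crt h b).1 + (crt h c).1) := by
      have := congrArg (fun z ↦ (crt h z).1) hsum
      simp only [_root_.map_add, Prod.fst_add, _root_.map_zero, Prod.fst_zero] at this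
      linear_combination this
    have h3 := fin_k3 (crt h a).1 (crt h b).1 (crt h c).1 (by rw [fst_val_mod_three]; exact hd a (by rw [habc]; simp))
      (by rw [fst_val_mod_three]; exact hd b (by rw [habc]; simp)) (by rw [fst_val_mod_three]; exact hd c (by rw [habc]; simp))
    rw [← e, fst_val_mod_three] at h3
    exact hn' w (by rw [hw]; simp) h3
  · -- `k = 4`
    have hsn0 : sn = 0 := Multiset.card_eq_zero.mp (by omega)
    rw [hsn0, add_zero] at hs'
    exact case_T hp h17 hs hcard hind (fun w hw ↦ hd w (hs' ▸ hw))


end EighteenPrime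

end Literature.AlgebraicGeometry.Shioda1982
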